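import Summits.CriticalPhenomena.SAWScalingLimit.Theses.SAWHexUniversality
import Summits.CriticalPhenomena.SAWScalingLimit.Theses.SAWDefectDecoherence
import Summits.CriticalPhenomena.SAWScalingLimit.Theses.SAWDevelopingMap
import Summits.CriticalPhenomena.SAWScalingLimit.Theses.SAWBrickWallHomotopy
import Summits.CriticalPhenomena.SAWScalingLimit.Theorems.HexConjecture.Negative.BoundaryWitness
import Literature.Probability.RandomPlanarGeometry.HullRestrictionSLEHolds
import Literature.Probability.RandomPlanarGeometry.SAWSideProbability
import Summits.CriticalPhenomena.SAWScalingLimit.Theorems.SAWDevelopingMapHexConjectureCurveUpgradeMain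
import Summits.CriticalPhenomena.SAWScalingLimit.Theorems.SAWDevelopingMapHexConjectureRangeIdentification
import Summits.CriticalPhenomena.SAWScalingLimit.Theorems.SAWDevelopingMapHexConjectureAvoidanceCocycle
import Summits.CriticalPhenomena.SAWScalingLimit.Theorems.SAWDevelopingMapHexConjectureAvoidanceCocycleFloor
import Summits.CriticalPhenomena.SAWScalingLimit.Theorems.SAWDevelopingMapHexConjectureAvoidanceCocycleArch
import Summits.CriticalPhenomena.SAWScalingLimit.Theorems.SAWDevelopingMapHexConjectureRangeIdentificationFloor
import Summits.CriticalPhenomena.SAWScalingLimit.Theorems.SAWDevelopingMapHexConjectureRestrictionCocycleOfRatioModulus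
import Summits.CriticalPhenomena.SAWScalingLimit.Theorems.SAWDevelopingMapObservableToSLETargetTransport
import Summits.CriticalPhenomena.SAWScalingLimit.Theorems.SAWDevelopingMapHexConjectureFloorRatioAssembly
import Summits.CriticalPhenomena.SAWScalingLimit.Theorems.SAWDevelopingMapHexConjectureRestrictionCocycleOfWindowLocality
import Summits.CriticalPhenomena.SAWScalingLimit.Theorems.SAWDevelopingMapHexConjectureRestrictionCocycleOfAspectBound
import Summits.CriticalPhenomena.SAWScalingLimit.Theorems.SAWDevelopingMapHexConjectureAspectBoundOfWindowTwoPoint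
import Summits.CriticalPhenomena.SAWScalingLimit.Theorems.SAWDevelopingMapHexConjectureWindowMassCubeMain
import Summits.CriticalPhenomena.SAWScalingLimit.Theorems.SAWDevelopingMapHexConjectureTwoPointTailBound
import Summits.CriticalPhenomena.SAWScalingLimit.Theorems.SAWDevelopingMapHexConjectureWindowTwoPointOfTailFraction
import Summits.CriticalPhenomena.SAWScalingLimit.Theorems.SAWDevelopingMapHexConjectureWindowTwoPointOfReg
import Summits.CriticalPhenomena.SAWScalingLimit.Theorems.SAWDevelopingMapHexConjectureKPAnalyticLocal
import Summits.CriticalPhenomena.SAWScalingLimit.Theorems.SAWDevelopingMapHexConjectureKPTransferAt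
import Summits.CriticalPhenomena.SAWScalingLimit.Theorems.SAWDevelopingMapHexConjectureDoublingEventually
import Summits.CriticalPhenomena.SAWScalingLimit.Theorems.SAWDevelopingMapHexConjectureTriDlStep
import Summits.CriticalPhenomena.SAWScalingLimit.Theorems.SAWDevelopingMapHexConjectureTriDlLowerBound
import Summits.CriticalPhenomena.SAWScalingLimit.Theorems.SAWDevelopingMapHexConjectureWindowTwoPointOfSideFloor
import Summits.CriticalPhenomena.SAWScalingLimit.Theorems.SAWDevelopingMapHexConjectureBochnerIneqOfPositivity
import Summits.CriticalPhenomena.SAWScalingLimit.Theorems.SAWDevelopingMapHexConjectureRegOfBochnerAvgTail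
import Summits.CriticalPhenomena.SAWScalingLimit.Theorems.HexConjecture.Negative.NonVacuity

/-!
(v13 — c12, 17:40Z: wave 1 LANDED both glue stubs — `stub_bochnerIneq_of_positivity` p171006, `stub_reg_of_bochner_avgTail` p171196 — so
`REG ⟸ HalfPlaneGramPositivity ∧ AverageTailFraction` is a KERNEL FACT; registered (sorried, 7): FRL, WTLB, GramPositivity, AvgTF, SFB, UIM, (E).)
(v12 — lead seat c12, 2026-08-17T16:40Z) ADOPTION of crux-strategist s3's alternative line `boundary-gram-bochner-regularity`
(`Lines/boundary_gram_bochner_regularity.{lean,md}`): the T-side stuck node REG is re-sourced as `REG ⟸ HalfPlaneGramPositivity ∧ AverageTailFraction`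
through two PROVABLE glue stubs (`stub_bochnerIneq_of_positivity`, `stub_reg_of_bochner_avgTail`, wave 1 of this seat) — see the section
"(c12 ← crux-strategist s3)".  Registered (sorried) stubs, cap 7: stub_floorRatioLimit, stub_windowTwoPointLowerBound, stub_halfPlaneGramPositivity,
stub_bochnerIneq_of_positivity, stub_reg_of_bochner_avgTail, stub_uniformModulus, stub_boundaryUniversality; REG / doubling / SFB are
hypothesis-level Props in v12 (SFB and `stub_averageTailFraction` are registered in v13 once the glue stubs land).  PRIMARY composition unchanged
(`HexConjecture_of` over the four split children); compositions whose hypotheses are not all declared stubs conclude the `SAWDevelopingMap` clone.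
NUMERICS of this seat (kit j025472, `Lines/root_locality_replaces_loewner_c12.md`): SFB ratio = parameter-free CFT prediction within 0.6 % (12 ≤ L ≤ 128),
doubling ratio → 0.844 ≫ 1/2, Gram-positivity margin `D(q) ≈ 0.37 q > 0`.

# Line `root-locality-replaces-loewner` — crux `HexConjecture` (stmt-CriticalPhenomena-0808; decl `SAWHexUniversality.HexConjecture` = `SAWDefectDecoherence.HexConjecture`, shared by 4 routes)

LEAD CONTINUATION c11 (prover-line-stmt-CriticalPhenomena-0808-c11-0, 2026-08-17) — TENTH/ELEVENTH RESHAPE: THE A-PRIORI ENVELOPE OF THE LEVER'S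
SEQUENCE IS NOW UNCONDITIONAL, AND THE LEVER HAS TWO SOURCES.  (i) LANDED (`--supports` this item): `…TriDlStep` p151051 (`stub_triDlStep`:
`(2−√2)·triDl L ≤ triDl (L+1)`, the only scale with an `O(1)`-cost extension), `…TriDlLowerBound` p151606 (`stub_triDlLowerBound`: `∃ m>0, m/(L+1) ≤ triDl L`)
over the new Literature file `HexSAWStripIdentity` p150948/p152064 (Duminil-Copin–Smirnov's dichotomy resolved: `E_{T,L}` is non-decreasing in `T` and
`E_T ≤ (2cos(π/8)/c_ε)·triDl ⌊(T−1)/2⌋ → 0`, so **`E_T(x_c) = 0`**, the strip identity `c_α A_T + B_T = 1` (Glazman–Manolescu Cor. 2.3), `B_T` antitone,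
`B_T ≥ m/T` and `Σ B_T = ∞` UNCONDITIONALLY — the tree had them only under the refuted `Summable` hypothesis), and `…WindowTwoPointOfSideFloor` p153382
(`stub_windowTwoPoint_of_sideFloorComparison`: SFB ⟹ WTLB by exact restriction, `T_x(⌊R/4⌋) ⊆ B_R(x)`).  (ii) RESHAPE v10/v11: `stub_observableLimit`
(= stmt-14003 verbatim) RETIRED from the registered list; crux-strategist s2's observable-side source of the lever `SideFloorComparison` (SFB: side exits of ONE
lattice triangle ≤ `C ×` its own floor arrivals in `[L/4, L/2]`; = DCS Conj. 2 read on a closed lattice side) REGISTERED as `stub_sideFloorComparison` with the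
composition `HexConjecture_of_sideFloor`; record `triDl_envelope`.  Registered (7): floorRatioLimit, windowTwoPointLowerBound, triDlLowerRegular, triDlDoubling,
sideFloorComparison, uniformModulus, boundaryUniversality; PRIMARY unchanged.  (iii) VERDICTS (`Lines/root_locality_replaces_loewner_c11.md`): the
surface-fugacity family is exit-class accounting whose wall class is the scale-DERIVATIVE of the exit class (dead for REG) but yields the exact y*-sum rule
`(B_{T−1} − B_T)/B_T = 1/E[(1+√2)^V − 1 | H = T]` (doubling ⟺ mean critical-adsorption weight of height-`T` arches `≥ T/κ`, `κ < 1`; DCS's `c/T` is the borderline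
`κ = 1`); the slit identity from the first-exit tip has no sign (`E_ω[M] = 1+√2` exactly); FRL pins the restriction cocycle up to ONE constant per domain pair and
the lever is exactly that normalisation.  STUCK (unchanged, RSW-type): `stub_triDlLowerRegular` / `stub_triDlDoubling`; SFB is the observable-side alternative.

LEAD CONTINUATION c10 (prover-line-stmt-CriticalPhenomena-0808-c10-0, 2026-08-17) — NINTH RESHAPE: THE KRACHUN–PANAGIOTIS ROUTE TO THE LEVER IS
TIGHT, AND THE REDUCTION IS NOW SCALE-LOCAL.  Seat c9 left the lever as `WTLB ⟸ REG` (kernel-checked) with the recommendation to try a CAP-FREE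
renewal count in KP Lemma 3.1.  This seat (i) audits KP §3 under the conjectured scaling (`D_T ≍ B_T ≍ T^{-1/4}`, `G_d ≍ d^{-5/4}`): Lemma 3.1
(`E[N] ≍ k^{3/4}`), cases (a)/(b) and Cor. 3.1 are dimensionally EQUALITIES, so the only slack is the regularity ratio `r(T) = Σ_{i≤T}D_i/((T+1)D_T)`
(REG) and the scale ratios (⟸ REG); every re-bookkeeping — Jensen/size-biased count (`Σ_pairs w = Σ_γ G(γ)·#pre(γ)` exactly, multiplicity `1+E[N]`),
late-renewals-only (`#pre ≤ 1 + N_{[T,k)}`: the small-scale history re-enters through short final bridges, `Σ_{j≤T}B_j`), sparsified gluing scales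
(gain `T/m` against multiplicity `(1/m)Σ_{j≤T}B_j`: `m` cancels), renewal density under the arch measure (wedge identity: loses the factor `D`) — lands on
`r` (or its bridge form `Σ_{j≤T}B_j ≤ C(T+1)triDl T`) bounded; doubling regularity directly needs an `O(1)`-cost extension (= the missing FKG/RSW gluing)
or a non-intersection gain in DCS's quadratic drop bound (open); details `Lines/root_locality_replaces_loewner_c10.md`.  (ii) LANDED (`--supports`
this item): `…KPAnalyticLocal` p145263 (`stub_kp_analytic_local`: KP's analytic step with REG only at the scales `s ∈ [T/4 − 1, 5T]`, `c = c(K)`),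
`…KPTransferAt` p144913 (`stub_kp_transfer_at`: the strip → half-box transfer pointwise in `R`), `…WindowTwoPointAtScale` p147951
(`windowTwoPointLowerBoundAt_of_regNear`: for every `K ≥ 1` ONE `C(K)` such that for every radius `R ≥ 600` the window inequality at `R` follows from
REG at the scales `s` with `⌈R/168⌉ ≤ 4(s+1)`, `s ≤ 5⌈R/168⌉`; `windowTwoPointLowerBound_of_regEventually`), `…DoublingEventually` p146440
(`reg_of_doublingEventually` / `windowTwoPointLowerBound_of_doublingEventually`: doubling `q·triDl T ≤ triDl(2T)` with `q > 1/2` at all LARGE `T`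
suffices — c9 needed all `T ≥ 1`).
RESHAPE v9: statement 2♮♮-D `TriDlDoubling` (`∃ q > 1/2 ∃ T₀ ∀ T ≥ T₀, q·triDl T ≤ triDl(2T)`) REGISTERED as `stub_triDlDoubling` (the lever's cleanest,
numerics-facing sufficient form: ratio `→ 2^{-1/4} ≈ 0.84`, measured `0.85`, c8); statement 2♮♮-loc (`TriDlLowerRegularNear`/`WindowTwoPointLowerBoundAt`,
the scale-local reduction, LANDED link); `stub_archAspectBound` RETIRED from the registered list (⟸ `stub_windowTwoPointLowerBound`, p129016; the Prop
`ArchAspectBound` and its compositions stay with plain hypotheses).  Registered stubs (7): observableLimit, floorRatioLimit, windowTwoPointLowerBound,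
triDlLowerRegular, triDlDoubling, uniformModulus, boundaryUniversality; PRIMARY unchanged (`HexConjecture_of` over FRL, WTLB, UIM, (E));
`HexConjecture_of_doubling` all-stub alternative.  STUCK (unchanged, RSW-type): `stub_triDlLowerRegular` / `stub_triDlDoubling`.

VERSION HISTORY v3–v8 (seats c1–c9; full narratives in `Cruxes/HexConjecture/NOTES.md` §§c1–c9 and `Lines/root_locality_replaces_loewner_{levers,
frontier,promote,c5,c6,c8,c9}.md`; everything named here is LANDED `--supports stmt-0808` unless marked open):
* v3 (c1) FLOOR CLASS: canonical transfer closed on the floor class by 10472's HA p114707 (`stub_canonicalTransferFlat` retired;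
  `stub_avoidanceCocycleFloor`, `stub_rangeIdentificationFloor` landed); UIM ⟹ non-retracing p116482, so no `HexTight` on the floor class
  (`hexConjectureFloor_of_sharedEstimates` p116733); statement 1 weakened to floor-ratio MODULI (`restrictionCocycle_of_floorRatioModulus` p116941,
  `hexConjectureFloor_of_boundaryEstimates` p117152); necessity of the soft stubs p117125/p116733/p79732.
* v4 (c2) endpoint classes coincide eventually (`floorConvergence_iff_hexConjectureFloor`), `hexConjecture_iff_floorConvergence_and_boundaryUniversality`
  (p118046); `stub_boundaryUniversality` = 10472's (E) verbatim and `stub_uniformModulus` = 10472's stub verbatim registered; (E) PROMOTED (crux-sized).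
* (c3/c4) frontier certificate: every composition needs stmt-14003 and (E); HPAT = "RSW for SAW" (bounded-span p114255 / endpoint-summed p119284
  halves are theorems); PROMOTE HPAT + UIM; Theorems-side glue over items `RootLocality.hexConjecture_of_items` p118046.
* v5 (c5) lever needed only ON AVERAGE: HPAT ↦ WAL (window-averaged arch locality; HPAT ⟹ WAL p121715, tail-exponent ⟹ WAL p123422); re-plumbed
  bootstrap p122154/p122972/p123193/p123521 (`restrictionCocycle_of_windowLocality`, `hexConjectureFloor_of_windowEstimates`).
* v6 (c6) FRL supplies the window gain (`G ≥ κ t^{-5/4}` non-integrable at the root: p125386/p125529/p125150/p125163/p125166): WAL ↦ the `η`-FREE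
  arch aspect bound AAB (`windowIneq_of_aspectBound` p125705, `restrictionCocycle_of_aspectBound`, `hexConjectureFloor_of_aspectEstimates` p126051).
* v7 (c8) far side of AAB ≤ GM/KP triangle tail (`farArchMass_offsetSum_le_sub_triA` p128101, `tri_identity` = GM Lemma 4.1 = KP (2)); AAB ⟸ WTLB
  (`archAspectBound_of_windowTwoPointLowerBound` p129016); CUBE version `triDl(4⌊R/40⌋)³ ≤ window mass` PROVED (`triDl_cube_le_windowMass` p128099);
  upper companion KP Lemma 2.2 (`farOffsetMass_le_sub_triA` p128102); TAILFRAC ∧ DROP ⟹ WTLB (p130078); TriDlPos p131027; numerics j020661.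
* v8 (c9) Krachun–Panagiotis §3 FORMALISED (KPDefs p137436 … KPCor31 p139666, KPTransfer p140766, KPTheorem2: KP Theorems 2–3 UNCONDITIONAL,
  `kp_triDl_rpow_decay`): `WTLB ⟸ REG` (`stub_windowTwoPointLowerBound_of_reg` p142667); strategist split glue `Split.HexConjecture_of_subs` p142668;
  `def TriDlLowerRegular` (REG) with `windowTwoPointLowerBound_of_triDlLowerRegular`.  WHY NO UNCONDITIONAL WTLB: KP's multiplicity bound
  `M_k·triDl k ≈ renBound k` needs `Σ_{i≤k} triDl i ≤ C k·triDl k` (REG) + bounded scale ratios; without it only `T^{−ε}` by pigeonhole.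

LEAD ADOPTION (prover-line-stmt-CriticalPhenomena-0808-0, cycle 2, after `marginal-reflex-wedge-cauchy-kernel` ended
line-dead with its harvest landed — `Lines/marginal_reflex_wedge_cauchy_kernel.dead.md`): skeleton taken over VERBATIM from the
planner except that the three references to the dropped decl `Theses.SAWDefectDecoherence.HexConjecture` now point to
`Theses.SAWDevelopingMap.HexConjecture` (payload route; identical statement text). Lead holds `stub_rootDominance`; wave 1 of
this line: BUILD workers on `stub_rangeIdentification`, `stub_curveUpgrade`, scoped worker on `stub_avoidanceCocycle` (reuse of the
crux-10472 `CanonicalTransfer*` files), verdict workers on `stub_observableLimit` (= stmt-14003), `stub_nonRetracing`,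
`stub_marksAndEndpoints`.
STATUS after wave 1 of this line (2026-08-16T16:30Z): `stub_curveUpgrade` PROVED (p108020 + 5 parts); `stub_rangeIdentification`
PROVED (6 parts + final assembly p113656, plugged in); stub 3 RESHAPED and CLOSED in corrected form (p113497 plugged in; new OPEN stub
`stub_canonicalTransferFlat`; 5 part files landed); verdicts: `stub_observableLimit` blocked on stmt-14003,
`stub_nonRetracing` blocked (weaker than 10472's open uniform modulus / NoRetrace; needs the missing pointwise
partition-function floor = 'RSW for SAW'), `stub_marksAndEndpoints` blocked (residuals R1 rough marks, R2 endpoint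
universality; not attackable inside a restriction line). OPEN stubs: observableLimit (= 14003), rootDominance (lead;
phase content), canonicalTransferFlat (10472's hullApproxDomain + floor→flat), nonRetracing, marksAndEndpoints.

Skeleton of the line (crux-plan, planner-cruxplan-stmt-CriticalPhenomena-0808-root-locality-replac-0,
2026-08-16) for the crux idea `Ideas/root-locality-replaces-loewner.md` (crux-ideate r1, ideator 2;
triage r1: 3 × pass, mandatory sharpening "∃ r → ∀ r" of `RootDominance` APPLIED below, dependency
warning "consume the REPAIRED Conj. 2" APPLIED below).

THE CRUX (fixed; the route decl, shared by 4 routes): Duminil-Copin–Smirnov 2012 Conjecture 1 on the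
honeycomb lattice — for every Dobrushin domain `(D; a, b)` and every hexagonal endpoint approximation
(`IsEmbEndpointApprox hexGraph hexCenter D a b`: eventually joined in `Ω_δ`, `δ·a_δ → a`, `δ·b_δ → b`)
the critical SAW law `hexSAWLaw` on `Ω_δ`, pushed to `CurveClass ℂ`, converges in law to chordal
SLE_{8/3} (`ConvergesInLawToSLE (8/3)`).

THE LINE. Replace the Loewner/martingale identification (`ObservableToSLER`: Conj. 2 in the walk's own
slit domains + tightness) by RESTRICTION: the `x_c`-weighted SAW has EXACT lattice restriction
covariance, so the probability that the walk of `Ω` stays inside a hull subdomain `Ω' = Ω ∖ A` is a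
ratio `Z_{Λ'}(a,b)/Z_Λ(a,b)` of two boundary values of ONE parafermionic observable in two domains.
Conj. 2 in its repaired, `b`-normalised form (`HexObservableLimitR`, stmt-14003: flat horizontal
half-lattice pieces pinned at BOTH marks) applied in `Ω` and in `Ω'` gives this ratio UP TO the one
scalar it cannot see (the absolute size of `F` at its root); ROOT DOMINANCE (`stub_rootDominance`, the
lever: `ψ`-averages of `F` next to the root `a` do not feel the far-away change `Λ ↦ Λ'`, relative
error `→ 0` as `supp ψ → a`) supplies exactly that scalar, and the computation
`F'(b)/F(b) = (S'/S)·I_Ω(ψ)/I_{Ω'}(ψ)·(1+o(1))`, `I_Ω/I_{Ω'} → (h'(0)/h'(∞))^{5/8} = Φ_A'(0)^{5/8}`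
(`φ_{Ω'} = h ∘ φ_Ω`, `h : ℍ ∖ Ã → ℍ`, `a ↦ ∞`, `b ↦ 0`; re-derived by all three triagers) yields the
AVOIDANCE COCYCLE WITH THE LAWLER–SCHRAMM–WERNER VALUE (`stub_avoidanceCocycle`). From there the
range of the walk is identified as the SLE_{8/3} trace by the restriction facts PROVED in the tree
(`sle_restriction_eightThirds_holds`, `IsSLELaw.hullRestriction_eightThirds_holds`,
`RestrictionConfig.ext_of_avoid_holds`, `LawlerSchrammWerner2003_unique_holds`) plus compactness
of the hyperspace `NonemptyCompacts` — no tightness input (`stub_rangeIdentification`); ONE SAW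
regularity estimate, NON-RETRACING (no three pairwise `ε`-close disjoint sub-walks of diameter `≥ ℓ`,
`stub_nonRetracing`), upgrades range convergence to curve convergence by an ABSTRACT topological
lemma (`stub_curveUpgrade`, all curve families; tightness and simplicity become OUTPUTS). All of this
happens in the class where the observable input lives: `D` flat near both marks, lattice endpoints =
discrete-boundary vertices (the printed reading of DCS). The passage to ALL Dobrushin domains and
ALL `IsEmbEndpointApprox` endpoints (rough marks; microscopically interior endpoints — the
disprover's near-miss `Boundary.HexConjectureBoundaryEndpoints`) is the FOREIGN residual
`stub_marksAndEndpoints`, shared with every observable route (it is the converse direction of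
`Boundary.boundaryEndpoints_of_hexConjecture`; this line does not attack it).

STUBS (7, registered; `sorry` only inside them; `HexConjecture_of` composes them into the crux BY
NAME, kernel-checked; `hexConjectureFlatBoundary_of_line` is the kernel-checked REACH of stubs 1–6
without the foreign stub):
1. `stub_observableLimit`     — `HexObservableLimitR` verbatim (shared target stmt-14003 of the route;
   DCS Conj. 2 repaired; XL, OPEN; not this line's to attack).
2. `stub_rootDominance`       — ROOT DOMINANCE (the LEVER; L–XL, OPEN; hardest stub OF THE LINE).
3. `stub_avoidanceCocycle`    — 1 → 2 → `HexAvoidanceCocycle` (L: the computation + winding rigidity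
   at `b` + LSW Thm 6.1 value + exact lattice restriction + canonical-discretisation transfer).
4. `stub_rangeIdentification` — cocycle → range of the walk converges in law (Hausdorff metric) to the
   SLE_{8/3} range (M–L, provable now: restriction uniqueness, hyperspace compactness, filling).
5. `stub_nonRetracing`        — no `(ε, ℓ)`-triple strands, `ε → 0` after `δ → 0` (L–XL, OPEN SAW
   estimate; second-hardest).
6. `stub_curveUpgrade`        — ABSTRACT: range convergence to an SLE_{8/3} curve + endpoints +
   non-retracing in law ⟹ `ConvergesInLawToSLE (8/3)` (M, provable now, pure topology/measure).
7. `stub_marksAndEndpoints`   — `HexConjectureFlatBoundary → HexConjecture` (XL, FOREIGN residual).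

## Disproof used
The standing `Disproof.lean` (cdisprove gen2 v5, `run/gate/evidence/stmt-CriticalPhenomena-0808/…`)
is NOT mounted in this planner jail and is not published under `Cruxes/HexConjecture/` (`ledger crux
ls`); used through the LANDED negative files, imported here:
* `Negative.hexConjecture_false_without_tendsto_fst / _snd / _reachable` (LoadBearing.lean: every
  clause of `IsEmbEndpointApprox` is load-bearing) — HONOURED: no stub drops a clause; the line USES
  `tendsto_fst`/`tendsto_snd` at `stub_curveUpgrade` (orientation of the limit arc: `src δ → D.pt 0`,
  `tgt δ → D.pt 1`, fed by `IsEmbEndpointApprox.tendsto_fst/snd` in `hexConjectureFlatBoundary_of_line`)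
  and `reachable` at `stub_rangeIdentification`/`stub_avoidanceCocycle` (the laws are probability
  measures eventually; `Negative.hexSAWLaw_eq_zero_of_not_mem` is the junk they exclude).
* `Boundary.HexConjectureBoundaryEndpoints`, `Boundary.boundaryEndpoints_of_hexConjecture`
  (BoundaryWitness.lean: the printed, discrete-boundary-endpoint reading is strictly weaker a priori)
  — HONOURED AND NAMED: stubs 3–6 live in that reading (restricted further to flat marks), and the gap
  to the crux is its own registered stub 7 (`flatBoundary_of_boundaryEndpoints` below records that the
  printed reading implies this line's class outright).
* `Boundary.not_forall_isProbabilityMeasure_hexSAWLaw`, `Boundary.hexConjectureAtFugacity_zero_false`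
  (refuted strengthenings: all-`δ` probability, fugacity `0`) — no stub is an instance: every law
  statement is eventual along `𝓝[>] 0` and at `x_c`.
* `ledger negatives --problem CriticalPhenomena` (8 items): stmt-5420 `HexObservableLimit` (corridor
  witness) — the line consumes the REPAIRED stmt-14003 (root pinned: rigid half-lattice in the ball at
  `a` as at `b`) and `RootDominance` copies the same rigid half-lattice clause in the root ball and is
  RELATIVE (`Λ`, `Λ'` agree in the ball; triage r1-2/3: "immune to the corridor witness"); stmt-0772
  (all-`δ` tightness `IsTightLaws`) — no tightness statement anywhere, everything eventual; stmt-8312 /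
  8261 — no phase retrieval, no positive-definiteness.
-/

noncomputable section

namespace Summit.CriticalPhenomena.SAWScalingLimit.Cruxes.HexConjecture.RootLocalityReplacesLoewner

open scoped Topology NNReal ENNReal
open Filter Set MeasureTheory
open Literature.Probability.RandomPlanarGeometry Literature.Probability.RandomPlanarGeometry.SAW
open Literature.Probability.LatticeModels

/-! ## The statements (named `Prop`s over tree declarations; the registered `stub_*` theorems restate
them verbatim, fully qualified; `Registered.stub_*` are the name-keyed aliases taken as hypotheses of
`HexConjecture_of` — same device as `Lines/critical-kloosterman-powerful-moduli.lean` of crux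
`MazurKaneLaw`: the skeleton audit admits a hypothesis whose head's last name component is a
declared stub)

Standing "flat-boundary class" hypotheses, inlined in statements 3–5 and 7 (the class in which the
observable input `HexObservableLimitR` lives): `0 < ρ`; for BOTH marked points
`D ∩ B(pt i, ρ) = {im z > im (pt i)} ∩ B(pt i, ρ)` (horizontal half-plane pieces, as in stmt-14003);
`IsEmbEndpointApprox hexGraph hexCenter D a b`; and eventually `a δ`, `b δ` are DISCRETE-BOUNDARY
vertices of `Ω_δ` (verbatim the body of `Boundary.IsDiscreteBoundaryVertex`: in `Ω_δ` with a honeycomb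
neighbour to which the `Ω_δ`-edge is missing; inside the flat balls these are exactly the bottom
zigzag up-faces, resp. the dangling down-faces, of the half-lattice — DCS's "vertices of `Ω_δ` closest
to `a`, `b`"). -/

/-- An `(ε, ℓ)`-TRIPLE STRAND of a curve class: some representative has three pairwise disjoint
parameter intervals, in order, whose images have diameter `≥ ℓ` and are pairwise within Hausdorff
distance `ε`. Reparametrisation-invariant. Its negation along the walk ("non-retracing") is the one
regularity input of the line (`HexNonRetracing`); a macroscopic parameter backtrack along a simple arc
forces one (`CurveUpgrade`). Inlined verbatim in the registered signatures. -/
def HasTripleStrand (γ : CurveClass ℂ) (ε ℓ : ℝ) : Prop :=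
  ∃ c : Curve ℂ, CurveClass.mk c = γ ∧ ∃ s t : Fin 3 → unitInterval,
    (∀ i, s i ≤ t i) ∧ t 0 < s 1 ∧ t 1 < s 2 ∧
    (∀ i, ℓ ≤ Metric.diam ((⇑c) '' Set.Icc (s i) (t i))) ∧
    ∀ i j, Metric.hausdorffDist ((⇑c) '' Set.Icc (s i) (t i))
      ((⇑c) '' Set.Icc (s j) (t j)) ≤ ε

/-- STATEMENT 1 — `ObservableLimit`: Duminil-Copin–Smirnov 2012 Conjecture 2 on the honeycomb
lattice, `ψ`-averaged and `b`-normalised, with BOTH marks pinned conformally (flat horizontal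
half-lattice pieces in `ρ`-balls) — VERBATIM the body of the route's repaired target
`SAWDefectDecoherence.HexObservableLimitR` (stmt-CriticalPhenomena-14003; `observableLimit_iff`). -/
def ObservableLimit : Prop :=
  ∃ c : ℂ, c ≠ 0 ∧ ∀ (D : Literature.Probability.RandomPlanarGeometry.DobrushinDomain) (ρ : ℝ) (Λ : ℝ → Finset Literature.Probability.LatticeModels.HexVertex) (m : Fin 2 → ℝ → ℤ) (a b : ℝ → Sym2 Literature.Probability.LatticeModels.HexVertex) (Φ : Literature.Probability.RandomPlanarGeometry.ConformalEquiv D.carrier UpperHalfPlane.upperHalfPlaneSet) (L : ℂ → ℂ) (Lb : ℂ) (ψ : ℂ → ℂ), let F : ℝ → Sym2 Literature.Probability.LatticeModels.HexVertex → ℂ := fun δ z => Literature.Probability.RandomPlanarGeometry.SAW.hexParafermionicObservable (Λ δ) (a δ) Literature.Probability.RandomPlanarGeometry.SAW.hexCriticalFugacity (5 / 8) z; 0 < ρ → (∀ i : Fin 2, D.carrier ∩ Metric.ball (D.pt i) ρ = {z : ℂ | (D.pt i).im < z.im} ∩ Metric.ball (D.pt i) ρ) → (∀ᶠ δ : ℝ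 in nhdsWithin 0 (Set.Ioi 0), Literature.Probability.RandomPlanarGeometry.SAW.hexDomainSimplyConnected (Λ δ) ∧ a δ ∈ Literature.Probability.RandomPlanarGeometry.SAW.hexDomainBoundary (Λ δ) ∧ b δ ∈ Literature.Probability.RandomPlanarGeometry.SAW.hexDomainBoundary (Λ δ) ∧ Nonempty (Literature.Probability.RandomPlanarGeometry.SAW.HexMidEdgeSAW (Λ δ) (a δ) (b δ)) ∧ (Literature.Probability.LatticeModels.hexGraph.induce ((Λ δ : Finset Literature.Probability.LatticeModels.HexVertex) : Set Literature.Probability.LatticeModels.HexVertex)).Preconnected ∧ (∀ v ∈ Λ δ, (δ : ℂ) * Literature.Probability.LatticeModels.hexCenter v ∈ D.carrier) ∧ (∀ i : Fin 2, ∀ v : Literature.Probability.LatticeModels.HexVertex, (δ : ℂ) * Literature.Probability.LatticeModels.hexCenter v ∈ Metric.ball (D.pt i) ρ → (v ∈ Λ δ ↔ m i δ ≤ v.1 1))) → (∀ K : Set ℂ, IsCompact K → K ⊆ D.carrier → ∀ᶠ δ : ℝ in nhdsWithin 0 (Set.Ioi 0), ∀ v : Literature.Probability.LatticeModels.HexVertex,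 (δ : ℂ) * Literature.Probability.LatticeModels.hexCenter v ∈ K → v ∈ Λ δ) → Filter.Tendsto (fun δ : ℝ => (δ : ℂ) * Literature.Probability.RandomPlanarGeometry.SAW.hexMidpoint (a δ)) (nhdsWithin 0 (Set.Ioi 0)) (nhds (D.pt 0)) → Filter.Tendsto (fun δ : ℝ => (δ : ℂ) * Literature.Probability.RandomPlanarGeometry.SAW.hexMidpoint (b δ)) (nhdsWithin 0 (Set.Ioi 0)) (nhds (D.pt 1)) → Filter.Tendsto (fun x => ‖Φ x‖) (nhdsWithin (D.pt 0) D.carrier) Filter.atTop → Φ.HasBoundaryValue (D.pt 1) 0 → ContinuousOn L D.carrier → (∀ z ∈ D.carrier, Complex.exp (L z) = deriv Φ z) → Filter.Tendsto L (nhdsWithin (D.pt 1) D.carrier) (nhds Lb) → Continuous ψ → HasCompactSupport ψ → tsupport ψ ⊆ D.carrier → Filter.Tendsto (fun δ : ℝ => (δ : ℂ) ^ 2 * (∑ᶠ e ∈ Literature.Probability.RandomPlanarGeometry.SAW.hexDomainMidEdges (Λ δ), ψ ((δ : ℂ) * Literature.Probability.RandomPlanarGeometry.SAW.hexMidpoint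 e) * F δ e) / F δ (b δ)) (nhdsWithin 0 (Set.Ioi 0)) (nhds (c * ∫ z, ψ z * Complex.exp ((5 / 8 : ℂ) * (L z - Lb))))

/-- The line's statement 1 IS the route item stmt-14003 (definitionally). -/
theorem observableLimit_iff :
    ObservableLimit ↔ Summit.CriticalPhenomena.SAWScalingLimit.Theses.SAWDefectDecoherence.HexObservableLimitR :=
  Iff.rfl

/-- STATEMENT 1♯ — `FloorRatioModulusLimit` (the WEAKENED statement 1; crux-10472's waypoint S1 = the conclusion of its landed
`FloorRatio.stub_targetTransport`, p72986, with `Tendsto.norm` applied): for a floor-type domain `D` (flat at the root `a` and at two floor points `b = D.pt 1`,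
`b' = D'.pt 1` of the same Jordan curve), admissible discretisations pinned to exact half-lattice rows in the three balls, boundary
mid-edges `a δ → a`, `b δ → b`, `b' δ → b'`, a map `Φ : D → ℍ` (`a ↦ ∞`, `b ↦ 0`) with a continuous logarithm `L` of `Φ'` having limits
`Lb`, `Lb'` at the two floor points: `‖F_δ(b'_δ)/F_δ(b_δ)‖ → exp((5/8) Re(Lb' − Lb))`.  Since `‖F_δ(p)‖ = Z_δ(a→p)` at floor exits this is
`Z_δ(a→b')/Z_δ(a→b) → |Φ'(b')/Φ'(b)|^{5/8}` — boundary conformal covariance of the critical boundary two-point function with the boundary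
exponent 5/8; no bulk value and no phase of the observable enters.  Implied by `ObservableLimit` (`floorRatioLimit_of_observableLimit`). -/
def FloorRatioLimit : Prop :=
  ∀ (D D' : DobrushinDomain) (ρ : ℝ) (Λ : ℝ → Finset HexVertex) (m₀ m m' : ℝ → ℤ) (a b b' : ℝ → Sym2 HexVertex) (Φ : ConformalEquiv D.carrier UpperHalfPlane.upperHalfPlaneSet) (L : ℂ → ℂ) (Lb Lb' : ℂ), D'.carrier = D.carrier → D'.pt 0 = D.pt 0 → 0 < ρ → D.carrier ∩ Metric.ball (D.pt 0) ρ = {z : ℂ | (D.pt 0).im < z.im} ∩ Metric.ball (D.pt 0) ρ → D.carrier ∩ Metric.ball (D.pt 1) ρ = {z : ℂ | (D.pt 1).im < z.im} ∩ Metric.ball (D.pt 1) ρ → D.carrier ∩ Metric.ball (D'.pt 1) ρ = {z : ℂ | (D'.pt 1).im < z.im} ∩ Metric.ball (D'.pt 1) ρ → (∀ᶠ δ : ℝ in 𝓝[>] 0, hexDomainSimplyConnected (Λ δ) ∧ a δ ∈ hexDomainBoundary (Λ δ) ∧ b δ ∈ hexDomainBoundary (Λ δ) ∧ b' δ ∈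 hexDomainBoundary (Λ δ) ∧ Nonempty (HexMidEdgeSAW (Λ δ) (a δ) (b δ)) ∧ Nonempty (HexMidEdgeSAW (Λ δ) (a δ) (b' δ)) ∧ (hexGraph.induce (↑(Λ δ) : Set HexVertex)).Preconnected ∧ (∀ v ∈ Λ δ, (δ : ℂ) * hexCenter v ∈ D.carrier) ∧ (∀ v : HexVertex, (δ : ℂ) * hexCenter v ∈ Metric.ball (D.pt 0) ρ → (v ∈ Λ δ ↔ m₀ δ ≤ v.1 1)) ∧ (∀ v : HexVertex, (δ : ℂ) * hexCenter v ∈ Metric.ball (D.pt 1) ρ → (v ∈ Λ δ ↔ m δ ≤ v.1 1)) ∧ (∀ v : HexVertex, (δ : ℂ) * hexCenter v ∈ Metric.ball (D'.pt 1) ρ → (v ∈ Λ δ ↔ m' δ ≤ v.1 1))) → (∀ K : Set ℂ, IsCompact K → K ⊆ D.carrier → ∀ᶠ δ : ℝ in 𝓝[>] 0, ∀ v : HexVertex, (δ : ℂ) * hexCenter v ∈ K → v ∈ Λ δ) → Tendsto (fun δ : ℝ => (δ : ℂ) * hexMidpoint (a δ)) (𝓝[>] 0) (𝓝 (D.pt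 0)) → Tendsto (fun δ : ℝ => (δ : ℂ) * hexMidpoint (b δ)) (𝓝[>] 0) (𝓝 (D.pt 1)) → Tendsto (fun δ : ℝ => (δ : ℂ) * hexMidpoint (b' δ)) (𝓝[>] 0) (𝓝 (D'.pt 1)) → Tendsto (fun x => ‖Φ x‖) (𝓝[D.carrier] (D.pt 0)) Filter.atTop → Φ.HasBoundaryValue (D.pt 1) 0 → ContinuousOn L D.carrier → (∀ z ∈ D.carrier, Complex.exp (L z) = deriv Φ z) → Tendsto L (𝓝[D.carrier] (D.pt 1)) (𝓝 Lb) → Tendsto L (𝓝[D.carrier] (D'.pt 1)) (𝓝 Lb') → Tendsto (fun δ : ℝ => ‖hexParafermionicObservable (Λ δ) (a δ) hexCriticalFugacity (5 / 8) (b' δ) / hexParafermionicObservable (Λ δ) (a δ) hexCriticalFugacity (5 / 8) (b δ)‖) (𝓝[>] 0) (𝓝 (Real.exp ((5 / 8) * (Lb' - Lb).re)))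

/-- Statement 1 implies statement 1♯ (crux-10472's landed target transport, p72986). -/
theorem floorRatioLimit_of_observableLimit (h : ObservableLimit) : FloorRatioLimit :=
  fun D D' ρ Λ m₀ m m' a b b' Φ L Lb Lb' h1 h2 h3 h4 h5 h6 h7 h8 h9 h10 h11 h12 h13 h14 h15 h16 h17 =>
    Summit.CriticalPhenomena.SAWScalingLimit.Theorems.HexConjecture.RootLocality.tendsto_norm_of_tendsto_exp_five_eighths
      (Summit.CriticalPhenomena.SAWScalingLimit.Theorems.ObservableToSLE.FloorRatio.stub_targetTransport h D D' ρ Λ m₀ m m'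
        a b b' Φ L Lb Lb' h1 h2 h3 h4 h5 h6 h7 h8 h9 h10 h11 h12 h13 h14 h15 h16 h17)

/-- STATEMENT 2 — `RootDominance` (THE LEVER; sharpened per triage r1-1/2/3: `∀ ε ∃ r₀ ∀ r < r₀ ∃ ψ`,
so `supp ψ → a` jointly with `ε → 0`). Setting = the ROOT half of stmt-14003's: a Dobrushin domain
flat (horizontal half-plane piece) in the ball `B(a, ρ)`, two discretisation families `Λ' δ ⊆ Λ δ`,
both hex-simply-connected, inside `Ω`, with the SAME boundary root mid-edge `a δ` (`δ·a δ → a`), `Λ δ`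
the exact half-lattice `{row ≥ m δ}` inside the ball and `Λ' = Λ` inside the ball (the change is far
from the root). Claim: for every `ε > 0` there is a scale `r₀` such that at EVERY scale `r < r₀` some
nonnegative bump `ψ ≢ 0` supported in the small interior ball `B(a + i r, r/4)` (angular localisation:
the phases of `F` are then coherent, `|I_Ω(ψ)| ≍ ∫ψ|φ'|^{5/8}`) has, eventually as `δ → 0⁺`,
`‖S'_δ − S_δ‖ ≤ ε ‖S_δ‖`, `S_δ = Σ_e ψ(δe) F_{Λ δ}(e)`, `S'_δ` the same sum for `Λ' δ`, `F` the
observable at `x_c`, `σ = 5/8` rooted at `a δ`. Given statement 1 in `Ω` and `Ω'` this is EQUIVALENT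
to the avoidance cocycle with the LSW value (module docstring); it is the observable-side form of
"P_Λ(γ ⊆ Λ') → Φ_A'(0)^{5/8}" and carries PHASE content (card: bounding `‖S'−S‖` by the positive
excursion mass loses `R^{25/48}`; the saving is boundary two-leg non-intersection, or the positive
mesoscopic variant through `σ = 0` masses and the `5/8` boundary calibration). -/
def RootDominance : Prop :=
  ∀ (D : DobrushinDomain) (ρ : ℝ) (Λ Λ' : ℝ → Finset HexVertex) (m : ℝ → ℤ) (a : ℝ → Sym2 HexVertex),
    0 < ρ →
    D.carrier ∩ Metric.ball (D.pt 0) ρ = {z : ℂ | (D.pt 0).im < z.im} ∩ Metric.ball (D.pt 0) ρ →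
    (∀ᶠ δ : ℝ in 𝓝[>] 0,
      hexDomainSimplyConnected (Λ δ) ∧ hexDomainSimplyConnected (Λ' δ) ∧ Λ' δ ⊆ Λ δ ∧
      a δ ∈ hexDomainBoundary (Λ δ) ∧ a δ ∈ hexDomainBoundary (Λ' δ) ∧
      (∀ v ∈ Λ δ, (δ : ℂ) * hexCenter v ∈ D.carrier) ∧
      (∀ v : HexVertex, (δ : ℂ) * hexCenter v ∈ Metric.ball (D.pt 0) ρ → (v ∈ Λ δ ↔ m δ ≤ v.1 1)) ∧
      (∀ v : HexVertex, (δ : ℂ) * hexCenter v ∈ Metric.ball (D.pt 0) ρ → (v ∈ Λ' δ ↔ v ∈ Λ δ))) →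
    Tendsto (fun δ : ℝ => (δ : ℂ) * hexMidpoint (a δ)) (𝓝[>] 0) (𝓝 (D.pt 0)) →
    ∀ ε : ℝ, 0 < ε → ∃ r₀ : ℝ, 0 < r₀ ∧ ∀ r : ℝ, 0 < r → r < r₀ →
      ∃ ψ : ℂ → ℝ, Continuous ψ ∧ HasCompactSupport ψ ∧ (∀ z, 0 ≤ ψ z) ∧ (∃ z, ψ z ≠ 0) ∧
        tsupport ψ ⊆ Metric.ball (D.pt 0 + (r : ℂ) * Complex.I) (r / 4) ∧
        ∀ᶠ δ : ℝ in 𝓝[>] 0,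
          ‖(∑ᶠ e ∈ hexDomainMidEdges (Λ' δ), (ψ ((δ : ℂ) * hexMidpoint e) : ℂ) *
                hexParafermionicObservable (Λ' δ) (a δ) hexCriticalFugacity (5 / 8) e) -
              ∑ᶠ e ∈ hexDomainMidEdges (Λ δ), (ψ ((δ : ℂ) * hexMidpoint e) : ℂ) *
                hexParafermionicObservable (Λ δ) (a δ) hexCriticalFugacity (5 / 8) e‖ ≤
            ε * ‖∑ᶠ e ∈ hexDomainMidEdges (Λ δ), (ψ ((δ : ℂ) * hexMidpoint e) : ℂ) *
                hexParafermionicObservable (Λ δ) (a δ) hexCriticalFugacity (5 / 8) e‖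

/-- STATEMENT 2b — `AdmissibleRestrictionLimitFlat` (lead's reshape after wave 1 of this line; the text is the
conclusion of the LANDED `restrictionLimit_of_rootDominance`, `…AvoidanceCocycleAssembly.lean` p112643): the admissible
mid-edge-walk restriction cocycle `Z_{Λ'δ}(a,b)/Z_{Λδ}(a,b) → d^{5/8}` for nested admissible vertex-domain families
discretising a hull subdomain `D' ⊆ D` of a domain flat at both marks, with LSW restriction data `(Φ, d)`. PROVED from
statements 1 + 2 (steps (a)–(c) of the planner's stub 3). -/
def AdmissibleRestrictionLimitFlat : Prop :=
  ∀ (D D' : Literature.Probability.RandomPlanarGeometry.DobrushinDomain) (ρ : ℝ) (φ : Literature.Probability.RandomPlanarGeometry.ConformalEquiv UpperHalfPlane.upperHalfPlaneSet D.carrier) (Φ : Literature.Probability.RandomPlanarGeometry.ConformalEquiv (UpperHalfPlane.upperHalfPlaneSet \ φ.pullbackHull D') UpperHalfPlane.upperHalfPlaneSet) (d : ℝ) (Λ Λ' : ℝ → Finset Literature.Probability.LatticeModels.HexVertex) (m : Fin 2 → ℝ → ℤ) (a b : ℝ → Sym2 Literature.Probability.LatticeModels.HexVertex), 0 < ρ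 → (∀ i : Fin 2, D.carrier ∩ Metric.ball (D.pt i) ρ = {z : ℂ | (D.pt i).im < z.im} ∩ Metric.ball (D.pt i) ρ) → D.IsHullSubdomain D' → D.IsChordalUniformizing φ → Literature.Probability.RandomPlanarGeometry.IsRestrictionMap (φ.pullbackHull D') Φ → Literature.Probability.RandomPlanarGeometry.HasRestrictionDeriv (φ.pullbackHull D') Φ d → (∀ᶠ δ : ℝ in nhdsWithin (0 : ℝ) (Set.Ioi 0), Λ' δ ⊆ Λ δ ∧ Literature.Probability.RandomPlanarGeometry.SAW.hexDomainSimplyConnected (Λ δ) ∧ Literature.Probability.RandomPlanarGeometry.SAW.hexDomainSimplyConnected (Λ' δ) ∧ (Literature.Probability.LatticeModels.hexGraph.induce ((Λ δ : Finset Literature.Probability.LatticeModels.HexVertex) : Set Literature.Probability.LatticeModels.HexVertex)).Preconnected ∧ (Literature.Probability.LatticeModels.hexGraph.induce ((Λ' δ : Finset Literature.Probability.LatticeModels.HexVertex) : Set Literature.Probability.LatticeModels.HexVertex)).Preconnected ∧ a δ ∈ Literature.Probability.RandomPlanarGeometry.SAW.hexDomainBoundary (Λ δ) ∧ b δ ∈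 Literature.Probability.RandomPlanarGeometry.SAW.hexDomainBoundary (Λ δ) ∧ a δ ∈ Literature.Probability.RandomPlanarGeometry.SAW.hexDomainBoundary (Λ' δ) ∧ b δ ∈ Literature.Probability.RandomPlanarGeometry.SAW.hexDomainBoundary (Λ' δ) ∧ Nonempty (Literature.Probability.RandomPlanarGeometry.SAW.HexMidEdgeSAW (Λ' δ) (a δ) (b δ)) ∧ (∀ v ∈ Λ δ, (δ : ℂ) * Literature.Probability.LatticeModels.hexCenter v ∈ D.carrier) ∧ (∀ v ∈ Λ' δ, (δ : ℂ) * Literature.Probability.LatticeModels.hexCenter v ∈ D'.carrier) ∧ (∀ i : Fin 2, ∀ v : Literature.Probability.LatticeModels.HexVertex, (δ : ℂ) * Literature.Probability.LatticeModels.hexCenter v ∈ Metric.ball (D.pt i) ρ → ((v ∈ Λ δ ↔ m i δ ≤ v.1 1) ∧ (v ∈ Λ' δ ↔ m i δ ≤ v.1 1)))) → (∀ K : Set ℂ, IsCompact K → K ⊆ D.carrier → ∀ᶠ δ : ℝ in nhdsWithin (0 : ℝ) (Set.Ioi 0), ∀ v : Literature.Probability.LatticeModels.HexVertex, (δ : ℂ)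 * Literature.Probability.LatticeModels.hexCenter v ∈ K → v ∈ Λ δ) → (∀ K : Set ℂ, IsCompact K → K ⊆ D'.carrier → ∀ᶠ δ : ℝ in nhdsWithin (0 : ℝ) (Set.Ioi 0), ∀ v : Literature.Probability.LatticeModels.HexVertex, (δ : ℂ) * Literature.Probability.LatticeModels.hexCenter v ∈ K → v ∈ Λ' δ) → Filter.Tendsto (fun δ : ℝ => (δ : ℂ) * Literature.Probability.RandomPlanarGeometry.SAW.hexMidpoint (a δ)) (nhdsWithin (0 : ℝ) (Set.Ioi 0)) (nhds (D.pt 0)) → Filter.Tendsto (fun δ : ℝ => (δ : ℂ) * Literature.Probability.RandomPlanarGeometry.SAW.hexMidpoint (b δ)) (nhdsWithin (0 : ℝ) (Set.Ioi 0)) (nhds (D.pt 1)) → Filter.Tendsto (fun δ : ℝ => (∑ γ : Literature.Probability.RandomPlanarGeometry.SAW.HexMidEdgeSAW (Λ' δ) (a δ) (b δ), Literature.Probability.RandomPlanarGeometry.SAW.hexCriticalFugacity ^ γ.length) / (∑ γ : Literature.Probability.RandomPlanarGeometry.SAW.HexMidEdgeSAW (Λ δ) (a δ) (b δ), Literature.Probability.RandomPlanarGeometry.SAW.hexCriticalFugacity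 ^ γ.length)) (nhdsWithin (0 : ℝ) (Set.Ioi 0)) (nhds (d ^ ((5 : ℝ) / 8)))

/-- STATEMENT 2c — `FloorRestrictionLimitFlat`: the same limit for the CANONICAL law `hexSAWLaw` on `Ω_δ = embMeshDomain`
with discrete-boundary endpoints and the event `range ⊆ closure D'` (value `ofReal (d^{5/8})`). -/
def FloorRestrictionLimitFlat : Prop :=
  ∀ (D D' : Literature.Probability.RandomPlanarGeometry.DobrushinDomain) (ρ : ℝ) (φ : Literature.Probability.RandomPlanarGeometry.ConformalEquiv UpperHalfPlane.upperHalfPlaneSet D.carrier) (Φ : Literature.Probability.RandomPlanarGeometry.ConformalEquiv (UpperHalfPlane.upperHalfPlaneSet \ φ.pullbackHull D') UpperHalfPlane.upperHalfPlaneSet) (d : ℝ) (a b : ℝ → Literature.Probability.LatticeModels.HexVertex), 0 < ρ → (∀ i : Fin 2, D.carrier ∩ Metric.ball (D.pt i) ρ = {z : ℂ | (D.pt i).im < z.im} ∩ Metric.ball (D.pt i) ρ) → D.IsHullSubdomain D' → D.IsChordalUniformizing φ → Literature.Probability.RandomPlanarGeometry.IsRestrictionMap (φ.pullbackHull D') Φ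 → Literature.Probability.RandomPlanarGeometry.HasRestrictionDeriv (φ.pullbackHull D') Φ d → Literature.Probability.RandomPlanarGeometry.SAW.IsEmbEndpointApprox Literature.Probability.LatticeModels.hexGraph Literature.Probability.LatticeModels.hexCenter D a b → (∀ᶠ δ : ℝ in nhdsWithin (0 : ℝ) (Set.Ioi 0), (a δ ∈ Literature.Probability.RandomPlanarGeometry.SAW.embMeshDomain Literature.Probability.LatticeModels.hexGraph Literature.Probability.LatticeModels.hexCenter D.carrier δ ∧ ∃ w, Literature.Probability.LatticeModels.hexGraph.Adj (a δ) w ∧ ¬ (Literature.Probability.RandomPlanarGeometry.SAW.hexDomainGraph D.carrier δ).Adj (a δ) w) ∧ (b δ ∈ Literature.Probability.RandomPlanarGeometry.SAW.embMeshDomain Literature.Probability.LatticeModels.hexGraph Literature.Probability.LatticeModels.hexCenter D.carrier δ ∧ ∃ w, Literature.Probability.LatticeModels.hexGraph.Adj (b δ) w ∧ ¬ (Literature.Probability.RandomPlanarGeometry.SAW.hexDomainGraph D.carrier δ).Adj (b δ) w)) → Filter.Tendsto (fun δ : ℝ => ((Literature.Probability.RandomPlanarGeometry.SAW.hexSAWLaw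 D.carrier δ (a δ) (b δ)).map (fun γ : Literature.Probability.RandomPlanarGeometry.SAW.HexDomainSAW D.carrier δ (a δ) (b δ) => γ.curve)) (Literature.Probability.RandomPlanarGeometry.CurveClass.rangeSubset (closure D'.carrier))) (nhdsWithin (0 : ℝ) (Set.Ioi 0)) (nhds (ENNReal.ofReal (d ^ ((5 : ℝ) / 8))))

/-- STATEMENT 2d — `CanonicalTransferFlat` (NEW OPEN STUB isolated by wave 1: the canonical-discretisation transfer
for the flat-boundary class = step (d) of the planner's stub 3; its floor-class analogue is crux-10472's landed
`FloorRatio.canonicalTransfer_of_hullApprox` modulo the OPEN registered sub-goal `stub_hullApproxDomain` of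
stmt-CriticalPhenomena-10472, plus a floor→flat generalisation of ~14 of the 30 `CanonicalTransfer*` files). -/
def CanonicalTransferFlat : Prop :=
  AdmissibleRestrictionLimitFlat → FloorRestrictionLimitFlat

/-- STATEMENT 3's conclusion — `HexAvoidanceCocycle` (the restriction formula for the critical
hexagonal SAW WITH ITS VALUE, canonical law): in the flat-boundary class, for every hull subdomain
`D'` of `D` (`MarkedDomain.IsHullSubdomain`: Jordan, same marks, `D ∖ D'` away from both marks) and any
chordal SLE_{8/3} law `μ` of `D`, `P_δ[γ_δ ⊆ closure D'] → μ {range ⊆ closure D'}` (`= Φ_A'(0)^{5/8}`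
by [LSW] Thm 6.1 transposed, `IsSLELaw.hullRestriction_eightThirds_holds` /
`sle_restriction_eightThirds_holds`). Implied by the crux (portmanteau; the touching event is
`μ`-null), so not a strengthening; it is hypothesis H1/PFR of the summit cards
`hyperspace-capacity-connectedness` / `excursion-cocycle-five-eighths`, here DERIVED. -/
def HexAvoidanceCocycle : Prop :=
  ∀ (D D' : DobrushinDomain) (ρ : ℝ) (a b : ℝ → HexVertex) (μ : Measure (CurveClass ℂ)),
    0 < ρ →
    (∀ i : Fin 2, D.carrier ∩ Metric.ball (D.pt i) ρ = {z : ℂ | (D.pt i).im < z.im} ∩ Metric.ball (D.pt i) ρ) →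
    IsEmbEndpointApprox hexGraph hexCenter D a b →
    (∀ᶠ δ : ℝ in 𝓝[>] 0,
      (a δ ∈ embMeshDomain hexGraph hexCenter D.carrier δ ∧
        ∃ w, hexGraph.Adj (a δ) w ∧ ¬ (hexDomainGraph D.carrier δ).Adj (a δ) w) ∧
      (b δ ∈ embMeshDomain hexGraph hexCenter D.carrier δ ∧
        ∃ w, hexGraph.Adj (b δ) w ∧ ¬ (hexDomainGraph D.carrier δ).Adj (b δ) w)) →
    D.IsHullSubdomain D' → IsSLELaw ((8 : ℝ≥0) / 3) D μ →
    Tendsto (fun δ : ℝ =>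
        ((hexSAWLaw D.carrier δ (a δ) (b δ)).map
            (fun γ : HexDomainSAW D.carrier δ (a δ) (b δ) => γ.curve))
          (CurveClass.rangeSubset (closure D'.carrier)))
      (𝓝[>] 0) (𝓝 (μ (CurveClass.rangeSubset (closure D'.carrier))))

/-- STATEMENT 3 — `AvoidanceCocycleFromObservable` (CORRECTED by wave 1, `stub-misstated` verdict of the scoped worker:
the canonical transfer (d) is an explicit input): statements 1, 2 and 2d give the cocycle. PROVED as
`RootLocality.avoidanceCocycle_of_canonicalTransfer` (final file `…AvoidanceCocycle.lean`, landing). -/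
def AvoidanceCocycleFromObservable : Prop :=
  ObservableLimit → RootDominance → CanonicalTransferFlat → HexAvoidanceCocycle

/-- STATEMENT 4's conclusion — `HexRangeLimit`: in the flat-boundary class the RANGE of the walk, a
random point of the hyperspace `NonemptyCompacts ℂ` (Hausdorff metric = Vietoris topology), converges
in law (`TendstoLaw`, portmanteau form) to the range of a chordal SLE_{8/3} curve of `D`. -/
def HexRangeLimit : Prop :=
  ∀ (D : DobrushinDomain) (ρ : ℝ) (a b : ℝ → HexVertex),
    0 < ρ →
    (∀ i : Fin 2, D.carrier ∩ Metric.ball (D.pt i) ρ = {z : ℂ | (D.pt i).im < z.im} ∩ Metric.ball (D.pt i) ρ) →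
    IsEmbEndpointApprox hexGraph hexCenter D a b →
    (∀ᶠ δ : ℝ in 𝓝[>] 0,
      (a δ ∈ embMeshDomain hexGraph hexCenter D.carrier δ ∧
        ∃ w, hexGraph.Adj (a δ) w ∧ ¬ (hexDomainGraph D.carrier δ).Adj (a δ) w) ∧
      (b δ ∈ embMeshDomain hexGraph hexCenter D.carrier δ ∧
        ∃ w, hexGraph.Adj (b δ) w ∧ ¬ (hexDomainGraph D.carrier δ).Adj (b δ) w)) →
    ∃ Γ : (ℝ≥0 → ℝ) → CurveClass ℂ, IsSLECurve ((8 : ℝ≥0) / 3) D Γ ∧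
      TendstoLaw
        (fun δ (γ : HexDomainSAW D.carrier δ (a δ) (b δ)) =>
          (⟨⟨γ.curve.range, γ.curve.isCompact_range⟩, γ.curve.range_nonempty⟩ :
            TopologicalSpace.NonemptyCompacts ℂ))
        (fun δ => hexSAWLaw D.carrier δ (a δ) (b δ))
        (fun ω => (⟨⟨(Γ ω).range, (Γ ω).isCompact_range⟩, (Γ ω).range_nonempty⟩ :
            TopologicalSpace.NonemptyCompacts ℂ))
        Literature.Probability.Process.preWienerMeasure

/-- STATEMENT 4 — `RangeIdentification`: the avoidance cocycle identifies the range. -/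
def RangeIdentification : Prop :=
  HexAvoidanceCocycle → HexRangeLimit

/-- STATEMENT 5 — `HexNonRetracing` (the ONE regularity input): in the flat-boundary class, for every
`ℓ > 0` and `η > 0` there is `ε > 0` with, eventually as `δ → 0⁺`,
`P_δ[γ_δ has an (ε, ℓ)-triple strand] ≤ η`. -/
def HexNonRetracing : Prop :=
  ∀ (D : DobrushinDomain) (ρ : ℝ) (a b : ℝ → HexVertex),
    0 < ρ →
    (∀ i : Fin 2, D.carrier ∩ Metric.ball (D.pt i) ρ = {z : ℂ | (D.pt i).im < z.im} ∩ Metric.ball (D.pt i) ρ) →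
    IsEmbEndpointApprox hexGraph hexCenter D a b →
    (∀ᶠ δ : ℝ in 𝓝[>] 0,
      (a δ ∈ embMeshDomain hexGraph hexCenter D.carrier δ ∧
        ∃ w, hexGraph.Adj (a δ) w ∧ ¬ (hexDomainGraph D.carrier δ).Adj (a δ) w) ∧
      (b δ ∈ embMeshDomain hexGraph hexCenter D.carrier δ ∧
        ∃ w, hexGraph.Adj (b δ) w ∧ ¬ (hexDomainGraph D.carrier δ).Adj (b δ) w)) →
    ∀ ℓ : ℝ, 0 < ℓ → ∀ η : ℝ, 0 < η → ∃ ε : ℝ, 0 < ε ∧ ∀ᶠ δ : ℝ in 𝓝[>] 0,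
      hexSAWLaw D.carrier δ (a δ) (b δ)
          {γ | ∃ c : Curve ℂ, CurveClass.mk c = γ.curve ∧ ∃ s t : Fin 3 → unitInterval,
            (∀ i, s i ≤ t i) ∧ t 0 < s 1 ∧ t 1 < s 2 ∧
            (∀ i, ℓ ≤ Metric.diam ((⇑c) '' Set.Icc (s i) (t i))) ∧
            ∀ i j, Metric.hausdorffDist ((⇑c) '' Set.Icc (s i) (t i))
              ((⇑c) '' Set.Icc (s j) (t j)) ≤ ε} ≤ ENNReal.ofReal η

/-- STATEMENT 6 — `CurveUpgrade` (ABSTRACT, all curve families; deterministic topology + portmanteau):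
if `Γ` is a chordal SLE_{8/3} curve of `D`, the interfaces `X δ` are eventually a.e.-measurable, their
RANGES converge in law to the range of `Γ`, their endpoints are deterministic (`src δ`, `tgt δ`) and
tend to the marks, and triple strands die in law (`ε → 0` after `δ → 0`), then `X δ → SLE_{8/3}` in law
in `CurveClass ℂ`. Mechanism: the SLE_{8/3} trace is a.s. a simple arc `η` from `a` to `b`; a curve
whose range is Hausdorff-`ε`-close to `η`, with the right endpoints and NO parameter backtrack of size
`h` (measured through the nearest-point projection to `η`, well defined up to the injectivity modulus
`ω_η(2ε)`), is within `osc_η(h + 2ω_η(2ε)) + ε` of `η` modulo reparametrisation; and an `h`-backtrack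
forces three passes over `η[u, u+h]`, i.e. an `(ε', ℓ')`-triple strand with `ε' = 2ε + 2 osc_η(ω_η(2ε))`,
`ℓ' = diam η[u,u+h] − ε'`; tightness in `CurveClass` and identification of every subsequential limit
follow (the range of the limit has the law of the SLE range, a simple arc a.s.; a non-retracing curve
onto a simple arc with source `a` is that arc). -/
def CurveUpgrade : Prop :=
  ∀ (D : DobrushinDomain) (Ω : ℝ → Type) [∀ δ, MeasurableSpace (Ω δ)]
    (X : ∀ δ, Ω δ → CurveClass ℂ) (P : ∀ δ, Measure (Ω δ))
    (Γ : (ℝ≥0 → ℝ) → CurveClass ℂ) (src tgt : ℝ → ℂ),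
    IsSLECurve ((8 : ℝ≥0) / 3) D Γ →
    (∀ᶠ δ : ℝ in 𝓝[>] 0, AEMeasurable (X δ) (P δ)) →
    TendstoLaw
        (fun δ ω => (⟨⟨(X δ ω).range, (X δ ω).isCompact_range⟩, (X δ ω).range_nonempty⟩ :
            TopologicalSpace.NonemptyCompacts ℂ))
        P
        (fun ω => (⟨⟨(Γ ω).range, (Γ ω).isCompact_range⟩, (Γ ω).range_nonempty⟩ :
            TopologicalSpace.NonemptyCompacts ℂ))
        Literature.Probability.Process.preWienerMeasure →
    (∀ δ ω, (X δ ω).source = src δ) → (∀ δ ω, (X δ ω).target = tgt δ) →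
    Tendsto src (𝓝[>] 0) (𝓝 (D.pt 0)) → Tendsto tgt (𝓝[>] 0) (𝓝 (D.pt 1)) →
    (∀ ℓ : ℝ, 0 < ℓ → ∀ η : ℝ, 0 < η → ∃ ε : ℝ, 0 < ε ∧ ∀ᶠ δ : ℝ in 𝓝[>] 0,
      P δ {ω | ∃ c : Curve ℂ, CurveClass.mk c = X δ ω ∧ ∃ s t : Fin 3 → unitInterval,
            (∀ i, s i ≤ t i) ∧ t 0 < s 1 ∧ t 1 < s 2 ∧
            (∀ i, ℓ ≤ Metric.diam ((⇑c) '' Set.Icc (s i) (t i))) ∧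
            ∀ i j, Metric.hausdorffDist ((⇑c) '' Set.Icc (s i) (t i))
              ((⇑c) '' Set.Icc (s j) (t j)) ≤ ε} ≤ ENNReal.ofReal η) →
    ConvergesInLawToSLE ((8 : ℝ≥0) / 3) D X P

/-- STATEMENT 7's hypothesis — `HexConjectureFlatBoundary`: the crux restricted to the flat-boundary
class (flat horizontal pieces at both marks; discrete-boundary lattice endpoints). This is what stubs
1–6 deliver (`hexConjectureFlatBoundary_of_line`). -/
def HexConjectureFlatBoundary : Prop :=
  ∀ (D : DobrushinDomain) (ρ : ℝ) (a b : ℝ → HexVertex),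
    0 < ρ →
    (∀ i : Fin 2, D.carrier ∩ Metric.ball (D.pt i) ρ = {z : ℂ | (D.pt i).im < z.im} ∩ Metric.ball (D.pt i) ρ) →
    IsEmbEndpointApprox hexGraph hexCenter D a b →
    (∀ᶠ δ : ℝ in 𝓝[>] 0,
      (a δ ∈ embMeshDomain hexGraph hexCenter D.carrier δ ∧
        ∃ w, hexGraph.Adj (a δ) w ∧ ¬ (hexDomainGraph D.carrier δ).Adj (a δ) w) ∧
      (b δ ∈ embMeshDomain hexGraph hexCenter D.carrier δ ∧
        ∃ w, hexGraph.Adj (b δ) w ∧ ¬ (hexDomainGraph D.carrier δ).Adj (b δ) w)) →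
    ConvergesInLawToSLE ((8 : ℝ≥0) / 3) D
      (fun δ (γ : HexDomainSAW D.carrier δ (a δ) (b δ)) => γ.curve)
      (fun δ => hexSAWLaw D.carrier δ (a δ) (b δ))

/-- STATEMENT 7 — `MarksAndEndpoints` (FOREIGN residual): the flat-boundary class suffices. -/
def MarksAndEndpoints : Prop :=
  HexConjectureFlatBoundary → Summit.CriticalPhenomena.SAWScalingLimit.Theses.SAWHexUniversality.HexConjecture

/-! ## The FLOOR class (lead continuation c1 reshape; the class of crux-10472's landed canonical transfer)

Standing "floor class" hypotheses, inlined as ONE conjunction in statements 3♭–5♭ and 7♭: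
`0 < ρ ∧ im (pt 1) = im (pt 0) ∧ D ⊆ {im z > im (pt 0)} ∧` flat horizontal half-discs of radius `ρ` at both marks
(verbatim `FloorRatio`'s `IsFloorDomain D ρ` unfolded); endpoints as before (`IsEmbEndpointApprox` + eventually
discrete-boundary vertices, which inside the flat balls are exactly the floor vertices of 10472's
`IsFloorEndpointApprox`, `RootLocality.stub_avoidanceCocycle_floorEndpoint`). -/

/-- STATEMENT 3♭'s conclusion — `HexAvoidanceCocycleFloor`: the avoidance cocycle with its LSW value for the
canonical law, FLOOR class (verbatim the conclusion of the landed `RootLocality.hexAvoidanceCocycle_floor_of_hullApprox`). -/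
def HexAvoidanceCocycleFloor : Prop :=
  ∀ (D D' : DobrushinDomain) (ρ : ℝ) (a b : ℝ → HexVertex) (μ : Measure (CurveClass ℂ)),
    (0 < ρ ∧ (D.pt 1).im = (D.pt 0).im ∧ D.carrier ⊆ {z : ℂ | (D.pt 0).im < z.im} ∧
      D.carrier ∩ Metric.ball (D.pt 0) ρ = {z : ℂ | (D.pt 0).im < z.im} ∩ Metric.ball (D.pt 0) ρ ∧
      D.carrier ∩ Metric.ball (D.pt 1) ρ = {z : ℂ | (D.pt 1).im < z.im} ∩ Metric.ball (D.pt 1) ρ) →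
    IsEmbEndpointApprox hexGraph hexCenter D a b →
    (∀ᶠ δ : ℝ in 𝓝[>] 0,
      (a δ ∈ embMeshDomain hexGraph hexCenter D.carrier δ ∧
        ∃ w, hexGraph.Adj (a δ) w ∧ ¬ (hexDomainGraph D.carrier δ).Adj (a δ) w) ∧
      (b δ ∈ embMeshDomain hexGraph hexCenter D.carrier δ ∧
        ∃ w, hexGraph.Adj (b δ) w ∧ ¬ (hexDomainGraph D.carrier δ).Adj (b δ) w)) →
    D.IsHullSubdomain D' → IsSLELaw ((8 : ℝ≥0) / 3) D μ →
    Tendsto (fun δ : ℝ =>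
        ((hexSAWLaw D.carrier δ (a δ) (b δ)).map
            (fun γ : HexDomainSAW D.carrier δ (a δ) (b δ) => γ.curve))
          (CurveClass.rangeSubset (closure D'.carrier)))
      (𝓝[>] 0) (𝓝 (μ (CurveClass.rangeSubset (closure D'.carrier))))

/-- STATEMENT 3♭ — `AvoidanceCocycleFloorFromObservable`: statements 1 and 2 give the floor-class cocycle
(PROVABLE NOW: `hexAvoidanceCocycle_floor_of_hullApprox` + `FloorRatio.hullApprox`; wave 1 of seat c1). -/
def AvoidanceCocycleFloorFromObservable : Prop :=
  ObservableLimit → RootDominance → HexAvoidanceCocycleFloor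

/-- STATEMENT 2♯ — `HalfPlaneArchTightness` (THE LEVER IN POSITIVE FORM; verbatim crux-10472's registered open stub
`stub_halfPlaneArchTightness`, line `floor-ratio-restriction-bootstrap`): for floor mid-edges `s, t` at mutual distance `≤ n` of a domain
`Λ` above the floor through `s`, the `x_c`-mass of walks `s → t` reaching distance `≥ K n` is at most `ε` times the mass of walks `s → t`
in the half-box `B` of radius `2Kn` — uniformly in the span `n` (boundary two-leg / arch tightness; σ = 0, masses only, no phases). -/
def HalfPlaneArchTightness : Prop :=
  ∀ ε : ℝ, 0 < ε → ∃ K : ℝ, 0 < K ∧ ∀ (n : ℕ), 1 ≤ n → ∀ (Λ B : Finset HexVertex)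
    (s t : Sym2 HexVertex), s ∈ hexDomainBoundary Λ → t ∈ hexDomainBoundary Λ → s ≠ t →
    dist (hexMidpoint s) (hexMidpoint t) ≤ n → (hexMidpoint t).im = (hexMidpoint s).im →
    (∀ v ∈ Λ, (hexMidpoint s).im < (hexCenter v).im) →
    (∀ v : HexVertex, v ∈ B ↔ ((hexMidpoint s).im < (hexCenter v).im ∧
      dist (hexCenter v) (hexMidpoint s) ≤ 2 * K * n)) →
    (∑ γ : HexMidEdgeSAW Λ s t, if ∃ v ∈ γ.verts, K * n ≤ dist (hexCenter v) (hexMidpoint s)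
      then hexCriticalFugacity ^ γ.length else 0) ≤
    ε * ∑ γ : HexMidEdgeSAW B s t, hexCriticalFugacity ^ γ.length

/-- STATEMENT 2♭♭ — `WindowArchLocality` (WAL; THE LEVER AFTER THE c5 RESHAPE = the WINDOW AVERAGE of 2♯).  For the vertical floor
mid-edge `s_x` of a cell `x`, a finite `Λ` in the rows `≥ x₁`, the lattice half-box `B = {rows ≥ x₁, |c_v − mid s_x| ≤ R}` and the one-sided
floor window `S = {d : θ₁R ≤ d ≤ θ₀R}` of endpoints `t_d = s_{x + d e₀}`: the `x_c`-mass of the walks `s_x → t_d` in `Λ` reaching distance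
`≥ R`, SUMMED over `d ∈ S`, is at most `η` times the mass of the walks `s_x → t_d` in `B`, SUMMED over `d ∈ S` — for every `η > 0`, all
`θ₀` below some `θb(η)`, some `θ₁(η, θ₀) ∈ (0, θ₀)` and all `R ≥ R₀(η, θ₀)`.  Endpoint-summed on both sides.  Implied by 2♯ termwise
(`windowArchLocality_of_halfPlaneArchTightness`, p121715) and by a common tail exponent of the half-plane arch measure (reach-tail
`≤ C R^{-α}`, span-tail `≥ c R^{-α}`, any `α ∈ (0,1)`; predicted `α = 1/4`).  OPEN. -/
def WindowArchLocality : Prop :=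
  ∀ η : ℝ, 0 < η → ∃ θb : ℝ, 0 < θb ∧ ∀ θ₀ : ℝ, 0 < θ₀ → θ₀ ≤ θb →
    ∃ θ₁ : ℝ, 0 < θ₁ ∧ θ₁ < θ₀ ∧ ∃ R₀ : ℝ, 0 < R₀ ∧ ∀ R : ℝ, R₀ ≤ R →
    ∀ (x : Site 2) (Λ B : Finset HexVertex) (S : Finset ℤ),
      (∀ v ∈ Λ, x 1 ≤ v.1 1) →
      (∀ v : HexVertex, v ∈ B ↔ (x 1 ≤ v.1 1 ∧
        dist (hexCenter v) (hexMidpoint s((x - Pi.single 1 1, 1), (x, 0))) ≤ R)) →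
      (∀ d : ℤ, d ∈ S ↔ (θ₁ * R ≤ (d : ℝ) ∧ (d : ℝ) ≤ θ₀ * R)) →
      ∑ d ∈ S, (∑ γ : HexMidEdgeSAW Λ s((x - Pi.single 1 1, 1), (x, 0))
          s((x + Pi.single 0 d - Pi.single 1 1, 1), (x + Pi.single 0 d, 0)),
        if ∃ v ∈ γ.verts, R ≤ dist (hexCenter v) (hexMidpoint s((x - Pi.single 1 1, 1), (x, 0)))
        then hexCriticalFugacity ^ γ.length else 0) ≤
      η * ∑ d ∈ S, ∑ γ : HexMidEdgeSAW B s((x - Pi.single 1 1, 1), (x, 0))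
          s((x + Pi.single 0 d - Pi.single 1 1, 1), (x + Pi.single 0 d, 0)),
        hexCriticalFugacity ^ γ.length

/-- 2♯ ⟹ 2♭♭: half-plane arch tightness implies the window-averaged arch locality, termwise (LANDED, p121715). -/
theorem windowArchLocality_of_halfPlaneArchTightness (h : HalfPlaneArchTightness) : WindowArchLocality :=
  Summit.CriticalPhenomena.SAWScalingLimit.Theorems.HexConjecture.RootLocality.windowArchLocality_of_halfPlaneArchTightness h

/-- STATEMENT 2♮ — `ArchAspectBound` (AAB; THE LEVER AFTER THE c6 RESHAPE — `η`-FREE).  For the vertical floor mid-edge `s_x` of a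
cell `x`, a finite `Λ` in the rows `≥ x₁`, the lattice half-box `B = {rows ≥ x₁, |c_v − mid s_x| ≤ R}`, the floor window
`S = {d : θ₁R ≤ d ≤ θaR}` and the reference window `S' = {d : θaR ≤ d ≤ θbR}` of endpoints `t_d = s_{x + d e₀}`: the `x_c`-mass of
the walks `s_x → t_d` in `Λ` reaching distance `≥ R`, SUMMED over `d ∈ S`, is at most `C` times the mass of the walks `s_x → t_d` in
`B`, SUMMED over `d ∈ S'` — for SOME `0 < θa < θb ≤ 1/4`, ONE constant `C`, every `θ₁ ∈ (0, θa)` and all `R ≥ R₀(θ₁)`.  No `η`, no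
locality: given the floor-ratio limit (1♯), whose boundary profile `≍ t^{-5/4}` is not integrable at the root, this order-of-magnitude
bound already yields the window inequality of the bootstrap (`RootLocality.windowIneq_of_aspectBound`).  Conjecturally LHS `≲ θa^{7/4}R^{-1/4}`,
RHS `≍ (θa^{-1/4} − θb^{-1/4})R^{-1/4}`.  Reduces (Krachun–Panagiotis 2023, eq. (2) + Cor. 3.1) to the lower regularity
`Σ_{i≤3T} D_i ≤ C T D_{18T}` of the triangle-walk tails `D_T`.  Not comparable with 2♯/2♭♭ as black boxes.  OPEN. -/
def ArchAspectBound : Prop :=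
  ∃ θa θb C : ℝ, 0 < θa ∧ θa < θb ∧ θb ≤ 1 / 4 ∧ 0 < C ∧ ∀ θ₁ : ℝ, 0 < θ₁ → θ₁ < θa →
    ∃ R₀ : ℝ, 0 < R₀ ∧ ∀ R : ℝ, R₀ ≤ R →
    ∀ (x : Site 2) (Λ B : Finset HexVertex) (S S' : Finset ℤ),
      (∀ v ∈ Λ, x 1 ≤ v.1 1) →
      (∀ v : HexVertex, v ∈ B ↔ (x 1 ≤ v.1 1 ∧
        dist (hexCenter v) (hexMidpoint s((x - Pi.single 1 1, 1), (x, 0))) ≤ R)) →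
      (∀ d : ℤ, d ∈ S ↔ (θ₁ * R ≤ (d : ℝ) ∧ (d : ℝ) ≤ θa * R)) →
      (∀ d : ℤ, d ∈ S' ↔ (θa * R ≤ (d : ℝ) ∧ (d : ℝ) ≤ θb * R)) →
      ∑ d ∈ S, (∑ γ : HexMidEdgeSAW Λ s((x - Pi.single 1 1, 1), (x, 0))
          s((x + Pi.single 0 d - Pi.single 1 1, 1), (x + Pi.single 0 d, 0)),
        if ∃ v ∈ γ.verts, R ≤ dist (hexCenter v) (hexMidpoint s((x - Pi.single 1 1, 1), (x, 0)))
        then hexCriticalFugacity ^ γ.length else 0) ≤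
      C * ∑ d ∈ S', ∑ γ : HexMidEdgeSAW B s((x - Pi.single 1 1, 1), (x, 0))
          s((x + Pi.single 0 d - Pi.single 1 1, 1), (x + Pi.single 0 d, 0)), hexCriticalFugacity ^ γ.length

/-- STATEMENT 2♮♮ — `WindowTwoPointLowerBound` (WTLB; THE LEVER AFTER THE c8 RESHAPE).  For SOME `0 < θa < θb ≤ 1/4`, ONE constant `C`
and all large `R`: for every cell `x`, with `B_R(x) = {rows ≥ x₁, |c_v − mid s_x| ≤ R}` the upper half-box and `S' = {d : θa R ≤ d ≤ θb R}`
the reference window of floor offsets, the Glazman–Manolescu triangle tail at the comparable scale is dominated by the window two-point mass: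
`triDl ⌊R/4⌋ ≤ C · Σ_{d ∈ S'} Z_{B_R(x)}(s_x → t_{x + d e₀})` (`HV.triDl L = Σ_K Δ^Δ_{L,K}` = half of Krachun–Panagiotis's `D_{2L+1}`, the
`x_c`-mass of the walks of the lattice triangle `T_L` from the root to its left side; non-increasing, `→ 0`, `c/L ≤ 2cos(π/8)·triDl L`,
`≤ 100 L^{-1e-10}`).  IMPLIES the arch aspect bound 2♮ (`archAspectBound_of_windowTwoPointLowerBound`: the far side of 2♮ is at most
`1/cos(3π/8) − A^Δ(⌊R/4⌋) = 2(cos(π/8)/cos(3π/8))·triDl ⌊R/4⌋` for every `Λ` and inner window).  STATUS: the CUBE version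
`triDl(4⌊R/40⌋)³ ≤ Σ_{d∈[R/40,R/4]} Z_{B_R}` is PROVED (`windowTwoPointLowerBound_cube`, GM's gluing); the window mass is at most
`2(cos(π/8)/cos(3π/8))·triDl(⌈θa R⌉ − 1)` (`farOffsetMass_le_sub_triA`, KP Lemma 2.2); the linear lower bound is Krachun–Panagiotis Cor. 3.1
(confined construction) plus the LOWER REGULARITY `Σ_{i≤3T} D_i ≤ C·T·D_{18T}` of the one sequence `D_T` — OPEN. -/
def WindowTwoPointLowerBound : Prop :=
  ∃ θa θb C : ℝ, 0 < θa ∧ θa < θb ∧ θb ≤ 1 / 4 ∧ 0 < C ∧ ∃ R₀ : ℝ, 0 < R₀ ∧ ∀ R : ℝ, R₀ ≤ R →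
    ∀ (x : Site 2) (B : Finset HexVertex) (S' : Finset ℤ),
      (∀ v : HexVertex, v ∈ B ↔ (x 1 ≤ v.1 1 ∧
        dist (hexCenter v) (hexMidpoint s((x - Pi.single 1 1, 1), (x, 0))) ≤ R)) →
      (∀ d : ℤ, d ∈ S' ↔ (θa * R ≤ (d : ℝ) ∧ (d : ℝ) ≤ θb * R)) →
      HV.triDl ⌊R / 4⌋₊ ≤ C * ∑ d ∈ S', ∑ γ : HexMidEdgeSAW B s((x - Pi.single 1 1, 1), (x, 0))
          s((x + Pi.single 0 d - Pi.single 1 1, 1), (x + Pi.single 0 d, 0)), hexCriticalFugacity ^ γ.length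

/-- 2♮♮ ⟹ 2♮: the window two-point lower bound implies the arch aspect bound (LANDED, seat c8, `…AspectBoundOfWindowTwoPoint`). -/
theorem archAspectBound_of_windowTwoPointLowerBound (h : WindowTwoPointLowerBound) : ArchAspectBound :=
  Summit.CriticalPhenomena.SAWScalingLimit.Theorems.HexConjecture.RootLocality.archAspectBound_of_windowTwoPointLowerBound h

/-- RECORD — THE CUBE VERSION OF 2♮♮ IS A THEOREM (seat c8, Glazman–Manolescu's gluing `HV.key_ineq` reflected into the right floor window):
for `R ≥ 40` and every cell `x`, `triDl(4⌊R/40⌋)³ ≤ Σ_{d ∈ [R/40, R/4]} Z_{B_R(x)}(s_x → t_{x + d e₀})`.  What separates it from 2♮♮ is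
"cube ↦ linear": Krachun–Panagiotis 2023 Cor. 3.1 `T⁴D_{18T}⁵ ≤ 2¹⁷(Σ_{i≤3T}D_i)⁴ Σ_{k=T}^{21T} G_k` plus lower regularity of `D`. -/
theorem windowTwoPointLowerBound_cube : ∀ R : ℝ, 40 ≤ R →
    ∀ (x : Site 2) (B : Finset HexVertex) (S' : Finset ℤ),
      (∀ v : HexVertex, v ∈ B ↔ (x 1 ≤ v.1 1 ∧
        dist (hexCenter v) (hexMidpoint s((x - Pi.single 1 1, 1), (x, 0))) ≤ R)) →
      (∀ d : ℤ, d ∈ S' ↔ ((1 / 40 : ℝ) * R ≤ (d : ℝ) ∧ (d : ℝ) ≤ (1 / 4 : ℝ) * R)) →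
      HV.triDl (4 * ⌊R / 40⌋₊) ^ 3 ≤ ∑ d ∈ S', ∑ γ : HexMidEdgeSAW B s((x - Pi.single 1 1, 1), (x, 0))
          s((x + Pi.single 0 d - Pi.single 1 1, 1), (x + Pi.single 0 d, 0)), hexCriticalFugacity ^ γ.length :=
  Summit.CriticalPhenomena.SAWScalingLimit.Theorems.HexConjecture.RootLocality.triDl_cube_le_windowMass

/-- RECORD — THE UPPER COMPANION OF 2♮♮ (seat c8, Krachun–Panagiotis Lemma 2.2 in the tree's vocabulary): floor arch masses beyond offset
`L` weigh at most the triangle tail, `Σ_{d ∈ S} Z_Λ(s_x → t_{x+d e₀}) ≤ 1/cos(3π/8) − A^Δ(L)` (`= 2(cos(π/8)/cos(3π/8))·triDl L`) when `|d| ≥ L+1` on `S`. -/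
theorem windowTwoPointMass_le_triangleTail (x : Site 2) (Λ : Finset HexVertex) (hΛ : ∀ v ∈ Λ, x 1 ≤ v.1 1)
    (L : ℕ) (S : Finset ℤ) (hS : ∀ d ∈ S, (L : ℤ) + 1 ≤ |d|) :
    ∑ d ∈ S, ∑ γ : HexMidEdgeSAW Λ s((x - Pi.single 1 1, 1), (x, 0))
        s((x + Pi.single 0 d - Pi.single 1 1, 1), (x + Pi.single 0 d, 0)), hexCriticalFugacity ^ γ.length ≤
      (Real.cos (3 * Real.pi / 8))⁻¹ - HV.triA L :=
  Summit.CriticalPhenomena.SAWScalingLimit.Theorems.HexConjecture.RootLocality.farOffsetMass_le_sub_triA x Λ hΛ L S hS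

/-- STATEMENT 2♮♮-T — `TailFraction` (TAILFRAC; first half of the second sufficient pair for 2♮♮, seat c8).  Writing `coded_N(d)` for the critical
floor-arch mass of the Duminil-Copin–Smirnov trapezoid `S_{N+1,N+1}` at offset `d` (= `Z_{S_x(N)}(s_x → t_{x+d e₀})` at every root cell): for some
`ε > 0` and all large `T` some strip carries floor-arch mass `≥ ε·triDl T` BEYOND `±T` — a fixed fraction of the half-plane arches not contained in
the lattice triangle `T_T` (total `2(cos(π/8)/cos(3π/8))·triDl T`) END far instead of returning near the root.  OPEN (conjecturally both parts
`≍ T^{-1/4}`). -/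
def TailFraction : Prop :=
  ∃ ε : ℝ, 0 < ε ∧ ∃ T₀ : ℕ, ∀ T : ℕ, T₀ ≤ T → ∃ N : ℕ, ε * HV.triDl T ≤ ∑ d ∈ ((Finset.Icc (-((N : ℤ) + 1)) ((N : ℤ) + 1)).erase 0).filter (fun d => (T : ℤ) + 1 ≤ |d|), ∑ P ∈ (HV.midWalks (HV.stripV (N + 1) (N + 1))).filter (fun P => HV.finalDart P = ((d, 0, false), (d, -1, true)) ∨ HV.finalDart P = ((d, -1, true), (d, 0, false))), hexCriticalFugacity ^ HV.mwLen P

/-- STATEMENT 2♮♮-D — `TriangleTailDrop` (DROP; second half): the non-increasing triangle tail drops by a fixed factor `q < 1` over a bounded scale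
ratio `Λ₀` — no long plateaus (UPPER regularity of the one sequence `triDl`; NOT implied by Krachun–Panagiotis's (12), which excludes a plateau of
ratio `Λ` only for `Λ > exp(C/D⁴)`).  OPEN. -/
def TriangleTailDrop : Prop :=
  ∃ q : ℝ, 0 ≤ q ∧ q < 1 ∧ ∃ Λ₀ : ℕ, 1 ≤ Λ₀ ∧ ∃ T₀ : ℕ, ∀ T : ℕ, T₀ ≤ T → HV.triDl (Λ₀ * T) ≤ q * HV.triDl T

/-- 2♮♮-T ∧ 2♮♮-D ⟹ 2♮♮: the window two-point lower bound from a tail fraction and a drop (LANDED, seat c8, `…WindowTwoPointOfTailFraction` p130078;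
evenness of the coded sums `…CodedReflect` p129924, fixed-scale split `…TailSplitFixedScale` p130000). -/
theorem windowTwoPointLowerBound_of_tailFraction_of_drop (hT : TailFraction) (hD : TriangleTailDrop) : WindowTwoPointLowerBound :=
  Summit.CriticalPhenomena.SAWScalingLimit.Theorems.HexConjecture.RootLocality.windowTwoPointLowerBound_of_tailFraction_of_drop' hT hD

/-- STATEMENT 2♮♮-R — `TriDlLowerRegular` (REG; THE LEVER'S SUFFICIENT FORM AFTER THE c9 RESHAPE, registered `stub_triDlLowerRegular`).  LOWER
regularity of the ONE explicit non-increasing sequence `triDl` (the Glazman–Manolescu triangle tail = half of Krachun–Panagiotis's `D_{2T+1}`):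
its partial sums are at most a constant times `T` times the last term, `Σ_{i ≤ T} triDl i ≤ C·(T+1)·triDl T` — no sudden drops.  True for every
regularly varying sequence of index `> −1` (predicted `triDl T ≍ T^{-1/4}`); the tree knows `x_c^{2T+1} ≤ triDl T` (`triDlPos_pow_le_triDl`),
`triDl T ≤ C·T^{-ε}` (`RootLocality.kp_triDl_rpow_decay`, KP) and monotonicity.  OPEN (an RSW-type regularity statement for the critical half-plane walk). -/
def TriDlLowerRegular : Prop :=
  ∃ C : ℝ, ∀ T : ℕ, 1 ≤ T → ∑ i ∈ Finset.range (T + 1), HV.triDl i ≤ C * ((T : ℝ) + 1) * HV.triDl T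

/-- 2♮♮-R ⟹ 2♮♮: the window two-point lower bound from the lower regularity of the triangle tail (LANDED, seat c9, `…WindowTwoPointOfReg`:
Krachun–Panagiotis's renewal construction in confined form — `stub_kp_dichotomy`, `stub_kp_analytic`, `stub_kp_transfer`). -/
theorem windowTwoPointLowerBound_of_triDlLowerRegular (h : TriDlLowerRegular) : WindowTwoPointLowerBound :=
  Summit.CriticalPhenomena.SAWScalingLimit.Theorems.HexConjecture.RootLocality.stub_windowTwoPointLowerBound_of_reg h

/- RECORD — KRACHUN–PANAGIOTIS'S THEOREM IS IN THE TREE (seat c9, UNCONDITIONAL, file `…KPTheorem2`, p142700; not imported here only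
because the check farm lags the tree): `RootLocality.kp_triDl_rpow_decay : ∃ ε > 0, C, ∀ T ≥ 1, triDl T ≤ C·T^(−ε)`, and for bridges
`RootLocality.kp_stripB_rpow_decay` / `RootLocality.kp_stripBlim_rpow_decay` (`B_{T'} ≤ C'·T'^(−ε)`, `T' ≥ 3`). -/

/-- STATEMENT 2♮♮-D — `TriDlDoubling` (c10; THE LEVER'S CLEANEST SUFFICIENT FORM, registered `stub_triDlDoubling`): DOUBLING regularity of the
triangle tail at LARGE scales — `∃ q > 1/2, ∃ T₀, ∀ T ≥ T₀, q·triDl T ≤ triDl(2T)`.  Predicted ratio `triDl(2T)/triDl T → 2^{-1/4} ≈ 0.84` (LSW exponents);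
measured `0.884, 0.867, 0.853, 0.850` at `T = 2, 4, 8, 16` (c8, j020661).  Implies REG (`triDlLowerRegular_of_triDlDoubling`, LANDED c10
`RootLocality.reg_of_doublingEventually`: rescale to `n ↦ triDl(nT₀)` and sum dyadic blocks), hence 2♮♮.  OPEN — the same RSW-type content as REG
(an `O(1)`-cost extension of escaping walks across `Tria_{2T} ∖ Tria_T`). -/
def TriDlDoubling : Prop :=
  ∃ q : ℝ, 1 / 2 < q ∧ ∃ T₀ : ℕ, ∀ T : ℕ, T₀ ≤ T → q * HV.triDl T ≤ HV.triDl (2 * T)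

/-- 2♮♮-D ⟹ 2♮♮-R: doubling at large scales gives the lower regularity of the triangle tail (LANDED, seat c10, `…DoublingEventually` p146440). -/
theorem triDlLowerRegular_of_triDlDoubling (h : TriDlDoubling) : TriDlLowerRegular := by
  obtain ⟨q, hq, T₀, hd⟩ := h
  exact Summit.CriticalPhenomena.SAWScalingLimit.Theorems.HexConjecture.RootLocality.reg_of_doublingEventually hq
    (le_max_right T₀ 1) (fun T hT => hd T ((le_max_left T₀ 1).trans hT))

/-- 2♮♮-D ⟹ 2♮♮: doubling at large scales gives the window two-point lower bound (LANDED, seat c10). -/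
theorem windowTwoPointLowerBound_of_triDlDoubling (h : TriDlDoubling) : WindowTwoPointLowerBound :=
  windowTwoPointLowerBound_of_triDlLowerRegular (triDlLowerRegular_of_triDlDoubling h)

/-- STATEMENT 2♮♮-loc(a) — `TriDlLowerRegularNear K R` (c10 RECORD): the lower-regularity inequality with constant `K` at the finitely many scales
`s` comparable to the radius `R` (`⌈R/168⌉ ≤ 4(s+1)`, `s ≤ 5⌈R/168⌉`, i.e. `s ∈ [R/672 − 1, 5R/168 + 5]`). -/
def TriDlLowerRegularNear (K R : ℝ) : Prop :=
  ∀ s : ℕ, ⌈R / 168⌉₊ ≤ 4 * (s + 1) → s ≤ 5 * ⌈R / 168⌉₊ →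
    ∑ i ∈ Finset.range (s + 1), HV.triDl i ≤ K * ((s : ℝ) + 1) * HV.triDl s

/-- STATEMENT 2♮♮-loc(b) — `WindowTwoPointLowerBoundAt C R` (c10 RECORD): the window inequality of 2♮♮ at ONE radius `R` with `θa = 1/168`,
`θb = 1/4` and constant `C`. -/
def WindowTwoPointLowerBoundAt (C R : ℝ) : Prop :=
  ∀ (x : Site 2) (B : Finset HexVertex) (S' : Finset ℤ),
    (∀ v : HexVertex, v ∈ B ↔ (x 1 ≤ v.1 1 ∧
      dist (hexCenter v) (hexMidpoint s((x - Pi.single 1 1, 1), (x, 0))) ≤ R)) →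
    (∀ d : ℤ, d ∈ S' ↔ ((1 / 168 : ℝ) * R ≤ (d : ℝ) ∧ (d : ℝ) ≤ (1 / 4 : ℝ) * R)) →
    HV.triDl ⌊R / 4⌋₊ ≤ C * ∑ d ∈ S', ∑ γ : HexMidEdgeSAW B s((x - Pi.single 1 1, 1), (x, 0))
        s((x + Pi.single 0 d - Pi.single 1 1, 1), (x + Pi.single 0 d, 0)), hexCriticalFugacity ^ γ.length

/-- RECORD (c10) — THE REDUCTION 2♮♮ ⟸ 2♮♮-R IS SCALE-LOCAL (LANDED, `RootLocality.windowTwoPointLowerBoundAt_of_regNear`, composing the registered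
sub-goals `stub_kp_analytic_local` p145263 and `stub_kp_transfer_at` p144913 over `stub_kp_dichotomy`): for every `K ≥ 1` there is ONE constant
`C = C(K)` such that for EVERY radius `R ≥ 600`, REG with constant `K` on the scales comparable to `R` gives the window inequality at `R`.  This is the
interface a "good scales" / adaptive-radius version of the bootstrap would consume; upstream, the set of good radii is `{R : r(s) ≤ K on [R/672−1, 5R/168+5]}`. -/
theorem windowTwoPointLowerBoundAt_of_triDlLowerRegularNear : ∀ K : ℝ, 1 ≤ K → ∃ C : ℝ, 0 < C ∧
    ∀ R : ℝ, 600 ≤ R → TriDlLowerRegularNear K R → WindowTwoPointLowerBoundAt C R := by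
  -- (= `RootLocality.windowTwoPointLowerBoundAt_of_regNear`, file `…WindowTwoPointAtScale` p147951; reproduced from its two registered
  -- sub-goals so that the skeleton elaborates before the check farm has built that module)
  intro K hK
  obtain ⟨c, hc, hmain⟩ :=
    Summit.CriticalPhenomena.SAWScalingLimit.Theorems.HexConjecture.RootLocality.stub_kp_analytic_local K _ _ hK
      (div_pos (Real.cos_pos_of_mem_Ioo ⟨by linarith [Real.pi_pos], by linarith [Real.pi_pos]⟩)
        (mul_pos (by norm_num) (Real.cos_pos_of_mem_Ioo ⟨by linarith [Real.pi_pos], by linarith [Real.pi_pos]⟩)) :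
        0 < Real.cos (Real.pi / 8) / (16 * Real.cos (Real.pi / 4)))
      (by norm_num : (0 : ℝ) < 15 / 64)
  refine ⟨c⁻¹, inv_pos.2 hc, fun R hR hloc x B S' hB hS' => ?_⟩
  have hT1 : 1 ≤ ⌈R / 168⌉₊ := Nat.one_le_ceil_iff.2 (by positivity)
  have hstrip := hmain (fun T => ∑ d ∈ Finset.Icc (T : ℤ) (21 * T),
    ∑ P ∈ (HV.midWalks (HV.stripV (32 * T + 1) (32 * T + 1))).filter
      (fun P => HV.finalDart P = ((d, 0, false), (d, -1, true)) ∨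
        HV.finalDart P = ((d, -1, true), (d, 0, false))), hexCriticalFugacity ^ HV.mwLen P) ⌈R / 168⌉₊ hT1 hloc
      (fun M₁ M₂ h₁ h₂ => Summit.CriticalPhenomena.SAWScalingLimit.Theorems.HexConjecture.RootLocality.stub_kp_dichotomy
        ⌈R / 168⌉₊ hT1 M₁ M₂ h₁ h₂)
  exact Summit.CriticalPhenomena.SAWScalingLimit.Theorems.HexConjecture.RootLocality.stub_kp_transfer_at _ (fun T => rfl)
    c R hc hR hstrip x B S' hB hS'

/-- STATEMENT 3♮♮ — `AvoidanceCocycleFloorFromWindowTwoPoint`: statements 1♯ and 2♮♮ give the floor-class cocycle (2♮♮ ⟹ 2♮ ⟹ cocycle). -/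
def AvoidanceCocycleFloorFromWindowTwoPoint : Prop :=
  FloorRatioLimit → WindowTwoPointLowerBound → HexAvoidanceCocycleFloor

/-- STATEMENT 3♮ — `AvoidanceCocycleFloorFromAspect`: statements 1♯ and 2♮ give the floor-class cocycle (LANDED glue, seat c6:
`RootLocality.hexAvoidanceCocycleFloor_of_aspectBound` over the bootstrap `restrictionCocycle_of_aspectBound`). -/
def AvoidanceCocycleFloorFromAspect : Prop :=
  FloorRatioLimit → ArchAspectBound → HexAvoidanceCocycleFloor

/-- STATEMENT 3♭♭ — `AvoidanceCocycleFloorFromWindow`: statements 1♯ and 2♭♭ give the floor-class cocycle (LANDED glue, seat c5: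
`RootLocality.hexAvoidanceCocycleFloor_of_windowLocality` over the re-plumbed bootstrap `restrictionCocycle_of_windowLocality`). -/
def AvoidanceCocycleFloorFromWindow : Prop :=
  FloorRatioLimit → WindowArchLocality → HexAvoidanceCocycleFloor

/-- STATEMENT 3♯ — `AvoidanceCocycleFloorFromArch`: statements 1 and 2♯ give the floor-class cocycle (LANDED glue,
`RootLocality.hexAvoidanceCocycleFloor_of_archTightness`, p116148, over crux-10472's landed chain). -/
def AvoidanceCocycleFloorFromArch : Prop :=
  ObservableLimit → HalfPlaneArchTightness → HexAvoidanceCocycleFloor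

/-- STATEMENT 3♯♯ — `AvoidanceCocycleFloorFromRatio`: statements 1♯ and 2♯ give the floor-class cocycle (LANDED glue,
`RootLocality.hexAvoidanceCocycleFloor_of_floorRatioLimit`, file `…FloorRatioAssembly` p117152; reproduced inline below). -/
def AvoidanceCocycleFloorFromRatio : Prop :=
  FloorRatioLimit → HalfPlaneArchTightness → HexAvoidanceCocycleFloor

/-- STATEMENT 4♭'s conclusion — `HexRangeLimitFloor`: range convergence to the SLE_{8/3} range, floor class. -/
def HexRangeLimitFloor : Prop :=
  ∀ (D : DobrushinDomain) (ρ : ℝ) (a b : ℝ → HexVertex),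
    (0 < ρ ∧ (D.pt 1).im = (D.pt 0).im ∧ D.carrier ⊆ {z : ℂ | (D.pt 0).im < z.im} ∧
      D.carrier ∩ Metric.ball (D.pt 0) ρ = {z : ℂ | (D.pt 0).im < z.im} ∩ Metric.ball (D.pt 0) ρ ∧
      D.carrier ∩ Metric.ball (D.pt 1) ρ = {z : ℂ | (D.pt 1).im < z.im} ∩ Metric.ball (D.pt 1) ρ) →
    IsEmbEndpointApprox hexGraph hexCenter D a b →
    (∀ᶠ δ : ℝ in 𝓝[>] 0,
      (a δ ∈ embMeshDomain hexGraph hexCenter D.carrier δ ∧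
        ∃ w, hexGraph.Adj (a δ) w ∧ ¬ (hexDomainGraph D.carrier δ).Adj (a δ) w) ∧
      (b δ ∈ embMeshDomain hexGraph hexCenter D.carrier δ ∧
        ∃ w, hexGraph.Adj (b δ) w ∧ ¬ (hexDomainGraph D.carrier δ).Adj (b δ) w)) →
    ∃ Γ : (ℝ≥0 → ℝ) → CurveClass ℂ, IsSLECurve ((8 : ℝ≥0) / 3) D Γ ∧
      TendstoLaw
        (fun δ (γ : HexDomainSAW D.carrier δ (a δ) (b δ)) =>
          (⟨⟨γ.curve.range, γ.curve.isCompact_range⟩, γ.curve.range_nonempty⟩ :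
            TopologicalSpace.NonemptyCompacts ℂ))
        (fun δ => hexSAWLaw D.carrier δ (a δ) (b δ))
        (fun ω => (⟨⟨(Γ ω).range, (Γ ω).isCompact_range⟩, (Γ ω).range_nonempty⟩ :
            TopologicalSpace.NonemptyCompacts ℂ))
        Literature.Probability.Process.preWienerMeasure

/-- STATEMENT 4♭ — `RangeIdentificationFloor` (PROVABLE NOW: the landed proof of `stub_rangeIdentification` is
pointwise in `(D, a, b)` — `Range.exists_subseqLimit`, `Range.eq_map_range_of_inherits`; wave 1 of seat c1). -/
def RangeIdentificationFloor : Prop :=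
  HexAvoidanceCocycleFloor → HexRangeLimitFloor

/-- STATEMENT 5♭ — `HexNonRetracingFloor` (OPEN SAW estimate; the old statement 5 restricted to the floor class,
hence formally weaker). -/
def HexNonRetracingFloor : Prop :=
  ∀ (D : DobrushinDomain) (ρ : ℝ) (a b : ℝ → HexVertex),
    (0 < ρ ∧ (D.pt 1).im = (D.pt 0).im ∧ D.carrier ⊆ {z : ℂ | (D.pt 0).im < z.im} ∧
      D.carrier ∩ Metric.ball (D.pt 0) ρ = {z : ℂ | (D.pt 0).im < z.im} ∩ Metric.ball (D.pt 0) ρ ∧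
      D.carrier ∩ Metric.ball (D.pt 1) ρ = {z : ℂ | (D.pt 1).im < z.im} ∩ Metric.ball (D.pt 1) ρ) →
    IsEmbEndpointApprox hexGraph hexCenter D a b →
    (∀ᶠ δ : ℝ in 𝓝[>] 0,
      (a δ ∈ embMeshDomain hexGraph hexCenter D.carrier δ ∧
        ∃ w, hexGraph.Adj (a δ) w ∧ ¬ (hexDomainGraph D.carrier δ).Adj (a δ) w) ∧
      (b δ ∈ embMeshDomain hexGraph hexCenter D.carrier δ ∧
        ∃ w, hexGraph.Adj (b δ) w ∧ ¬ (hexDomainGraph D.carrier δ).Adj (b δ) w)) →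
    ∀ ℓ : ℝ, 0 < ℓ → ∀ η : ℝ, 0 < η → ∃ ε : ℝ, 0 < ε ∧ ∀ᶠ δ : ℝ in 𝓝[>] 0,
      hexSAWLaw D.carrier δ (a δ) (b δ)
          {γ | ∃ c : Curve ℂ, CurveClass.mk c = γ.curve ∧ ∃ s t : Fin 3 → unitInterval,
            (∀ i, s i ≤ t i) ∧ t 0 < s 1 ∧ t 1 < s 2 ∧
            (∀ i, ℓ ≤ Metric.diam ((⇑c) '' Set.Icc (s i) (t i))) ∧
            ∀ i j, Metric.hausdorffDist ((⇑c) '' Set.Icc (s i) (t i))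
              ((⇑c) '' Set.Icc (s j) (t j)) ≤ ε} ≤ ENNReal.ofReal η

/-- STATEMENT 7♭'s hypothesis — `HexConjectureFloor`: the crux on the floor class (what statements 1, 2, 3♭, 4♭,
5♭, 6 deliver: `hexConjectureFloor_of_line`).  Same class as crux-10472's recommended narrowing
`FloorObservableToSLE` (its floor-vertex endpoints = discrete-boundary endpoints here, eventually). -/
def HexConjectureFloor : Prop :=
  ∀ (D : DobrushinDomain) (ρ : ℝ) (a b : ℝ → HexVertex),
    (0 < ρ ∧ (D.pt 1).im = (D.pt 0).im ∧ D.carrier ⊆ {z : ℂ | (D.pt 0).im < z.im} ∧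
      D.carrier ∩ Metric.ball (D.pt 0) ρ = {z : ℂ | (D.pt 0).im < z.im} ∩ Metric.ball (D.pt 0) ρ ∧
      D.carrier ∩ Metric.ball (D.pt 1) ρ = {z : ℂ | (D.pt 1).im < z.im} ∩ Metric.ball (D.pt 1) ρ) →
    IsEmbEndpointApprox hexGraph hexCenter D a b →
    (∀ᶠ δ : ℝ in 𝓝[>] 0,
      (a δ ∈ embMeshDomain hexGraph hexCenter D.carrier δ ∧
        ∃ w, hexGraph.Adj (a δ) w ∧ ¬ (hexDomainGraph D.carrier δ).Adj (a δ) w) ∧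
      (b δ ∈ embMeshDomain hexGraph hexCenter D.carrier δ ∧
        ∃ w, hexGraph.Adj (b δ) w ∧ ¬ (hexDomainGraph D.carrier δ).Adj (b δ) w)) →
    ConvergesInLawToSLE ((8 : ℝ≥0) / 3) D
      (fun δ (γ : HexDomainSAW D.carrier δ (a δ) (b δ)) => γ.curve)
      (fun δ => hexSAWLaw D.carrier δ (a δ) (b δ))

/-- STATEMENT 7♭ — `MarksAndEndpointsFloor` (FOREIGN residual, enlarged by the reshape): the floor class suffices.
Content: (R1) rough / non-floor marks, (R2) endpoint universality, (R3) flat-at-both-marks domains not above a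
common floor line — (R3) is what `stub_canonicalTransferFlat` used to carry. -/
def MarksAndEndpointsFloor : Prop :=
  HexConjectureFloor → Summit.CriticalPhenomena.SAWScalingLimit.Theses.SAWHexUniversality.HexConjecture

/-! ## Crux-10472's endpoint convention (seat c2 reshape): floor-VERTEX endpoints -/

/-- STATEMENT 5♯ — `UniformModulus` (UIM; verbatim crux-10472's registered open stub `stub_uniformModulus`, line
`floor-ratio-restriction-bootstrap`; `Cruxes/ObservableToSLE/Restatement.lean`): on every floor domain with floor-vertex
endpoints, for every `ε, η > 0` there is `θ > 0` such that eventually the critical SAW curve class has injectivity modulus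
`(ε, θ)` with probability `≥ 1 − η`.  Implies `HexNonRetracingFloor` (`nonRetracingFloor_of_uniformModulus`, p116482); implied by
the crux (`Negative.ModulusNecessity.floorUniformModulus_of_hexConjecture`, p79732).  OPEN. -/
def UniformModulus : Prop :=
  ∀ (D : DobrushinDomain) (ρ : ℝ) (a b : ℝ → HexVertex),
    (0 < ρ ∧ (D.pt 1).im = (D.pt 0).im ∧ D.carrier ⊆ {z : ℂ | (D.pt 0).im < z.im} ∧
      D.carrier ∩ Metric.ball (D.pt 0) ρ = {z : ℂ | (D.pt 0).im < z.im} ∩ Metric.ball (D.pt 0) ρ ∧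
      D.carrier ∩ Metric.ball (D.pt 1) ρ = {z : ℂ | (D.pt 1).im < z.im} ∩ Metric.ball (D.pt 1) ρ) →
    (IsEmbEndpointApprox hexGraph hexCenter D a b ∧ ∀ᶠ δ : ℝ in 𝓝[>] 0,
      (∃ u : HexVertex, hexGraph.Adj (a δ) u ∧ ((δ : ℂ) * hexCenter u).im ≤ (D.pt 0).im) ∧
      (∃ u : HexVertex, hexGraph.Adj (b δ) u ∧ ((δ : ℂ) * hexCenter u).im ≤ (D.pt 1).im)) →
    ∀ ε η : ℝ, 0 < ε → 0 < η → ∃ θ : ℝ, 0 < θ ∧ ∀ᶠ δ : ℝ in 𝓝[>] 0,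
      hexSAWLaw D.carrier δ (a δ) (b δ) {γ | γ.curve ∉ CurveClass.modulusClass ε θ} ≤ ENNReal.ofReal η

/-- `FloorConvergence` — the crux on the floor class in crux-10472's convention: floor domains, FLOOR-VERTEX endpoint
approximations (verbatim the conclusion class of `Restatement.FloorObservableToSLE` (C′) and the hypothesis of (E)).
Equivalent to `HexConjectureFloor` (`floorConvergence_iff_hexConjectureFloor`). -/
def FloorConvergence : Prop :=
  ∀ (D : DobrushinDomain) (ρ : ℝ) (a b : ℝ → HexVertex),
    (0 < ρ ∧ (D.pt 1).im = (D.pt 0).im ∧ D.carrier ⊆ {z : ℂ | (D.pt 0).im < z.im} ∧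
      D.carrier ∩ Metric.ball (D.pt 0) ρ = {z : ℂ | (D.pt 0).im < z.im} ∩ Metric.ball (D.pt 0) ρ ∧
      D.carrier ∩ Metric.ball (D.pt 1) ρ = {z : ℂ | (D.pt 1).im < z.im} ∩ Metric.ball (D.pt 1) ρ) →
    (IsEmbEndpointApprox hexGraph hexCenter D a b ∧ ∀ᶠ δ : ℝ in 𝓝[>] 0,
      (∃ u : HexVertex, hexGraph.Adj (a δ) u ∧ ((δ : ℂ) * hexCenter u).im ≤ (D.pt 0).im) ∧
      (∃ u : HexVertex, hexGraph.Adj (b δ) u ∧ ((δ : ℂ) * hexCenter u).im ≤ (D.pt 1).im)) →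
    ConvergesInLawToSLE ((8 : ℝ≥0) / 3) D
      (fun δ (γ : HexDomainSAW D.carrier δ (a δ) (b δ)) => γ.curve)
      (fun δ => hexSAWLaw D.carrier δ (a δ) (b δ))

/-- STATEMENT 7♯ — `BoundaryUniversality` (E) (verbatim crux-10472's restated residual, `Cruxes/ObservableToSLE/Restatement.lean`):
floor-class convergence with floor-vertex endpoints ⟹ DCS Conjecture 1 as typed.  Content: (R1) marked points whose local boundary is
not a horizontal floor with the domain above; (R2) endpoint universality (microscopically interior lattice endpoints); (R3)
flat-at-both-marks domains not above the line through the marks.  No mechanism in print; implied by the crux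
(`boundaryUniversality_of_hexConjecture`); equivalent to `MarksAndEndpointsFloor` (`marksAndEndpointsFloor_iff_boundaryUniversality`). -/
def BoundaryUniversality : Prop :=
  FloorConvergence → Summit.CriticalPhenomena.SAWScalingLimit.Theses.SAWHexUniversality.HexConjecture

/-! ## The registered stubs (`sorry` lives only here; signatures verbatim and fully qualified, so that a
Theorems-side `propose --supports stmt-CriticalPhenomena-0808` proof can restate them textually) -/

/- (c11) `stub_observableLimit` (statement 1 = stmt-CriticalPhenomena-14003 `HexObservableLimitR` VERBATIM, the shared target of the four
observable routes) is NO LONGER REGISTERED here: it has carried the standing verdict "= 14003, not this line's to attack" since seat 0, the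
PRIMARY composition uses only its boundary shadow `stub_floorRatioLimit` (⟸ 14003, p72986), and the registered list is capped at 7.  The Prop
`ObservableLimit` (`observableLimit_iff : ObservableLimit ↔ HexObservableLimitR`) and the compositions `HexConjecture_of_observable` /
`HexConjecture_of_rootDominance` stay, with a plain hypothesis `(h1 : ObservableLimit)`. -/

/-- **STUB 1♯ · `stub_floorRatioLimit`** (OPEN; the WEAKENED statement 1 — implied by `stub_observableLimit` = stmt-14003 via target
transport p72986 + `Tendsto.norm`; a statement about RATIOS OF POSITIVE BOUNDARY PARTITION FUNCTIONS only).  See `FloorRatioLimit`.  WHY PLAUSIBLY TRUE: it is the boundary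
shadow of DCS Conj. 2 / of conformal covariance of the SAW boundary two-point function with exponent 5/8 (the SAW boundary one-leg
exponent, [LSW 2004] §3.4; Kennedy's simulations support restriction with exponent 5/8).  WHY HARD: any proof in print goes through the
observable (barrier `ParafermionicHalfCauchyRiemann`) or through Conj. 1 plus normalisation information the curve law does not carry.
[arXiv:1007.0575 Conj. 2; LSW 2004 §3.4, Prop. 2; arXiv:math/0112246] -/
theorem stub_floorRatioLimit : ∀ (D D' : Literature.Probability.RandomPlanarGeometry.DobrushinDomain) (ρ : ℝ) (Λ : ℝ → Finset Literature.Probability.LatticeModels.HexVertex) (m₀ m m' : ℝ → ℤ) (a b b' : ℝ → Sym2 Literature.Probability.LatticeModels.HexVertex) (Φ : Literature.Probability.RandomPlanarGeometry.ConformalEquiv D.carrier UpperHalfPlane.upperHalfPlaneSet) (L : ℂ → ℂ) (Lb Lb' : ℂ), D'.carrier = D.carrier → D'.pt 0 = D.pt 0 → 0 < ρ → D.carrier ∩ Metric.ball (D.pt 0) ρ = {z : ℂ | (D.pt 0).im < z.im} ∩ Metric.ball (D.pt 0) ρ → D.carrier ∩ Metric.ball (D.pt 1) ρ = {z : ℂ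 | (D.pt 1).im < z.im} ∩ Metric.ball (D.pt 1) ρ → D.carrier ∩ Metric.ball (D'.pt 1) ρ = {z : ℂ | (D'.pt 1).im < z.im} ∩ Metric.ball (D'.pt 1) ρ → (∀ᶠ δ : ℝ in nhdsWithin (0 : ℝ) (Set.Ioi 0), Literature.Probability.RandomPlanarGeometry.SAW.hexDomainSimplyConnected (Λ δ) ∧ a δ ∈ Literature.Probability.RandomPlanarGeometry.SAW.hexDomainBoundary (Λ δ) ∧ b δ ∈ Literature.Probability.RandomPlanarGeometry.SAW.hexDomainBoundary (Λ δ) ∧ b' δ ∈ Literature.Probability.RandomPlanarGeometry.SAW.hexDomainBoundary (Λ δ) ∧ Nonempty (Literature.Probability.RandomPlanarGeometry.SAW.HexMidEdgeSAW (Λ δ) (a δ) (b δ)) ∧ Nonempty (Literature.Probability.RandomPlanarGeometry.SAW.HexMidEdgeSAW (Λ δ) (a δ) (b' δ)) ∧ (Literature.Probability.LatticeModels.hexGraph.induce (↑(Λ δ) : Set Literature.Probability.LatticeModels.HexVertex)).Preconnected ∧ (∀ v ∈ Λ δ, (δ : ℂ) * Literature.Probability.LatticeModels.hexCenter v ∈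 D.carrier) ∧ (∀ v : Literature.Probability.LatticeModels.HexVertex, (δ : ℂ) * Literature.Probability.LatticeModels.hexCenter v ∈ Metric.ball (D.pt 0) ρ → (v ∈ Λ δ ↔ m₀ δ ≤ v.1 1)) ∧ (∀ v : Literature.Probability.LatticeModels.HexVertex, (δ : ℂ) * Literature.Probability.LatticeModels.hexCenter v ∈ Metric.ball (D.pt 1) ρ → (v ∈ Λ δ ↔ m δ ≤ v.1 1)) ∧ (∀ v : Literature.Probability.LatticeModels.HexVertex, (δ : ℂ) * Literature.Probability.LatticeModels.hexCenter v ∈ Metric.ball (D'.pt 1) ρ → (v ∈ Λ δ ↔ m' δ ≤ v.1 1))) → (∀ K : Set ℂ, IsCompact K → K ⊆ D.carrier → ∀ᶠ δ : ℝ in nhdsWithin (0 : ℝ) (Set.Ioi 0), ∀ v : Literature.Probability.LatticeModels.HexVertex, (δ : ℂ) * Literature.Probability.LatticeModels.hexCenter v ∈ K → v ∈ Λ δ) → Filter.Tendsto (fun δ : ℝ => (δ : ℂ) * Literature.Probability.RandomPlanarGeometry.SAW.hexMidpoint (a δ)) (nhdsWithin (0 : ℝ) (Set.Ioi 0)) (nhds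 (D.pt 0)) → Filter.Tendsto (fun δ : ℝ => (δ : ℂ) * Literature.Probability.RandomPlanarGeometry.SAW.hexMidpoint (b δ)) (nhdsWithin (0 : ℝ) (Set.Ioi 0)) (nhds (D.pt 1)) → Filter.Tendsto (fun δ : ℝ => (δ : ℂ) * Literature.Probability.RandomPlanarGeometry.SAW.hexMidpoint (b' δ)) (nhdsWithin (0 : ℝ) (Set.Ioi 0)) (nhds (D'.pt 1)) → Filter.Tendsto (fun x => ‖Φ x‖) (nhdsWithin (D.pt 0) D.carrier) Filter.atTop → Φ.HasBoundaryValue (D.pt 1) 0 → ContinuousOn L D.carrier → (∀ z ∈ D.carrier, Complex.exp (L z) = deriv Φ z) → Filter.Tendsto L (nhdsWithin (D.pt 1) D.carrier) (nhds Lb) → Filter.Tendsto L (nhdsWithin (D'.pt 1) D.carrier) (nhds Lb') → Filter.Tendsto (fun δ : ℝ => ‖Literature.Probability.RandomPlanarGeometry.SAW.hexParafermionicObservable (Λ δ) (a δ) Literature.Probability.RandomPlanarGeometry.SAW.hexCriticalFugacity (5 / 8) (b' δ) / Literature.Probability.RandomPlanarGeometry.SAW.hexParafermionicObservable (Λ δ)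 (a δ) Literature.Probability.RandomPlanarGeometry.SAW.hexCriticalFugacity (5 / 8) (b δ)‖) (nhdsWithin (0 : ℝ) (Set.Ioi 0)) (nhds (Real.exp ((5 / 8) * (Lb' - Lb).re))) := by
  sorry

/- (c6) The phase-form lever `RootDominance` (former registered `stub_rootDominance`, statement 2) is NO LONGER REGISTERED:
abandoned by seats c1–c5 (phase content, no tool); it stays a named Prop with its derived compositions
`hexConjectureFloor_of_line_rootDominance` / `HexConjecture_of_rootDominance`. -/

/- (c10) The arch aspect bound `stub_archAspectBound` (statement 2♮, the c6 lever) is NO LONGER REGISTERED: it is implied by the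
registered `stub_windowTwoPointLowerBound` (`archAspectBound_of_windowTwoPointLowerBound`, p129016) and has carried the standing verdict
"⟸ WTLB" since c8; it stays a named Prop (`ArchAspectBound`, `archAspectBound_holds`) with its compositions (`HexConjecture_of_aspectBound`,
plain hypothesis). -/

/-- **STUB 2♮♮ · `stub_windowTwoPointLowerBound`** (OPEN — THE LEVER after the c8 reshape; see `WindowTwoPointLowerBound`).  WHY IT SUFFICES:
it implies the arch aspect bound 2♮ (`archAspectBound_of_windowTwoPointLowerBound`, LANDED), which with the floor-ratio limit 1♯ gives the
bootstrap's window inequality and the avoidance cocycle (c6).  WHY PLAUSIBLY TRUE: both sides are `≍ R^{-1/4}` under the predicted boundary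
exponents (`G_k ≍ k^{-5/4}`, `D_T ≍ T^{-1/4}`); the CUBE version is a theorem (`windowTwoPointLowerBound_cube`) and the reference mass is at
most `2(1+√2)·triDl(⌈θa R⌉ − 1)` (`windowTwoPointMass_le_triangleTail`), so 2♮♮ is a two-sided order-of-magnitude statement about the
boundary two-point function and ONE explicit sequence.  WHY HARD / STATUS: the linear lower bound is Krachun–Panagiotis 2023 Cor. 3.1
(`T⁴D_{18T}⁵ ≤ 2¹⁷(Σ_{i≤3T}D_i)⁴ Σ_{k=T}^{21T} G_k`, whose constructed U-walks are confined to radius `O(T)`) plus the LOWER REGULARITY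
`Σ_{i≤3T} D_i ≤ C·T·D_{18T}` of `D` (no sudden drops; true for `D_T ≍ T^{-α}`, `α < 1`; KP prove only `c/T ≤ D_T ≤ 100T^{-1e-10}`) — open;
a sharp two-point lower bound from the one-arm tail is RSW-flavoured.  A SECOND SUFFICIENT PAIR (c8): with `TAIL_T = Σ_{|k|>T} G_k` and `FN_T` =
the arches ending in `[−T,T]` but leaving `T_T`, the tree has `TAIL_T + FN_T ≤ 2(cos(π/8)/cos(3π/8))·triDl T` (both inequalities landed) and
`WINDOW(T₁,T₂) = TAIL_{T₁} − TAIL_{T₂}`, so 2♮♮ ⟸ TAILFRAC (`TAIL_T ≥ ε·triDl T`: a fixed fraction of the non-contained arches END far) ∧ DROP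
(`triDl(ΛT) ≤ q·triDl T`, `q < 1`, bounded `Λ`: no long plateaus — upper regularity, not implied by KP's (12)); both open.  [arXiv:2310.17299 Lemma 2.2, Cor. 3.1; GlazmanManolescu2019 Lemma 4.1,
§4.1; arXiv:1007.0575 Lemma 2]  STATUS c9: the Krachun–Panagiotis half is LANDED — `windowTwoPointLowerBound_of_triDlLowerRegular` (2♮♮ ⟸ 2♮♮-R = REG,
`stub_triDlLowerRegular`). -/
theorem stub_windowTwoPointLowerBound : ∃ θa θb C : ℝ, 0 < θa ∧ θa < θb ∧ θb ≤ 1 / 4 ∧ 0 < C ∧ ∃ R₀ : ℝ, 0 < R₀ ∧ ∀ R : ℝ, R₀ ≤ R → ∀ (x : Literature.Probability.LatticeModels.Site 2) (B : Finset Literature.Probability.LatticeModels.HexVertex) (S' : Finset ℤ), (∀ v : Literature.Probability.LatticeModels.HexVertex, v ∈ B ↔ (x 1 ≤ v.1 1 ∧ dist (Literature.Probability.LatticeModels.hexCenter v) (Literature.Probability.RandomPlanarGeometry.SAW.hexMidpoint s((x - Pi.single 1 1, 1), (x, 0))) ≤ R)) → (∀ d : ℤ, d ∈ S' ↔ (θa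 * R ≤ (d : ℝ) ∧ (d : ℝ) ≤ θb * R)) → Literature.Probability.RandomPlanarGeometry.SAW.HV.triDl ⌊R / 4⌋₊ ≤ C * ∑ d ∈ S', ∑ γ : Literature.Probability.RandomPlanarGeometry.SAW.HexMidEdgeSAW B s((x - Pi.single 1 1, 1), (x, 0)) s((x + Pi.single 0 d - Pi.single 1 1, 1), (x + Pi.single 0 d, 0)), Literature.Probability.RandomPlanarGeometry.SAW.hexCriticalFugacity ^ γ.length := by
  sorry

/- (c12) `stub_triDlLowerRegular` (REG) is no longer a registered (sorried) stub: REG is DERIVED in both T-side decompositions (⟸ doubling, landed;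
⟸ HalfPlaneGramPositivity ∧ AverageTailFraction, s3's glue stubs below); the Prop, its alias and `HexConjecture_of_reg` (hypothesis form) stay. -/


/- (c12) `stub_triDlDoubling` is no longer a registered (sorried) stub (cap 7; sufficient form of REG, glue landed). Numerics (kit j025472):
`triDl(2L)/triDl L` = 0.8550(5), 0.8482(7), 0.8443(12), 0.8438(15) at L = 8, 16, 32, 64 (→ 2^{-1/4} = 0.8409 ≫ 1/2). -/


/-- **STUB 2♮♮-step · `stub_triDlStep`** (LANDED c11 — was registered by seat c11 as a worker target; the UNIT-SCALE lower regularity of the one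
sequence the open stubs 2♮♮-R / 2♮♮-D are about).  One-step drops of the triangle tail are at most by the factor `2x_c² = 2 − √2 ≈ 0.586`:
`(2 − √2)·triDl L ≤ triDl (L+1)` for every `L`.  MECHANISM (an `O(1)`-cost extension exists at unit scale, and only there): a walk of `T_L` from `a`
whose final half-edge crosses the left side, `(−L, x₁, false) → (−L−1, x₁, true)`, extends inside the FRESH column `x₀ = −L−1` (never met by `T_L`,
so self-avoidance is automatic) by the two 2-step paths `(−L−1, x₁, true) → (−L−1, x₁, false) → (−L−2, x₁, true)` and
`(−L−1, x₁, true) → (−L−1, x₁+1, false) → (−L−2, x₁+1, true)`, each ending with a left half-edge of `T_{L+1}`; the map (walk, choice) ↦ extension is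
injective (drop the last two entries) and multiplies the weight by `x_c²`.  Summing the whole geometric run down/up the column gives the sharper
`(1/√2)(1 − O(x_c^{2L}))`; conjecturally the ratio tends to `1`.  Over a doubling of the scale this compounds to `(2−√2)^L` — the gap between this
unit-scale fact and 2♮♮-D is exactly the missing scale-`T` extension mechanism (RSW substitute). [GlazmanManolescu2019 §4.1 (T_L); folklore] -/
theorem stub_triDlStep : ∀ L : ℕ, (2 - Real.sqrt 2) * Literature.Probability.RandomPlanarGeometry.SAW.HV.triDl L ≤ Literature.Probability.RandomPlanarGeometry.SAW.HV.triDl (L + 1) :=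
  -- LANDED (seat c11, worker W-A): `…Theorems/SAWDevelopingMapHexConjectureTriDlStep.lean`
  Summit.CriticalPhenomena.SAWScalingLimit.Theorems.HexConjecture.RootLocality.stub_triDlStep

/-- **STUB 2♮♮-env · `stub_triDlLowerBound`** (LANDED c11, p151606 — registered by seat c11; the LOWER half of the a-priori envelope of the lever's sequence,
made unconditional this seat): `∃ m > 0, ∀ L, m/(L+1) ≤ triDl L`.  Duminil-Copin–Smirnov's harmonic bound `B_T ≥ m/T` was in the tree only under the
refuted `Summable` hypothesis (`stripBlim_ge`); `Literature/…/HexSAWStripIdentity.lean` (c11, p150948) proves `E_T(x_c) = 0` (E_{T,L} is non-decreasing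
in T and `≤ (2cos(π/8)/c_ε)·triDl ⌊(T−1)/2⌋ → 0`), hence the strip identity `c_α A_T + B_T = 1` (Glazman–Manolescu Cor. 2.3), `B_T` antitone, `B_{T+1} ≥ m/(T+1)`
unconditionally and, with `B_{2L+1} ≤ 2cos(π/8)·triDl L`, this bound (`SAW.triDl_ge_div`).  With KP's Theorem 3 (`kp_triDl_rpow_decay`, c9) the sequence of
2♮♮-R and 2♮♮-D now has the proved envelope `c/(L+1) ≤ triDl L ≤ C·L^{-ε}`. [DuminilCopinSmirnov2012 §3; GlazmanManolescu2019 Cor. 2.3; arXiv:2310.17299 Lemma 2.3] -/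
theorem stub_triDlLowerBound : ∃ m : ℝ, 0 < m ∧ ∀ L : ℕ, m / ((L : ℝ) + 1) ≤ Literature.Probability.RandomPlanarGeometry.SAW.HV.triDl L :=
  -- LANDED (seat c11): `…Theorems/SAWDevelopingMapHexConjectureTriDlLowerBound.lean` p151606 over Literature `HexSAWStripIdentity` p150948
  Summit.CriticalPhenomena.SAWScalingLimit.Theorems.HexConjecture.RootLocality.stub_triDlLowerBound

/-- RECORD (c11) — THE PROVED ENVELOPE OF THE LEVER'S SEQUENCE: `∃ m > 0, ∃ ε > 0, ∃ C, ∀ L ≥ 1, m/(L+1) ≤ triDl L ≤ C·L^(−ε)` (lower half: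
this seat, p150948/p151606; upper half: Krachun–Panagiotis Theorem 3, seat c9 `RootLocality.kp_triDl_rpow_decay`), and `(2−√2)·triDl L ≤ triDl (L+1) ≤ triDl L`. -/
theorem triDl_envelope : (∃ m : ℝ, 0 < m ∧ ∀ L : ℕ, m / ((L : ℝ) + 1) ≤ HV.triDl L) ∧
    (∀ L : ℕ, (2 - Real.sqrt 2) * HV.triDl L ≤ HV.triDl (L + 1) ∧ HV.triDl (L + 1) ≤ HV.triDl L) :=
  ⟨stub_triDlLowerBound, fun L => ⟨stub_triDlStep L, HV.triDl_antitone (Nat.le_succ L)⟩⟩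

/-- RECORD (c11): the a-priori one-step envelope compounds geometrically — `(2 − √2)^k · triDl L ≤ triDl (L + k)`. -/
theorem triDl_add_ge (L k : ℕ) :
    (2 - Real.sqrt 2) ^ k * Literature.Probability.RandomPlanarGeometry.SAW.HV.triDl L ≤
      Literature.Probability.RandomPlanarGeometry.SAW.HV.triDl (L + k) := by
  induction k with
  | zero => simp
  | succ k ih =>
    have h2 : (0 : ℝ) ≤ 2 - Real.sqrt 2 := by
      rw [sub_nonneg]
      have h4 : Real.sqrt 2 < 2 := by
        rw [show (2 : ℝ) = Real.sqrt 4 by rw [show (4 : ℝ) = 2 ^ 2 by norm_num, Real.sqrt_sq (by norm_num : (0:ℝ) ≤ 2)]]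
        exact Real.sqrt_lt_sqrt (by norm_num) (by norm_num)
      exact h4.le
    calc (2 - Real.sqrt 2) ^ (k + 1) * Literature.Probability.RandomPlanarGeometry.SAW.HV.triDl L
        = (2 - Real.sqrt 2) * ((2 - Real.sqrt 2) ^ k * Literature.Probability.RandomPlanarGeometry.SAW.HV.triDl L) := by ring
      _ ≤ (2 - Real.sqrt 2) * Literature.Probability.RandomPlanarGeometry.SAW.HV.triDl (L + k) :=
          mul_le_mul_of_nonneg_left ih h2
      _ ≤ Literature.Probability.RandomPlanarGeometry.SAW.HV.triDl (L + k + 1) := stub_triDlStep (L + k)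
      _ = Literature.Probability.RandomPlanarGeometry.SAW.HV.triDl (L + (k + 1)) := by rw [Nat.add_assoc]

/-- STATEMENT 2♮♮-S — `SideFloorComparison` (SFB; crux-strategist s2's ALTERNATIVE source of the lever, line card
`Lines/one_domain_side_floor_profile.md`, 2026-08-17, adopted into this skeleton by lead c11 as a second registered sufficient form of 2♮♮):
inside ONE lattice triangle `T_L` rooted at its base mid-edge, SIDE EXITS ≤ `C ×` FLOOR ARRIVALS in the base window `[L/4, L/2]`:
`∃ C L₀, ∀ L ≥ L₀, triDl L ≤ C · Σ_{d ∈ [L/4, L/2]} Σ_{P ∈ midWalks (triV L), P ends on the floor mid-edge at abscissa d} x_c^{ℓ(P)}`.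
Two boundary exit functionals of ONE critical ensemble, one root, one scale (both `≍ L^{-1/4}` under the LSW exponents); under DCS Conjecture 2 read on the
closed lattice sides of the triangle both are `λ_L·L·∫(profile)` with the SAME unknown scalar `λ_L`, which cancels — an OBSERVABLE-side source of the
linear one-scale comparison that the T-side (REG/doubling) cannot produce.  SFB ⟹ 2♮♮ by exact restriction in the favourable direction
(`T_x(⌊R/4⌋) ⊆ B_R(x)`, `stub_windowTwoPoint_of_sideFloorComparison`, PROVABLE).  OPEN; its intended proof is boundary convergence of the normalised
parafermionic observable on a closed 60° side up to the convex corners (a widening of stmt-14003; barrier HalfCR bites). -/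
def SideFloorComparison : Prop :=
  ∃ C : ℝ, ∃ L₀ : ℕ, ∀ L : ℕ, L₀ ≤ L → HV.triDl L ≤ C * ∑ d ∈ Finset.Icc ((L : ℤ) / 4) ((L : ℤ) / 2),
    ∑ P ∈ (HV.midWalks (HV.triV L)).filter (fun P => HV.finalDart P = ((d, 0, false), (d, -1, true)) ∨
      HV.finalDart P = ((d, -1, true), (d, 0, false))), hexCriticalFugacity ^ HV.mwLen P

/-- **STUB 2♮♮-S · `stub_sideFloorComparison`** (OPEN — s2's observable-side source of the lever, registered by c11, re-registered by c12 in v13; see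
`SideFloorComparison`).  NUMERICAL VERDICT (seat c12, kit j025472, 20.6 M nPERM tours): by the exact 3-fold lattice symmetry of `T_L` (base exit darts ↔ left
exit darts, root ↦ left-side midpoint) the SFB ratio has a PARAMETER-FREE continuum limit `ρ_∞ = I_side/I_window = 2.2751` (Schwarz–Christoffel of the
equilateral triangle, h = 5/8); the measured `ρ(L) = triDl L / Σ_{[L/4,L/2]} G_L` equals the discrete prediction `ρ_pred(L)` within 0.6 % for all 12 ≤ L ≤ 128
(−0.11 ± 0.22 % at L = 128) and the floor-arrival profile of `T_L` normalised by the side total lies on the `|Ψ'|^{5/8}` curve within 0.5 % at L = 128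
(`Lines/root_locality_replaces_loewner_c12.md`): SFB holds with any `C > 2.28` asymptotically.  WHY HARD: = stmt-14003 widened to closed lattice sides
(barrier `ParafermionicHalfCauchyRiemann`).  DISPROVER TARGET: `ρ(L) → ∞` (would contradict the confirmed conformal covariance). -/
theorem stub_sideFloorComparison : ∃ C : ℝ, ∃ L₀ : ℕ, ∀ L : ℕ, L₀ ≤ L → Literature.Probability.RandomPlanarGeometry.SAW.HV.triDl L ≤ C * ∑ d ∈ Finset.Icc ((L : ℤ) / 4) ((L : ℤ) / 2), ∑ P ∈ (Literature.Probability.RandomPlanarGeometry.SAW.HV.midWalks (Literature.Probability.RandomPlanarGeometry.SAW.HV.triV L)).filter (fun P => Literature.Probability.RandomPlanarGeometry.SAW.HV.finalDart P = ((d, 0, false), (d, -1, true)) ∨ Literature.Probability.RandomPlanarGeometry.SAW.HV.finalDart P = ((d, -1, true), (d, 0, false))), Literature.Probability.RandomPlanarGeometry.SAW.hexCriticalFugacity ^ Literature.Probability.RandomPlanarGeometry.SAW.HV.mwLen P := by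
  sorry


/-- **STUB 2♮♮-S→2♮♮ · `stub_windowTwoPoint_of_sideFloorComparison`** (LANDED c11 wave 2 — registered by lead c11; s2's glue stub verbatim): SFB ⟹ WTLB with
`θa = 1/20`, `θb = 1/8`, the same `C`, `R₀ = max 80 (4L₀ + 8)`: for `L = ⌊R/4⌋` the chart triangle `T_x(L)` lies in the rows `≥ x₁` within distance `3L+2 ≤ R`
of the root (`triChart_geometry`, p127431), its floor arch mass at offset `d` (`|d| ≤ L`) IS the coded triangle sum (`triArch_archMass_offset_eq`), exact
restriction is monotone (`archMass_mono`), and `[⌊L/4⌋, ⌊L/2⌋] ⊆ [R/20, R/8]` for `R ≥ 80`; extra offsets add nonnegative terms. -/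
theorem stub_windowTwoPoint_of_sideFloorComparison : (∃ C : ℝ, ∃ L₀ : ℕ, ∀ L : ℕ, L₀ ≤ L → Literature.Probability.RandomPlanarGeometry.SAW.HV.triDl L ≤ C * ∑ d ∈ Finset.Icc ((L : ℤ) / 4) ((L : ℤ) / 2), ∑ P ∈ (Literature.Probability.RandomPlanarGeometry.SAW.HV.midWalks (Literature.Probability.RandomPlanarGeometry.SAW.HV.triV L)).filter (fun P => Literature.Probability.RandomPlanarGeometry.SAW.HV.finalDart P = ((d, 0, false), (d, -1, true)) ∨ Literature.Probability.RandomPlanarGeometry.SAW.HV.finalDart P = ((d, -1, true), (d, 0, false))), Literature.Probability.RandomPlanarGeometry.SAW.hexCriticalFugacity ^ Literature.Probability.RandomPlanarGeometry.SAW.HV.mwLen P) → (∃ θa θb C : ℝ, 0 < θa ∧ θa < θb ∧ θb ≤ 1 / 4 ∧ 0 < C ∧ ∃ R₀ : ℝ, 0 < R₀ ∧ ∀ R : ℝ, R₀ ≤ R → ∀ (x : Literature.Probability.LatticeModels.Site 2) (B : Finset Literature.Probability.LatticeModels.HexVertex) (S' : Finset ℤ), (∀ v : Literature.Probability.LatticeModels.HexVertex,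 v ∈ B ↔ (x 1 ≤ v.1 1 ∧ dist (Literature.Probability.LatticeModels.hexCenter v) (Literature.Probability.RandomPlanarGeometry.SAW.hexMidpoint s((x - Pi.single 1 1, 1), (x, 0))) ≤ R)) → (∀ d : ℤ, d ∈ S' ↔ (θa * R ≤ (d : ℝ) ∧ (d : ℝ) ≤ θb * R)) → Literature.Probability.RandomPlanarGeometry.SAW.HV.triDl ⌊R / 4⌋₊ ≤ C * ∑ d ∈ S', ∑ γ : Literature.Probability.RandomPlanarGeometry.SAW.HexMidEdgeSAW B s((x - Pi.single 1 1, 1), (x, 0)) s((x + Pi.single 0 d - Pi.single 1 1, 1), (x + Pi.single 0 d, 0)), Literature.Probability.RandomPlanarGeometry.SAW.hexCriticalFugacity ^ γ.length) :=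
  -- LANDED (seat c11, wave 2): `…Theorems/SAWDevelopingMapHexConjectureWindowTwoPointOfSideFloor.lean`
  Summit.CriticalPhenomena.SAWScalingLimit.Theorems.HexConjecture.RootLocality.stub_windowTwoPoint_of_sideFloorComparison

/-- 2♮♮-S ⟹ 2♮♮ (from the glue stub). -/
theorem windowTwoPointLowerBound_of_sideFloorComparison (h : SideFloorComparison) : WindowTwoPointLowerBound :=
  stub_windowTwoPoint_of_sideFloorComparison h

/-! ## (c12 ← crux-strategist s3) The POSITIVITY source of the lever: line `boundary-gram-bochner-regularity` ADOPTED
(`Lines/boundary_gram_bochner_regularity.{lean,md}`, 2026-08-17T16:04Z).  It keeps layer 1 and `REG → WTLB` and RE-SOURCES the stuck node REG: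
`TriDlLowerRegular ⟸ HalfPlaneGramPositivity ∧ AverageTailFraction` through two PROVABLE glue stubs (Bochner with Fejér test vectors; real
analysis + KP Lemma 2.2).  The statements below are s3's, verbatim (so that the registered signatures coincide with s3's skeleton). -/

/-- STATEMENT 2♮♮-P — `HalfPlaneGramPositivity` (s3's NEW LEVER): the twisted critical half-plane boundary two-point sequence `f(0) = 1`,
`f(±k) = e^{±5πi/8} G(k)` (`G k = RootLocality.halfPlaneArch k`, Krachun–Panagiotis's `G_k`: the `x_c`-mass of half-plane floor arches from the root
to the floor mid-edge at offset `k`, as the `iSup` over the DCS trapezoids) is POSITIVE-DEFINITE on `ℤ` (every finite Gram form has nonnegative real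
part).  Source: the F-PSD conjecture of crux idea `critical-boundary-gram` (boundary parafermionic matrix PSD on simply connected domains, ≈ 32 000
domains checked exactly, threshold exactly at `(x_c, 5/8)`), half-plane floor block.  Equivalent (given the flux identity) to
`Σ_m G(m) sin(qm) ≤ (√2−1) Σ_m G(m)(1 − cos qm)` for `0 < q ≤ π`; the `q^{1/4}` terms of both sides coincide for `G ~ A m^{-5/4}` (tan(π/8) = √2−1).
NUMERICS (this seat, `G(m)` from kit j025472 + `A m^{-5/4}` tail, A = 0.306): the margin `D(q) = (√2−1)ΣG(1−cos) − ΣG sin` is POSITIVE at every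
tested `q ∈ [0.02, π]` and ≈ 0.37·q near 0; for the pure power law `D(q) = −A·ζ(1/4)·q + O(q²) = +0.81·A·q` (ζ(1/4) < 0) and the observed
small-`m` deficit `G(m) < A m^{-5/4}` adds to it — so near `q = 0` positivity is NOT knife-edge.  OPEN (a structural proof is needed: SOS of the
vertex Gram forms, or transfer-matrix positivity on the half-plane). -/
def HalfPlaneGramPositivity : Prop :=
  ∀ (n : ℕ) (c : Fin n → ℂ), 0 ≤ (∑ j : Fin n, ∑ k : Fin n, (starRingEnd ℂ) (c j) * c k * (if (j : ℕ) = k then 1 else Complex.exp (Complex.I * (5 * Real.pi / 8) * (if (j : ℕ) < k then 1 else -1)) * (Summit.CriticalPhenomena.SAWScalingLimit.Theorems.HexConjecture.RootLocality.halfPlaneArch ((Int.natAbs ((j : ℤ) - k) : ℕ) : ℤ) : ℂ))).re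

/-- STATEMENT 2♮♮-B — `HalfPlaneBochnerIneq` (s3): the Bochner consequence with the test vectors `c_j = e^{iqj}`, `q = 3π/(4M)`:
`Σ_{1≤k<M} G(k)·w(k/M) ≤ (1 + cos(3π/8))·Def(M)`, `w(u) = cos((3π/8)(2u−1)) − cos(3π/8) ≥ 0` on `[0,1]`, `Def(M) = 1/(2cos(3π/8)) − Σ_{k≤M} G(k)`.
"Window mass ≤ const × tail": an ANTI-CLIFF (lower-regularity) statement for `Def`. -/
def HalfPlaneBochnerIneq : Prop :=
  ∀ M : ℕ, 1 ≤ M → ∑ k ∈ Finset.Ico 1 M, Summit.CriticalPhenomena.SAWScalingLimit.Theorems.HexConjecture.RootLocality.halfPlaneArch ((k : ℕ) : ℤ) * (Real.cos (3 * Real.pi / 8 * (2 * (k : ℝ) / M - 1)) - Real.cos (3 * Real.pi / 8)) ≤ (1 + Real.cos (3 * Real.pi / 8)) * (1 / (2 * Real.cos (3 * Real.pi / 8)) - ∑ k ∈ Finset.Icc 1 M, Summit.CriticalPhenomena.SAWScalingLimit.Theorems.HexConjecture.RootLocality.halfPlaneArch ((k : ℕ) : ℤ))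

/-- STATEMENT 2♮♮-T — `AverageTailFraction` (AvgTF; s3's RESIDUAL, open): `Σ_{i≤T} triDl i ≤ C·Σ_{i≤T} Def(i)` — the Abel-summed, one-sided
form of seat c8's `TailFraction` (numerically `TAIL_T/(κ₂ triDl T) = 0.94 → 0.88`); "an arch is on average not much taller (in triangle scale) than long". -/
def AverageTailFraction : Prop :=
  ∃ C : ℝ, ∀ T : ℕ, 1 ≤ T → ∑ i ∈ Finset.range (T + 1), Literature.Probability.RandomPlanarGeometry.SAW.HV.triDl i ≤ C * ∑ i ∈ Finset.range (T + 1), (1 / (2 * Real.cos (3 * Real.pi / 8)) - ∑ k ∈ Finset.Icc 1 i, Summit.CriticalPhenomena.SAWScalingLimit.Theorems.HexConjecture.RootLocality.halfPlaneArch ((k : ℕ) : ℤ))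

/-- **STUB 2♮♮-P · `stub_halfPlaneGramPositivity`** (OPEN — s3's lever, registered by lead c12 on adoption; see `HalfPlaneGramPositivity`).
WHY IT SUFFICES: with the two glue stubs below and `stub_averageTailFraction` it gives REG, hence WTLB (p142667), hence the PRIMARY composition
(`HexConjecture_of_gram`).  WHY PLAUSIBLY TRUE: F-PSD exact-enumeration evidence + this seat's half-plane symbol numerics (margin ≈ 0.37·q).
WHY HARD: no positivity structure for SAW is known (no OS/reflection positivity at c = 0); the kernel is PSD only at the special spin σ = 5/8.
DISPROVER TARGET: a `q` with `Σ_{m≤K} G(m)(cos(3π/8) − cos(qm − 3π/8)) ... ` i.e. the certificate `Σ_{m≤K} G(m)[c_α + cos(qm + 5π/8)] + (1 + c_α)·Def(K) < 0`.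
[s3 line card; Cruxes/HexConjecture/Ideas/critical-boundary-gram.md; EVIDENCE-boundary-gram.md] -/
theorem stub_halfPlaneGramPositivity : ∀ (n : ℕ) (c : Fin n → ℂ), 0 ≤ (∑ j : Fin n, ∑ k : Fin n, (starRingEnd ℂ) (c j) * c k * (if (j : ℕ) = k then 1 else Complex.exp (Complex.I * (5 * Real.pi / 8) * (if (j : ℕ) < k then 1 else -1)) * (Summit.CriticalPhenomena.SAWScalingLimit.Theorems.HexConjecture.RootLocality.halfPlaneArch ((Int.natAbs ((j : ℤ) - k) : ℕ) : ℤ) : ℂ))).re := by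
  sorry

/-- **STUB 2♮♮-P→B · `stub_bochnerIneq_of_positivity`** (LANDED c12 wave 1, p171006 — registered by lead c12; s3's STUB 2 verbatim):
positivity ⟹ the Bochner tail inequality.  PROOF ROUTE: in the Gram form take `c_j = e^{iqj}`, `j < n`, `q = 3π/(4M)`; the form equals
`n + 2Σ_{1≤m<n}(n−m) G(m) cos(qm + 5π/8) ≥ 0`; divide by `n`; `−cos(qm + 5π/8) = w(m/M) + cos(3π/8)` with `w(m/M) ≥ 0` for `m ≤ M` and `≥ −1` beyond;
`Σ_{M<m<n} G(m) ≤ Def(M)` (partial sums of `G` over `[1,n)` are `≤ 1/(2cos(3π/8))`: evenness `G(−k) = G(k)` (CodedReflect p129924) + the trapezoid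
total `archTotal_le` passed to the `iSup`); subtract and let `n → ∞` in the finite sum `Σ_{m≤M}(1 − m/n)G(m)(w + c_α)`.  Needs `0 ≤ halfPlaneArch`
(`Real.iSup_nonneg`) and `BddAbove` of the defining family (each term `≤ 1/cos(3π/8)`). -/
theorem stub_bochnerIneq_of_positivity : (∀ (n : ℕ) (c : Fin n → ℂ), 0 ≤ (∑ j : Fin n, ∑ k : Fin n, (starRingEnd ℂ) (c j) * c k * (if (j : ℕ) = k then 1 else Complex.exp (Complex.I * (5 * Real.pi / 8) * (if (j : ℕ) < k then 1 else -1)) * (Summit.CriticalPhenomena.SAWScalingLimit.Theorems.HexConjecture.RootLocality.halfPlaneArch ((Int.natAbs ((j : ℤ) - k) : ℕ) : ℤ) : ℂ))).re) → (∀ M : ℕ, 1 ≤ M → ∑ k ∈ Finset.Ico 1 M, Summit.CriticalPhenomena.SAWScalingLimit.Theorems.HexConjecture.RootLocality.halfPlaneArch ((k : ℕ) : ℤ) * (Real.cos (3 * Real.pi / 8 * (2 * (k : ℝ) / M - 1)) - Real.cos (3 * Real.pi / 8)) ≤ (1 + Real.cos (3 * Real.pi / 8)) * (1 / (2 * Real.cos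 (3 * Real.pi / 8)) - ∑ k ∈ Finset.Icc 1 M, Summit.CriticalPhenomena.SAWScalingLimit.Theorems.HexConjecture.RootLocality.halfPlaneArch ((k : ℕ) : ℤ))) :=
  -- LANDED (seat c12, wave 1): `…Theorems/SAWDevelopingMapHexConjectureBochnerIneqOfPositivity.lean` p171006
  Summit.CriticalPhenomena.SAWScalingLimit.Theorems.HexConjecture.RootLocality.stub_bochnerIneq_of_positivity

/-- **STUB 2♮♮-B→R · `stub_reg_of_bochner_avgTail`** (LANDED c12 wave 1, p171196 — registered by lead c12; s3's STUB 3 verbatim):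
Bochner family ∧ AvgTF ⟹ REG.  PROOF ROUTE: (i) with `a = 1/20`, `b = 19/20`, `w ≥ w_* = w(1/20) = 0.1059…` on `[a,b]` and `Def` antitone (`G ≥ 0`):
`Def(⌈M/20⌉ − 1) ≤ (1 + (1+cos(3π/8))/w_*)·Def(⌊19M/20⌋) ≤ 14.06·Def(⌊19M/20⌋)`; iterate (scale ratio 19 > 14.06) ⟹ `Σ_{i≤N} Def(i) ≤ C₁ (N+1) Def(N)`;
(ii) AvgTF; (iii) `Def(T) ≤ (cos(π/8)/cos(3π/8))·triDl T` WITHOUT any limit identity: `Σ_{0<|d|≤T} G(d) ≥ triA T` (the triangle's floor arches are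
trapezoid floor arches: `triV T ⊆ stripV (N+1) (N+1)` for `N ≥ 2T`, `le_ciSup`), evenness, and `tri_identity'` (`1/c_α − triA T = (2cos(π/8)/c_α)·triDl T`). -/
theorem stub_reg_of_bochner_avgTail : (∀ M : ℕ, 1 ≤ M → ∑ k ∈ Finset.Ico 1 M, Summit.CriticalPhenomena.SAWScalingLimit.Theorems.HexConjecture.RootLocality.halfPlaneArch ((k : ℕ) : ℤ) * (Real.cos (3 * Real.pi / 8 * (2 * (k : ℝ) / M - 1)) - Real.cos (3 * Real.pi / 8)) ≤ (1 + Real.cos (3 * Real.pi / 8)) * (1 / (2 * Real.cos (3 * Real.pi / 8)) - ∑ k ∈ Finset.Icc 1 M, Summit.CriticalPhenomena.SAWScalingLimit.Theorems.HexConjecture.RootLocality.halfPlaneArch ((k : ℕ) : ℤ))) → (∃ C : ℝ, ∀ T : ℕ, 1 ≤ T → ∑ i ∈ Finset.range (T + 1), Literature.Probability.RandomPlanarGeometry.SAW.HV.triDl i ≤ C * ∑ i ∈ Finset.range (T + 1), (1 / (2 * Real.cos (3 * Real.pi / 8)) - ∑ k ∈ Finset.Icc 1 i, Summit.CriticalPhenomena.SAWScalingLimit.Theorems.HexConjecture.RootLocality.halfPlaneArch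 ((k : ℕ) : ℤ))) → (∃ C : ℝ, ∀ T : ℕ, 1 ≤ T → ∑ i ∈ Finset.range (T + 1), Literature.Probability.RandomPlanarGeometry.SAW.HV.triDl i ≤ C * ((T : ℝ) + 1) * Literature.Probability.RandomPlanarGeometry.SAW.HV.triDl T) :=
  -- LANDED (seat c12, wave 1): `…Theorems/SAWDevelopingMapHexConjectureRegOfBochnerAvgTail.lean` p171196
  Summit.CriticalPhenomena.SAWScalingLimit.Theorems.HexConjecture.RootLocality.stub_reg_of_bochner_avgTail

/-- **STUB 2♮♮-T · `stub_averageTailFraction`** (OPEN — s3's RESIDUAL, registered by lead c12 in v13 after the two glue stubs landed; see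
`AverageTailFraction`).  WHY IT SUFFICES: with `stub_halfPlaneGramPositivity` and the LANDED glue (p171006, p171196) it gives REG (`triDlLowerRegular_of_gram`),
hence WTLB (p142667) and the PRIMARY composition.  WHY PLAUSIBLY TRUE: both sides `≍ T^{3/4}` under the LSW exponents; numerically the one-scale tail fraction is
0.88–0.94 (c8) and the AvgTF ratio `Σ_{i≤T} triDl i / Σ_{i≤T} Def(i) ≈ 0.45`.  WHY HARD: excluding "tall thin" arches (triangle scale ≫ landing offset) for most
of the mass is an RSW-type statement about one half-plane ensemble — one-sided and averaged, but with no tool in print.  DISPROVER TARGET: the ratio drifting to ∞. -/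
theorem stub_averageTailFraction : ∃ C : ℝ, ∀ T : ℕ, 1 ≤ T → ∑ i ∈ Finset.range (T + 1), Literature.Probability.RandomPlanarGeometry.SAW.HV.triDl i ≤ C * ∑ i ∈ Finset.range (T + 1), (1 / (2 * Real.cos (3 * Real.pi / 8)) - ∑ k ∈ Finset.Icc 1 i, Summit.CriticalPhenomena.SAWScalingLimit.Theorems.HexConjecture.RootLocality.halfPlaneArch ((k : ℕ) : ℤ)) := by
  sorry

/-- 2♮♮-P ∧ glue ∧ 2♮♮-T ⟹ REG (pure logic over the adopted statements). -/
theorem triDlLowerRegular_of_gram (hP : HalfPlaneGramPositivity) (hB : HalfPlaneGramPositivity → HalfPlaneBochnerIneq)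
    (hR : HalfPlaneBochnerIneq → AverageTailFraction → TriDlLowerRegular) (hT : AverageTailFraction) : TriDlLowerRegular :=
  hR (hB hP) hT

/-- **STUB 3 · `stub_avoidanceCocycle`** — RESHAPED (lead, after wave 1): signature CORRECTED to
`ObservableLimit → RootDominance → CanonicalTransferFlat → HexAvoidanceCocycle` (the canonical transfer (d) is now the
separate OPEN stub `stub_canonicalTransferFlat`); in this form it is PROVED — worker a1a2c2dd landed steps (a)–(c) as
`…AvoidanceCocycle{Value p103331, Integral p104324, Package p105119, RootPhase p107600, Assembly p112643}.lean`
(`restrictionLimit_of_rootDominance : HexObservableLimitR → RootDominance → AdmissibleRestrictionLimitFlat`) and the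
corrected stub `avoidanceCocycle_of_canonicalTransfer` in the final file `…AvoidanceCocycle.lean` p113497 — PLUGGED IN below (closed). ORIGINAL PLANNER TEXT: (L; provable GIVEN its two antecedents — analysis +
combinatorics, no new SAW estimate): STUB 1 → STUB 2 → `HexAvoidanceCocycle`. THE WORK. (a) Exact
lattice restriction: for vertex sets `Λ' ⊆ Λ` the `x_c`-SAWs of `Λ` from `a` to `b` staying in `Λ'`
ARE the SAWs of `Λ'`, so `P_Λ(γ ⊆ Λ') = Z_{Λ'}(a,b)/Z_Λ(a,b) = F'(b)/F(b)` (`|F(b)| = Z(b)` and equal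
phases by winding rigidity at the boundary mid-edge `b`, route support stmt-8515). (b) The computation:
with STUB 1 in `(Ω, Λ)` and in `(Ω', Λ')` (a hull subdomain of a flat-pinned domain is flat-pinned with
a smaller `ρ`; `Λ'` := `Λ` cut down to `Ω'`, filled to be hex-simply-connected) and STUB 2's bumps
`ψ_r`: `F'(b)/F(b) = (S'/S)·(δ²S/F(b))/(δ²S'/F'(b)) → (1 ± ε)·I_Ω(ψ_r)/I_{Ω'}(ψ_r)`, and
`I_{Ω'}(ψ)/I_Ω(ψ) → (h'(∞)/h'(0))^{5/8}` as `r → 0` (`φ_{Ω'} = h∘φ_Ω`, `L' − L'_b = L − L_b +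
log h'(φ_Ω) − log h'(0)`, `h'(φ_Ω(z)) → h'(∞)` on `supp ψ_r`, `|I_Ω(ψ_r)| ≥ cos(5π/32)·∫ψ_r|e^{(5/8)(L−L_b)}|`
by the angular localisation of `ψ_r`); so `lim P = (h'(0)/h'(∞))^{5/8} = Φ_Ã'(0)^{5/8}` (`Ã = φ_Ω(A)`,
bounded and away from `0`; inversion-symmetric, no SLE reversibility needed). (c) The value is
`μ(rangeSubset (closure D'))`: [LSW] Thm 6.1 in `ℍ` (`sle_restriction_eightThirds_holds`, value
`ENNReal.ofReal (d^{5/8})`, `d = Φ_A'(0)`) transported by a chordal uniformiser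
(`MarkedDomain.exists_isChordalUniformizing_holds`, `disjoint_range_pullbackHull_iff`, the touching
event is null: `HullRestrictionNull`). (d) Canonical transfer (flat-boundary class): `Ω_δ` =
`embMeshDomain` with mesh edges; in the flat balls it is the half-lattice `{row ≥ m}` or that plus a row
of DANGLING degree-1 down-faces (never visited except as endpoints: forced first/last step, `O(δ)` in
`CurveClass`); a discrete-boundary endpoint is a bottom up-face / dangling face, i.e. the walk is the
mid-edge walk from the boundary mid-edge below it (weights `x_c^{#vertices}` agree); away from the
marks `Λ δ :=` the hex-simply-connected filling of `V(Ω_δ)` is admissible for STUB 1, and the walks of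
`Λ δ` that are not walks of `Ω_δ` (a non-mesh honeycomb edge, a filled bulb) pass within `δ` of
`∂Ω` at distance `≥ ρ/2` from the marks — their fraction `→ 0` by the cocycle itself for thin
two-sided collar hulls (value `→ 1`), likewise the `O(δ²)`-boundary discrepancy between
`{range ⊆ closure D'}` and `{vertices in Ω'}` (sandwich between shrunk/enlarged hulls, continuity of
`Φ'_A(0)` in `A`: `HasRestrictionDeriv.tendsto_of_kernel_holds`). Probability eventually:
`IsEmbEndpointApprox.reachable` (honours `hexConjecture_false_without_reachable`). Leans on: STUB 1,
STUB 2, `hexParafermionicObservable_zero_spin`, `hexSAWWeight_singleton`, `embDomainGraph_adj_iff`,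
`embMeshGraph_adj_iff`, `sle_restriction_eightThirds_holds`, `IsSLELaw.hullRestriction_eightThirds_holds`,
`MarkedDomain.IsHullSubdomain.eventually_mem`, `exists_isSLECurve_eightThirds`, `IsSLECurve.map_eq_holds`.
[arXiv:math/0209343 Thm 6.1; arXiv:1007.0575 §3; LSW 2004 SAW §3.4] -/
theorem stub_avoidanceCocycle : (∃ c : ℂ, c ≠ 0 ∧ ∀ (D : Literature.Probability.RandomPlanarGeometry.DobrushinDomain) (ρ : ℝ) (Λ : ℝ → Finset Literature.Probability.LatticeModels.HexVertex) (m : Fin 2 → ℝ → ℤ) (a b : ℝ → Sym2 Literature.Probability.LatticeModels.HexVertex) (Φ : Literature.Probability.RandomPlanarGeometry.ConformalEquiv D.carrier UpperHalfPlane.upperHalfPlaneSet) (L : ℂ → ℂ) (Lb : ℂ) (ψ : ℂ → ℂ), let F : ℝ → Sym2 Literature.Probability.LatticeModels.HexVertex → ℂ := fun δ z => Literature.Probability.RandomPlanarGeometry.SAW.hexParafermionicObservable (Λ δ) (a δ) Literature.Probability.RandomPlanarGeometry.SAW.hexCriticalFugacity (5 / 8) z; 0 < ρ → (∀ i : Fin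 2, D.carrier ∩ Metric.ball (D.pt i) ρ = {z : ℂ | (D.pt i).im < z.im} ∩ Metric.ball (D.pt i) ρ) → (∀ᶠ δ : ℝ in nhdsWithin 0 (Set.Ioi 0), Literature.Probability.RandomPlanarGeometry.SAW.hexDomainSimplyConnected (Λ δ) ∧ a δ ∈ Literature.Probability.RandomPlanarGeometry.SAW.hexDomainBoundary (Λ δ) ∧ b δ ∈ Literature.Probability.RandomPlanarGeometry.SAW.hexDomainBoundary (Λ δ) ∧ Nonempty (Literature.Probability.RandomPlanarGeometry.SAW.HexMidEdgeSAW (Λ δ) (a δ) (b δ)) ∧ (Literature.Probability.LatticeModels.hexGraph.induce ((Λ δ : Finset Literature.Probability.LatticeModels.HexVertex) : Set Literature.Probability.LatticeModels.HexVertex)).Preconnected ∧ (∀ v ∈ Λ δ, (δ : ℂ) * Literature.Probability.LatticeModels.hexCenter v ∈ D.carrier) ∧ (∀ i : Fin 2, ∀ v : Literature.Probability.LatticeModels.HexVertex, (δ : ℂ) * Literature.Probability.LatticeModels.hexCenter v ∈ Metric.ball (D.pt i) ρ → (v ∈ Λ δ ↔ m i δ ≤ v.1 1))) → (∀ K : Set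 ℂ, IsCompact K → K ⊆ D.carrier → ∀ᶠ δ : ℝ in nhdsWithin 0 (Set.Ioi 0), ∀ v : Literature.Probability.LatticeModels.HexVertex, (δ : ℂ) * Literature.Probability.LatticeModels.hexCenter v ∈ K → v ∈ Λ δ) → Filter.Tendsto (fun δ : ℝ => (δ : ℂ) * Literature.Probability.RandomPlanarGeometry.SAW.hexMidpoint (a δ)) (nhdsWithin 0 (Set.Ioi 0)) (nhds (D.pt 0)) → Filter.Tendsto (fun δ : ℝ => (δ : ℂ) * Literature.Probability.RandomPlanarGeometry.SAW.hexMidpoint (b δ)) (nhdsWithin 0 (Set.Ioi 0)) (nhds (D.pt 1)) → Filter.Tendsto (fun x => ‖Φ x‖) (nhdsWithin (D.pt 0) D.carrier) Filter.atTop → Φ.HasBoundaryValue (D.pt 1) 0 → ContinuousOn L D.carrier → (∀ z ∈ D.carrier, Complex.exp (L z) = deriv Φ z) → Filter.Tendsto L (nhdsWithin (D.pt 1) D.carrier) (nhds Lb) → Continuous ψ → HasCompactSupport ψ → tsupport ψ ⊆ D.carrier → Filter.Tendsto (fun δ : ℝ => (δ : ℂ) ^ 2 * (∑ᶠ e ∈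 Literature.Probability.RandomPlanarGeometry.SAW.hexDomainMidEdges (Λ δ), ψ ((δ : ℂ) * Literature.Probability.RandomPlanarGeometry.SAW.hexMidpoint e) * F δ e) / F δ (b δ)) (nhdsWithin 0 (Set.Ioi 0)) (nhds (c * ∫ z, ψ z * Complex.exp ((5 / 8 : ℂ) * (L z - Lb))))) → (∀ (D : Literature.Probability.RandomPlanarGeometry.DobrushinDomain) (ρ : ℝ) (Λ Λ' : ℝ → Finset Literature.Probability.LatticeModels.HexVertex) (m : ℝ → ℤ) (a : ℝ → Sym2 Literature.Probability.LatticeModels.HexVertex), 0 < ρ → D.carrier ∩ Metric.ball (D.pt 0) ρ = {z : ℂ | (D.pt 0).im < z.im} ∩ Metric.ball (D.pt 0) ρ → (∀ᶠ δ : ℝ in nhdsWithin (0 : ℝ) (Set.Ioi 0), Literature.Probability.RandomPlanarGeometry.SAW.hexDomainSimplyConnected (Λ δ) ∧ Literature.Probability.RandomPlanarGeometry.SAW.hexDomainSimplyConnected (Λ' δ) ∧ Λ' δ ⊆ Λ δ ∧ a δ ∈ Literature.Probability.RandomPlanarGeometry.SAW.hexDomainBoundary (Λ δ) ∧ a δ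 ∈ Literature.Probability.RandomPlanarGeometry.SAW.hexDomainBoundary (Λ' δ) ∧ (∀ v ∈ Λ δ, (δ : ℂ) * Literature.Probability.LatticeModels.hexCenter v ∈ D.carrier) ∧ (∀ v : Literature.Probability.LatticeModels.HexVertex, (δ : ℂ) * Literature.Probability.LatticeModels.hexCenter v ∈ Metric.ball (D.pt 0) ρ → (v ∈ Λ δ ↔ m δ ≤ v.1 1)) ∧ (∀ v : Literature.Probability.LatticeModels.HexVertex, (δ : ℂ) * Literature.Probability.LatticeModels.hexCenter v ∈ Metric.ball (D.pt 0) ρ → (v ∈ Λ' δ ↔ v ∈ Λ δ))) → Filter.Tendsto (fun δ : ℝ => (δ : ℂ) * Literature.Probability.RandomPlanarGeometry.SAW.hexMidpoint (a δ)) (nhdsWithin (0 : ℝ) (Set.Ioi 0)) (nhds (D.pt 0)) → ∀ ε : ℝ, 0 < ε → ∃ r₀ : ℝ, 0 < r₀ ∧ ∀ r : ℝ, 0 < r → r < r₀ → ∃ ψ : ℂ → ℝ, Continuous ψ ∧ HasCompactSupport ψ ∧ (∀ z, 0 ≤ ψ z) ∧ (∃ z, ψ z ≠ 0) ∧ tsupport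 ψ ⊆ Metric.ball (D.pt 0 + (r : ℂ) * Complex.I) (r / 4) ∧ ∀ᶠ δ : ℝ in nhdsWithin (0 : ℝ) (Set.Ioi 0), ‖(∑ᶠ e ∈ Literature.Probability.RandomPlanarGeometry.SAW.hexDomainMidEdges (Λ' δ), (ψ ((δ : ℂ) * Literature.Probability.RandomPlanarGeometry.SAW.hexMidpoint e) : ℂ) * Literature.Probability.RandomPlanarGeometry.SAW.hexParafermionicObservable (Λ' δ) (a δ) Literature.Probability.RandomPlanarGeometry.SAW.hexCriticalFugacity (5 / 8) e) - ∑ᶠ e ∈ Literature.Probability.RandomPlanarGeometry.SAW.hexDomainMidEdges (Λ δ), (ψ ((δ : ℂ) * Literature.Probability.RandomPlanarGeometry.SAW.hexMidpoint e) : ℂ) * Literature.Probability.RandomPlanarGeometry.SAW.hexParafermionicObservable (Λ δ) (a δ) Literature.Probability.RandomPlanarGeometry.SAW.hexCriticalFugacity (5 / 8) e‖ ≤ ε * ‖∑ᶠ e ∈ Literature.Probability.RandomPlanarGeometry.SAW.hexDomainMidEdges (Λ δ), (ψ ((δ : ℂ) * Literature.Probability.RandomPlanarGeometry.SAW.hexMidpoint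 e) : ℂ) * Literature.Probability.RandomPlanarGeometry.SAW.hexParafermionicObservable (Λ δ) (a δ) Literature.Probability.RandomPlanarGeometry.SAW.hexCriticalFugacity (5 / 8) e‖) → ((∀ (D D' : Literature.Probability.RandomPlanarGeometry.DobrushinDomain) (ρ : ℝ) (φ : Literature.Probability.RandomPlanarGeometry.ConformalEquiv UpperHalfPlane.upperHalfPlaneSet D.carrier) (Φ : Literature.Probability.RandomPlanarGeometry.ConformalEquiv (UpperHalfPlane.upperHalfPlaneSet \ φ.pullbackHull D') UpperHalfPlane.upperHalfPlaneSet) (d : ℝ) (Λ Λ' : ℝ → Finset Literature.Probability.LatticeModels.HexVertex) (m : Fin 2 → ℝ → ℤ) (a b : ℝ → Sym2 Literature.Probability.LatticeModels.HexVertex), 0 < ρ → (∀ i : Fin 2, D.carrier ∩ Metric.ball (D.pt i) ρ = {z : ℂ | (D.pt i).im < z.im} ∩ Metric.ball (D.pt i) ρ) → D.IsHullSubdomain D' → D.IsChordalUniformizing φ → Literature.Probability.RandomPlanarGeometry.IsRestrictionMap (φ.pullbackHull D') Φ → Literature.Probability.RandomPlanarGeometry.HasRestrictionDeriv (φ.pullbackHull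 D') Φ d → (∀ᶠ δ : ℝ in nhdsWithin (0 : ℝ) (Set.Ioi 0), Λ' δ ⊆ Λ δ ∧ Literature.Probability.RandomPlanarGeometry.SAW.hexDomainSimplyConnected (Λ δ) ∧ Literature.Probability.RandomPlanarGeometry.SAW.hexDomainSimplyConnected (Λ' δ) ∧ (Literature.Probability.LatticeModels.hexGraph.induce ((Λ δ : Finset Literature.Probability.LatticeModels.HexVertex) : Set Literature.Probability.LatticeModels.HexVertex)).Preconnected ∧ (Literature.Probability.LatticeModels.hexGraph.induce ((Λ' δ : Finset Literature.Probability.LatticeModels.HexVertex) : Set Literature.Probability.LatticeModels.HexVertex)).Preconnected ∧ a δ ∈ Literature.Probability.RandomPlanarGeometry.SAW.hexDomainBoundary (Λ δ) ∧ b δ ∈ Literature.Probability.RandomPlanarGeometry.SAW.hexDomainBoundary (Λ δ) ∧ a δ ∈ Literature.Probability.RandomPlanarGeometry.SAW.hexDomainBoundary (Λ' δ) ∧ b δ ∈ Literature.Probability.RandomPlanarGeometry.SAW.hexDomainBoundary (Λ' δ) ∧ Nonempty (Literature.Probability.RandomPlanarGeometry.SAW.HexMidEdgeSAW (Λ' δ)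 (a δ) (b δ)) ∧ (∀ v ∈ Λ δ, (δ : ℂ) * Literature.Probability.LatticeModels.hexCenter v ∈ D.carrier) ∧ (∀ v ∈ Λ' δ, (δ : ℂ) * Literature.Probability.LatticeModels.hexCenter v ∈ D'.carrier) ∧ (∀ i : Fin 2, ∀ v : Literature.Probability.LatticeModels.HexVertex, (δ : ℂ) * Literature.Probability.LatticeModels.hexCenter v ∈ Metric.ball (D.pt i) ρ → ((v ∈ Λ δ ↔ m i δ ≤ v.1 1) ∧ (v ∈ Λ' δ ↔ m i δ ≤ v.1 1)))) → (∀ K : Set ℂ, IsCompact K → K ⊆ D.carrier → ∀ᶠ δ : ℝ in nhdsWithin (0 : ℝ) (Set.Ioi 0), ∀ v : Literature.Probability.LatticeModels.HexVertex, (δ : ℂ) * Literature.Probability.LatticeModels.hexCenter v ∈ K → v ∈ Λ δ) → (∀ K : Set ℂ, IsCompact K → K ⊆ D'.carrier → ∀ᶠ δ : ℝ in nhdsWithin (0 : ℝ) (Set.Ioi 0), ∀ v : Literature.Probability.LatticeModels.HexVertex, (δ : ℂ) * Literature.Probability.LatticeModels.hexCenter v ∈ K → v ∈ Λ' δ) →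 Filter.Tendsto (fun δ : ℝ => (δ : ℂ) * Literature.Probability.RandomPlanarGeometry.SAW.hexMidpoint (a δ)) (nhdsWithin (0 : ℝ) (Set.Ioi 0)) (nhds (D.pt 0)) → Filter.Tendsto (fun δ : ℝ => (δ : ℂ) * Literature.Probability.RandomPlanarGeometry.SAW.hexMidpoint (b δ)) (nhdsWithin (0 : ℝ) (Set.Ioi 0)) (nhds (D.pt 1)) → Filter.Tendsto (fun δ : ℝ => (∑ γ : Literature.Probability.RandomPlanarGeometry.SAW.HexMidEdgeSAW (Λ' δ) (a δ) (b δ), Literature.Probability.RandomPlanarGeometry.SAW.hexCriticalFugacity ^ γ.length) / (∑ γ : Literature.Probability.RandomPlanarGeometry.SAW.HexMidEdgeSAW (Λ δ) (a δ) (b δ), Literature.Probability.RandomPlanarGeometry.SAW.hexCriticalFugacity ^ γ.length)) (nhdsWithin (0 : ℝ) (Set.Ioi 0)) (nhds (d ^ ((5 : ℝ) / 8)))) → ∀ (D D' : Literature.Probability.RandomPlanarGeometry.DobrushinDomain) (ρ : ℝ) (φ : Literature.Probability.RandomPlanarGeometry.ConformalEquiv UpperHalfPlane.upperHalfPlaneSet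 D.carrier) (Φ : Literature.Probability.RandomPlanarGeometry.ConformalEquiv (UpperHalfPlane.upperHalfPlaneSet \ φ.pullbackHull D') UpperHalfPlane.upperHalfPlaneSet) (d : ℝ) (a b : ℝ → Literature.Probability.LatticeModels.HexVertex), 0 < ρ → (∀ i : Fin 2, D.carrier ∩ Metric.ball (D.pt i) ρ = {z : ℂ | (D.pt i).im < z.im} ∩ Metric.ball (D.pt i) ρ) → D.IsHullSubdomain D' → D.IsChordalUniformizing φ → Literature.Probability.RandomPlanarGeometry.IsRestrictionMap (φ.pullbackHull D') Φ → Literature.Probability.RandomPlanarGeometry.HasRestrictionDeriv (φ.pullbackHull D') Φ d → Literature.Probability.RandomPlanarGeometry.SAW.IsEmbEndpointApprox Literature.Probability.LatticeModels.hexGraph Literature.Probability.LatticeModels.hexCenter D a b → (∀ᶠ δ : ℝ in nhdsWithin (0 : ℝ) (Set.Ioi 0), (a δ ∈ Literature.Probability.RandomPlanarGeometry.SAW.embMeshDomain Literature.Probability.LatticeModels.hexGraph Literature.Probability.LatticeModels.hexCenter D.carrier δ ∧ ∃ w, Literature.Probability.LatticeModels.hexGraph.Adj (a δ) w ∧ ¬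 (Literature.Probability.RandomPlanarGeometry.SAW.hexDomainGraph D.carrier δ).Adj (a δ) w) ∧ (b δ ∈ Literature.Probability.RandomPlanarGeometry.SAW.embMeshDomain Literature.Probability.LatticeModels.hexGraph Literature.Probability.LatticeModels.hexCenter D.carrier δ ∧ ∃ w, Literature.Probability.LatticeModels.hexGraph.Adj (b δ) w ∧ ¬ (Literature.Probability.RandomPlanarGeometry.SAW.hexDomainGraph D.carrier δ).Adj (b δ) w)) → Filter.Tendsto (fun δ : ℝ => ((Literature.Probability.RandomPlanarGeometry.SAW.hexSAWLaw D.carrier δ (a δ) (b δ)).map (fun γ : Literature.Probability.RandomPlanarGeometry.SAW.HexDomainSAW D.carrier δ (a δ) (b δ) => γ.curve)) (Literature.Probability.RandomPlanarGeometry.CurveClass.rangeSubset (closure D'.carrier))) (nhdsWithin (0 : ℝ) (Set.Ioi 0)) (nhds (ENNReal.ofReal (d ^ ((5 : ℝ) / 8))))) → ∀ (D D' : Literature.Probability.RandomPlanarGeometry.DobrushinDomain) (ρ : ℝ) (a b : ℝ → Literature.Probability.LatticeModels.HexVertex) (μ : MeasureTheory.Measure (Literature.Probability.RandomPlanarGeometry.CurveClass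 ℂ)), 0 < ρ → (∀ i : Fin 2, D.carrier ∩ Metric.ball (D.pt i) ρ = {z : ℂ | (D.pt i).im < z.im} ∩ Metric.ball (D.pt i) ρ) → Literature.Probability.RandomPlanarGeometry.SAW.IsEmbEndpointApprox Literature.Probability.LatticeModels.hexGraph Literature.Probability.LatticeModels.hexCenter D a b → (∀ᶠ δ : ℝ in nhdsWithin (0 : ℝ) (Set.Ioi 0), (a δ ∈ Literature.Probability.RandomPlanarGeometry.SAW.embMeshDomain Literature.Probability.LatticeModels.hexGraph Literature.Probability.LatticeModels.hexCenter D.carrier δ ∧ ∃ w, Literature.Probability.LatticeModels.hexGraph.Adj (a δ) w ∧ ¬ (Literature.Probability.RandomPlanarGeometry.SAW.hexDomainGraph D.carrier δ).Adj (a δ) w) ∧ (b δ ∈ Literature.Probability.RandomPlanarGeometry.SAW.embMeshDomain Literature.Probability.LatticeModels.hexGraph Literature.Probability.LatticeModels.hexCenter D.carrier δ ∧ ∃ w, Literature.Probability.LatticeModels.hexGraph.Adj (b δ) w ∧ ¬ (Literature.Probability.RandomPlanarGeometry.SAW.hexDomainGraph D.carrier δ).Adj (b δ) w)) → D.IsHullSubdomain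 D' → Literature.Probability.RandomPlanarGeometry.IsSLELaw ((8 : NNReal) / 3) D μ → Filter.Tendsto (fun δ : ℝ => ((Literature.Probability.RandomPlanarGeometry.SAW.hexSAWLaw D.carrier δ (a δ) (b δ)).map (fun γ : Literature.Probability.RandomPlanarGeometry.SAW.HexDomainSAW D.carrier δ (a δ) (b δ) => γ.curve)) (Literature.Probability.RandomPlanarGeometry.CurveClass.rangeSubset (closure D'.carrier))) (nhdsWithin (0 : ℝ) (Set.Ioi 0)) (nhds (μ (Literature.Probability.RandomPlanarGeometry.CurveClass.rangeSubset (closure D'.carrier)))) :=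
  Summit.CriticalPhenomena.SAWScalingLimit.Theorems.HexConjecture.RootLocality.avoidanceCocycle_of_canonicalTransfer

/-- **Former STUB 3d · `stub_canonicalTransferFlat`** — RETIRED by the lead continuation's reshape (no longer
registered; the flat-class canonical transfer is not needed in the floor class, where crux-10472's
`FloorRatio.canonicalTransfer_of_hullApprox` + `FloorRatio.hullApprox` are LANDED).  Its statement survives as the
named Prop `CanonicalTransferFlat`, hypothesis of the recorded flat reach `hexConjectureFlatBoundary_of_line`. -/
example : CanonicalTransferFlat ↔ (AdmissibleRestrictionLimitFlat → FloorRestrictionLimitFlat) := Iff.rfl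

/-- **STUB 3♭ · `stub_avoidanceCocycleFloor`** — CLOSED (wave 1 of seat c1: LANDED p116316, `…AvoidanceCocycleFloor.lean`, plugged in): `HexObservableLimitR →
RootDominance → HexAvoidanceCocycleFloor`, by `RootLocality.hexAvoidanceCocycle_floor_of_hullApprox` (p113497) fed with
`FloorRatio.hullApprox` (p114707).  Leans on: those two landed theorems only. -/
theorem stub_avoidanceCocycleFloor : Summit.CriticalPhenomena.SAWScalingLimit.Theses.SAWDefectDecoherence.HexObservableLimitR → (∀ (D : Literature.Probability.RandomPlanarGeometry.DobrushinDomain) (ρ : ℝ) (Λ Λ' : ℝ → Finset Literature.Probability.LatticeModels.HexVertex) (m : ℝ → ℤ) (a : ℝ → Sym2 Literature.Probability.LatticeModels.HexVertex), 0 < ρ → D.carrier ∩ Metric.ball (D.pt 0) ρ = {z : ℂ | (D.pt 0).im < z.im} ∩ Metric.ball (D.pt 0) ρ → (∀ᶠ δ : ℝ in nhdsWithin (0 : ℝ) (Set.Ioi 0), Literature.Probability.RandomPlanarGeometry.SAW.hexDomainSimplyConnected (Λ δ) ∧ Literature.Probability.RandomPlanarGeometry.SAW.hexDomainSimplyConnected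 (Λ' δ) ∧ Λ' δ ⊆ Λ δ ∧ a δ ∈ Literature.Probability.RandomPlanarGeometry.SAW.hexDomainBoundary (Λ δ) ∧ a δ ∈ Literature.Probability.RandomPlanarGeometry.SAW.hexDomainBoundary (Λ' δ) ∧ (∀ v ∈ Λ δ, (δ : ℂ) * Literature.Probability.LatticeModels.hexCenter v ∈ D.carrier) ∧ (∀ v : Literature.Probability.LatticeModels.HexVertex, (δ : ℂ) * Literature.Probability.LatticeModels.hexCenter v ∈ Metric.ball (D.pt 0) ρ → (v ∈ Λ δ ↔ m δ ≤ v.1 1)) ∧ (∀ v : Literature.Probability.LatticeModels.HexVertex, (δ : ℂ) * Literature.Probability.LatticeModels.hexCenter v ∈ Metric.ball (D.pt 0) ρ → (v ∈ Λ' δ ↔ v ∈ Λ δ))) → Filter.Tendsto (fun δ : ℝ => (δ : ℂ) * Literature.Probability.RandomPlanarGeometry.SAW.hexMidpoint (a δ)) (nhdsWithin (0 : ℝ) (Set.Ioi 0)) (nhds (D.pt 0)) → ∀ ε : ℝ, 0 < ε → ∃ r₀ : ℝ, 0 < r₀ ∧ ∀ r : ℝ, 0 < r → r < r₀ → ∃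 ψ : ℂ → ℝ, Continuous ψ ∧ HasCompactSupport ψ ∧ (∀ z, 0 ≤ ψ z) ∧ (∃ z, ψ z ≠ 0) ∧ tsupport ψ ⊆ Metric.ball (D.pt 0 + (r : ℂ) * Complex.I) (r / 4) ∧ ∀ᶠ δ : ℝ in nhdsWithin (0 : ℝ) (Set.Ioi 0), ‖(∑ᶠ e ∈ Literature.Probability.RandomPlanarGeometry.SAW.hexDomainMidEdges (Λ' δ), (ψ ((δ : ℂ) * Literature.Probability.RandomPlanarGeometry.SAW.hexMidpoint e) : ℂ) * Literature.Probability.RandomPlanarGeometry.SAW.hexParafermionicObservable (Λ' δ) (a δ) Literature.Probability.RandomPlanarGeometry.SAW.hexCriticalFugacity (5 / 8) e) - ∑ᶠ e ∈ Literature.Probability.RandomPlanarGeometry.SAW.hexDomainMidEdges (Λ δ), (ψ ((δ : ℂ) * Literature.Probability.RandomPlanarGeometry.SAW.hexMidpoint e) : ℂ) * Literature.Probability.RandomPlanarGeometry.SAW.hexParafermionicObservable (Λ δ) (a δ) Literature.Probability.RandomPlanarGeometry.SAW.hexCriticalFugacity (5 / 8) e‖ ≤ ε * ‖∑ᶠ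 e ∈ Literature.Probability.RandomPlanarGeometry.SAW.hexDomainMidEdges (Λ δ), (ψ ((δ : ℂ) * Literature.Probability.RandomPlanarGeometry.SAW.hexMidpoint e) : ℂ) * Literature.Probability.RandomPlanarGeometry.SAW.hexParafermionicObservable (Λ δ) (a δ) Literature.Probability.RandomPlanarGeometry.SAW.hexCriticalFugacity (5 / 8) e‖) → ∀ (D D' : Literature.Probability.RandomPlanarGeometry.DobrushinDomain) (ρ : ℝ) (a b : ℝ → Literature.Probability.LatticeModels.HexVertex) (μ : MeasureTheory.Measure (Literature.Probability.RandomPlanarGeometry.CurveClass ℂ)), (0 < ρ ∧ (D.pt 1).im = (D.pt 0).im ∧ D.carrier ⊆ {z : ℂ | (D.pt 0).im < z.im} ∧ D.carrier ∩ Metric.ball (D.pt 0) ρ = {z : ℂ | (D.pt 0).im < z.im} ∩ Metric.ball (D.pt 0) ρ ∧ D.carrier ∩ Metric.ball (D.pt 1) ρ = {z : ℂ | (D.pt 1).im < z.im} ∩ Metric.ball (D.pt 1) ρ) → Literature.Probability.RandomPlanarGeometry.SAW.IsEmbEndpointApprox Literature.Probability.LatticeModels.hexGraph Literature.Probability.LatticeModels.hexCenter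 D a b → (∀ᶠ δ : ℝ in nhdsWithin (0 : ℝ) (Set.Ioi 0), (a δ ∈ Literature.Probability.RandomPlanarGeometry.SAW.embMeshDomain Literature.Probability.LatticeModels.hexGraph Literature.Probability.LatticeModels.hexCenter D.carrier δ ∧ ∃ w, Literature.Probability.LatticeModels.hexGraph.Adj (a δ) w ∧ ¬ (Literature.Probability.RandomPlanarGeometry.SAW.hexDomainGraph D.carrier δ).Adj (a δ) w) ∧ (b δ ∈ Literature.Probability.RandomPlanarGeometry.SAW.embMeshDomain Literature.Probability.LatticeModels.hexGraph Literature.Probability.LatticeModels.hexCenter D.carrier δ ∧ ∃ w, Literature.Probability.LatticeModels.hexGraph.Adj (b δ) w ∧ ¬ (Literature.Probability.RandomPlanarGeometry.SAW.hexDomainGraph D.carrier δ).Adj (b δ) w)) → D.IsHullSubdomain D' → Literature.Probability.RandomPlanarGeometry.IsSLELaw ((8 : NNReal) / 3) D μ → Filter.Tendsto (fun δ : ℝ => ((Literature.Probability.RandomPlanarGeometry.SAW.hexSAWLaw D.carrier δ (a δ) (b δ)).map (fun γ : Literature.Probability.RandomPlanarGeometry.SAW.HexDomainSAW D.carrier δ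 (a δ) (b δ) => γ.curve)) (Literature.Probability.RandomPlanarGeometry.CurveClass.rangeSubset (closure D'.carrier))) (nhdsWithin (0 : ℝ) (Set.Ioi 0)) (nhds (μ (Literature.Probability.RandomPlanarGeometry.CurveClass.rangeSubset (closure D'.carrier)))) :=
  Summit.CriticalPhenomena.SAWScalingLimit.Theorems.HexConjecture.RootLocality.stub_avoidanceCocycleFloor

/-- **STUB 4 · `stub_rangeIdentification`** — CLOSED (wave 1 of this line: PROVED, final assembly p113656 over the parts
`…RangeIdentification{Hyperspace p103698, Lattice p105704, Fill p103853, Boundary p104465, Avoid p105780, Transfer p104848}`;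
design: Γ from the SLE(8/3) law through a chordal uniformiser, identification = collars + avoidance identity + injective
avoidance code on chord ranges + arc lemma, no tightness). PLANNER TEXT: (M–L, PROVABLE NOW — soft: measure theory + plane topology
+ the tree's restriction library): `HexAvoidanceCocycle → HexRangeLimit`. THE WORK. The laws of
`K_δ := range γ_δ ⊆ closure D` live in the compact hyperspace `{K ⊆ closure D}` of `NonemptyCompacts ℂ`
(Mathlib `NonemptyCompacts.instMetricSpace`, Blaschke), so they are relatively compact — NO tightness
estimate. Let `ν` be a subsequential limit and `μ` the SLE_{8/3} law of `D` (`exists_isSLECurve_eightThirds`).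
(i) `ν{K ⊆ closure D'} = μ{range ⊆ closure D'}` for every hull subdomain `D'`: portmanteau on the closed
event (`NonemptyCompacts.isClosed_subsets_of_isClosed`) and on its interior, sandwiching `D'` between
shrunk and enlarged hulls, the values being continuous (`HasRestrictionDeriv.tendsto_of_kernel_holds`; or
directly `μ`-continuity). (ii) These events are a π-system rich enough ([LSW] Lemma 3.2:
`RestrictionConfig.isPiSystem_avoid_holds`, `ext_of_avoid_holds`, `IsRestrictionMeasure.unique`, after
pulling back by a chordal uniformiser `MarkedDomain.exists_isChordalUniformizing_holds`) to determine
the law of the boundary-visible hull `H(K) := closure D ∖ ⋃{components of closure D ∖ K reaching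
∂D ∖ {a,b}}`; hence `H(K)` under `ν` has the law of `H(range Γ) = range Γ` (the SLE_{8/3} trace is a
simple arc meeting `∂D` only at the marks: `sleEightThirdsFamily_spec`,
`ae_isSimpleTrace_sleTrace_eightThirds_of_hasSLETrace hasSLETrace_eightThirds`). (iii) `K ⊆ H(K)`, `K` is connected and contains `a`, `b` (closed conditions,
limits of connected polylines with endpoints `→ a, b`), and a connected subset of a simple arc
containing both its endpoints is the arc: `K = H(K)` `ν`-a.s. So every subsequential limit is the law of
`range Γ`; compactness gives `TendstoLaw`. Probability measures eventually from `reachable`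
(`isProbabilityMeasure_hexSAWLaw`; finiteness of `Ω_δ`); `isProjectiveLimit_preWienerMeasure_holds` for
the target. Leans on: the cocycle (STUB 3), `CurveClass.isClosed_rangeSubset`,
`Literature.MeasureTheory.RandomSets.AvoidanceFunctional` (π-systems of avoidance events, Borel =
Effros), `RestrictionMeasuresProofs`, `HullRestrictionSLEHolds`, `SLEUniquenessInLaw`.
[arXiv:math/0209343 Lemma 3.2, Prop. 3.3, Thm 6.1; Matheron 1975 (Choquet–Kendall–Matheron)] -/
theorem stub_rangeIdentification : (∀ (D D' : Literature.Probability.RandomPlanarGeometry.DobrushinDomain) (ρ : ℝ) (a b : ℝ → Literature.Probability.LatticeModels.HexVertex) (μ : MeasureTheory.Measure (Literature.Probability.RandomPlanarGeometry.CurveClass ℂ)), 0 < ρ → (∀ i : Fin 2, D.carrier ∩ Metric.ball (D.pt i) ρ = {z : ℂ | (D.pt i).im < z.im} ∩ Metric.ball (D.pt i) ρ) → Literature.Probability.RandomPlanarGeometry.SAW.IsEmbEndpointApprox Literature.Probability.LatticeModels.hexGraph Literature.Probability.LatticeModels.hexCenter D a b → (∀ᶠ δ : ℝ in nhdsWithin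 (0 : ℝ) (Set.Ioi 0), (a δ ∈ Literature.Probability.RandomPlanarGeometry.SAW.embMeshDomain Literature.Probability.LatticeModels.hexGraph Literature.Probability.LatticeModels.hexCenter D.carrier δ ∧ ∃ w, Literature.Probability.LatticeModels.hexGraph.Adj (a δ) w ∧ ¬ (Literature.Probability.RandomPlanarGeometry.SAW.hexDomainGraph D.carrier δ).Adj (a δ) w) ∧ (b δ ∈ Literature.Probability.RandomPlanarGeometry.SAW.embMeshDomain Literature.Probability.LatticeModels.hexGraph Literature.Probability.LatticeModels.hexCenter D.carrier δ ∧ ∃ w, Literature.Probability.LatticeModels.hexGraph.Adj (b δ) w ∧ ¬ (Literature.Probability.RandomPlanarGeometry.SAW.hexDomainGraph D.carrier δ).Adj (b δ) w)) → D.IsHullSubdomain D' → Literature.Probability.RandomPlanarGeometry.IsSLELaw ((8 : NNReal) / 3) D μ → Filter.Tendsto (fun δ : ℝ => ((Literature.Probability.RandomPlanarGeometry.SAW.hexSAWLaw D.carrier δ (a δ) (b δ)).map (fun γ : Literature.Probability.RandomPlanarGeometry.SAW.HexDomainSAW D.carrier δ (a δ) (b δ) => γ.curve)) (Literature.Probability.RandomPlanarGeometry.CurveClass.rangeSubset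 (closure D'.carrier))) (nhdsWithin (0 : ℝ) (Set.Ioi 0)) (nhds (μ (Literature.Probability.RandomPlanarGeometry.CurveClass.rangeSubset (closure D'.carrier))))) → ∀ (D : Literature.Probability.RandomPlanarGeometry.DobrushinDomain) (ρ : ℝ) (a b : ℝ → Literature.Probability.LatticeModels.HexVertex), 0 < ρ → (∀ i : Fin 2, D.carrier ∩ Metric.ball (D.pt i) ρ = {z : ℂ | (D.pt i).im < z.im} ∩ Metric.ball (D.pt i) ρ) → Literature.Probability.RandomPlanarGeometry.SAW.IsEmbEndpointApprox Literature.Probability.LatticeModels.hexGraph Literature.Probability.LatticeModels.hexCenter D a b → (∀ᶠ δ : ℝ in nhdsWithin (0 : ℝ) (Set.Ioi 0), (a δ ∈ Literature.Probability.RandomPlanarGeometry.SAW.embMeshDomain Literature.Probability.LatticeModels.hexGraph Literature.Probability.LatticeModels.hexCenter D.carrier δ ∧ ∃ w, Literature.Probability.LatticeModels.hexGraph.Adj (a δ) w ∧ ¬ (Literature.Probability.RandomPlanarGeometry.SAW.hexDomainGraph D.carrier δ).Adj (a δ) w) ∧ (b δ ∈ Literature.Probability.RandomPlanarGeometry.SAW.embMeshDomain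 Literature.Probability.LatticeModels.hexGraph Literature.Probability.LatticeModels.hexCenter D.carrier δ ∧ ∃ w, Literature.Probability.LatticeModels.hexGraph.Adj (b δ) w ∧ ¬ (Literature.Probability.RandomPlanarGeometry.SAW.hexDomainGraph D.carrier δ).Adj (b δ) w)) → ∃ Γ : (NNReal → ℝ) → Literature.Probability.RandomPlanarGeometry.CurveClass ℂ, Literature.Probability.RandomPlanarGeometry.IsSLECurve ((8 : NNReal) / 3) D Γ ∧ Literature.Probability.RandomPlanarGeometry.TendstoLaw (fun δ (γ : Literature.Probability.RandomPlanarGeometry.SAW.HexDomainSAW D.carrier δ (a δ) (b δ)) => (⟨⟨γ.curve.range, γ.curve.isCompact_range⟩, γ.curve.range_nonempty⟩ : TopologicalSpace.NonemptyCompacts ℂ)) (fun δ => Literature.Probability.RandomPlanarGeometry.SAW.hexSAWLaw D.carrier δ (a δ) (b δ)) (fun ω => (⟨⟨(Γ ω).range, (Γ ω).isCompact_range⟩, (Γ ω).range_nonempty⟩ : TopologicalSpace.NonemptyCompacts ℂ)) Literature.Probability.Process.preWienerMeasure :=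
  Summit.CriticalPhenomena.SAWScalingLimit.Theorems.HexConjecture.RootLocality.stub_rangeIdentification

/-- **STUB 4♭ · `stub_rangeIdentificationFloor`** — CLOSED (wave 1 of seat c1: LANDED p115940, `…RangeIdentificationFloor.lean` with the pointwise `hexRangeLimit_at_of_cocycle_at`, plugged in): `HexAvoidanceCocycleFloor →
HexRangeLimitFloor`.  The landed proof of `RootLocality.stub_rangeIdentification` (p113656) uses the flat hypotheses
ONLY to instantiate the cocycle at the fixed `(D, ρ, a, b)`; its engine is pointwise:
`Range.exists_subseqLimit hab μ hC hs` (…RangeIdentificationLattice) + `Range.eq_map_range_of_inherits`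
(…RangeIdentification) + `FloorRatio.exists_sleLaw_through`.  The worker lands the pointwise form
`hexRangeLimit_at_of_cocycle_at` and this floor instance. -/
theorem stub_rangeIdentificationFloor : (∀ (D D' : Literature.Probability.RandomPlanarGeometry.DobrushinDomain) (ρ : ℝ) (a b : ℝ → Literature.Probability.LatticeModels.HexVertex) (μ : MeasureTheory.Measure (Literature.Probability.RandomPlanarGeometry.CurveClass ℂ)), (0 < ρ ∧ (D.pt 1).im = (D.pt 0).im ∧ D.carrier ⊆ {z : ℂ | (D.pt 0).im < z.im} ∧ D.carrier ∩ Metric.ball (D.pt 0) ρ = {z : ℂ | (D.pt 0).im < z.im} ∩ Metric.ball (D.pt 0) ρ ∧ D.carrier ∩ Metric.ball (D.pt 1) ρ = {z : ℂ | (D.pt 1).im < z.im} ∩ Metric.ball (D.pt 1) ρ) → Literature.Probability.RandomPlanarGeometry.SAW.IsEmbEndpointApprox Literature.Probability.LatticeModels.hexGraph Literature.Probability.LatticeModels.hexCenter D a b → (∀ᶠ δ : ℝ in nhdsWithin (0 : ℝ) (Set.Ioi 0), (a δ ∈ Literature.Probability.RandomPlanarGeometry.SAW.embMeshDomain Literature.Probability.LatticeModels.hexGraph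 Literature.Probability.LatticeModels.hexCenter D.carrier δ ∧ ∃ w, Literature.Probability.LatticeModels.hexGraph.Adj (a δ) w ∧ ¬ (Literature.Probability.RandomPlanarGeometry.SAW.hexDomainGraph D.carrier δ).Adj (a δ) w) ∧ (b δ ∈ Literature.Probability.RandomPlanarGeometry.SAW.embMeshDomain Literature.Probability.LatticeModels.hexGraph Literature.Probability.LatticeModels.hexCenter D.carrier δ ∧ ∃ w, Literature.Probability.LatticeModels.hexGraph.Adj (b δ) w ∧ ¬ (Literature.Probability.RandomPlanarGeometry.SAW.hexDomainGraph D.carrier δ).Adj (b δ) w)) → D.IsHullSubdomain D' → Literature.Probability.RandomPlanarGeometry.IsSLELaw ((8 : NNReal) / 3) D μ → Filter.Tendsto (fun δ : ℝ => ((Literature.Probability.RandomPlanarGeometry.SAW.hexSAWLaw D.carrier δ (a δ) (b δ)).map (fun γ : Literature.Probability.RandomPlanarGeometry.SAW.HexDomainSAW D.carrier δ (a δ) (b δ) => γ.curve)) (Literature.Probability.RandomPlanarGeometry.CurveClass.rangeSubset (closure D'.carrier))) (nhdsWithin (0 : ℝ) (Set.Ioi 0)) (nhds (μ (Literature.Probability.RandomPlanarGeometry.CurveClass.rangeSubset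 (closure D'.carrier))))) → ∀ (D : Literature.Probability.RandomPlanarGeometry.DobrushinDomain) (ρ : ℝ) (a b : ℝ → Literature.Probability.LatticeModels.HexVertex), (0 < ρ ∧ (D.pt 1).im = (D.pt 0).im ∧ D.carrier ⊆ {z : ℂ | (D.pt 0).im < z.im} ∧ D.carrier ∩ Metric.ball (D.pt 0) ρ = {z : ℂ | (D.pt 0).im < z.im} ∩ Metric.ball (D.pt 0) ρ ∧ D.carrier ∩ Metric.ball (D.pt 1) ρ = {z : ℂ | (D.pt 1).im < z.im} ∩ Metric.ball (D.pt 1) ρ) → Literature.Probability.RandomPlanarGeometry.SAW.IsEmbEndpointApprox Literature.Probability.LatticeModels.hexGraph Literature.Probability.LatticeModels.hexCenter D a b → (∀ᶠ δ : ℝ in nhdsWithin (0 : ℝ) (Set.Ioi 0), (a δ ∈ Literature.Probability.RandomPlanarGeometry.SAW.embMeshDomain Literature.Probability.LatticeModels.hexGraph Literature.Probability.LatticeModels.hexCenter D.carrier δ ∧ ∃ w, Literature.Probability.LatticeModels.hexGraph.Adj (a δ) w ∧ ¬ (Literature.Probability.RandomPlanarGeometry.SAW.hexDomainGraph D.carrier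 δ).Adj (a δ) w) ∧ (b δ ∈ Literature.Probability.RandomPlanarGeometry.SAW.embMeshDomain Literature.Probability.LatticeModels.hexGraph Literature.Probability.LatticeModels.hexCenter D.carrier δ ∧ ∃ w, Literature.Probability.LatticeModels.hexGraph.Adj (b δ) w ∧ ¬ (Literature.Probability.RandomPlanarGeometry.SAW.hexDomainGraph D.carrier δ).Adj (b δ) w)) → ∃ Γ : (NNReal → ℝ) → Literature.Probability.RandomPlanarGeometry.CurveClass ℂ, Literature.Probability.RandomPlanarGeometry.IsSLECurve ((8 : NNReal) / 3) D Γ ∧ Literature.Probability.RandomPlanarGeometry.TendstoLaw (fun δ (γ : Literature.Probability.RandomPlanarGeometry.SAW.HexDomainSAW D.carrier δ (a δ) (b δ)) => (⟨⟨γ.curve.range, γ.curve.isCompact_range⟩, γ.curve.range_nonempty⟩ : TopologicalSpace.NonemptyCompacts ℂ)) (fun δ => Literature.Probability.RandomPlanarGeometry.SAW.hexSAWLaw D.carrier δ (a δ) (b δ)) (fun ω => (⟨⟨(Γ ω).range, (Γ ω).isCompact_range⟩, (Γ ω).range_nonempty⟩ : TopologicalSpace.NonemptyCompacts ℂ)) Literature.Probability.Process.preWienerMeasure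 :=
  Summit.CriticalPhenomena.SAWScalingLimit.Theorems.HexConjecture.RootLocality.stub_rangeIdentificationFloor

/-- **Former STUB 5 · `stub_nonRetracing`** (flat class) — RETIRED by the reshape in favour of the formally weaker
floor-class `stub_nonRetracingFloor`; the statement survives as the named Prop `HexNonRetracing`. -/
example : HexNonRetracing → HexNonRetracingFloor :=
  fun h D ρ a b hfl happ hbd => h D ρ a b hfl.1 (Fin.forall_fin_two.2 ⟨hfl.2.2.2.1, hfl.2.2.2.2⟩) happ hbd

/-- **Former STUB 5♭ · `stub_nonRetracingFloor`** (OPEN SAW estimate, floor class) — RETIRED from the registered list by seat c8's reshape: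
it is implied by the registered `stub_uniformModulus` (`nonRetracingFloor_of_uniformModulus`, p116482) and was carried only by alternative
compositions, which now take the named Prop `HexNonRetracingFloor` as a plain hypothesis. -/
example : UniformModulus → HexNonRetracingFloor :=
  Summit.CriticalPhenomena.SAWScalingLimit.Theorems.HexConjecture.RootLocality.nonRetracingFloor_of_uniformModulus

/-- **STUB 6 · `stub_curveUpgrade`** — CLOSED (wave 1 of this line: PROVED as `RootLocality.Upgrade.curveUpgrade`,
`…CurveUpgradeMain.lean` p108020, parts `…CurveUpgrade{Crossing p103247, Projection p103250, Deterministic p104900,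
Law p103621, Moduli p103622}`; design: portmanteau open-set transfer, no tightness/uniqueness needed). PLANNER TEXT: (M, PROVABLE NOW — deterministic plane topology + portmanteau; no
SAW input): `CurveUpgrade`, see its docstring for the mechanism. Inputs from the tree: the SLE_{8/3}
curve is a.s. simple with endpoints `pt 0`, `pt 1` (`Negative.IsSLECurve.ae_source_eq/ae_target_eq`,
`ae_isSimpleTrace_sleTrace_eightThirds_of_hasSLETrace hasSLETrace_eightThirds`, `IsCompactifiedImage`),
`CurveClass` is Polish (`CurveClass.instPolishSpace`), `range : CurveClass → NonemptyCompacts` is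
1-Lipschitz (`Curve.infDist_range_le`), `isProjectiveLimit_preWienerMeasure_holds`. Steps: (1) the
deterministic lemma (module docstring); (2) tightness of `law(X δ)` in `CurveClass ℂ` from (1) + the
hypotheses (Aizenman–Burchard compactness criterion = bounded number of `h`-steps, inherited from the
arc); (3) every subsequential limit `ν`: ranges have the law of `range Γ`, no triple strands a.s.
(`{triple strand (ε,ℓ)} ⊆ interior {triple strand (2ε, ℓ/2)}`, portmanteau), source `= pt 0`; a
non-retracing curve onto a simple arc from its source is that arc, and the law of a simple curve class
is the image of the law of its (range, source) under a measurable map — so `ν = law Γ`. Why it might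
need reshaping: only measurability bookkeeping (arcs form an analytic set; work on the coupling space or
with `MeasureTheory.AnalyticSet`). [Aizenman–Burchard Duke 1999 §2; Billingsley 1999 Thm 2.1, §5] -/
theorem stub_curveUpgrade : ∀ (D : Literature.Probability.RandomPlanarGeometry.DobrushinDomain) (Ω : ℝ → Type) [∀ δ, MeasurableSpace (Ω δ)] (X : ∀ δ, Ω δ → Literature.Probability.RandomPlanarGeometry.CurveClass ℂ) (P : ∀ δ, MeasureTheory.Measure (Ω δ)) (Γ : (NNReal → ℝ) → Literature.Probability.RandomPlanarGeometry.CurveClass ℂ) (src tgt : ℝ → ℂ), Literature.Probability.RandomPlanarGeometry.IsSLECurve ((8 : NNReal) / 3) D Γ → (∀ᶠ δ : ℝ in nhdsWithin (0 : ℝ) (Set.Ioi 0), AEMeasurable (X δ) (P δ)) → Literature.Probability.RandomPlanarGeometry.TendstoLaw (fun δ ω => (⟨⟨(X δ ω).range, (X δ ω).isCompact_range⟩, (X δ ω).range_nonempty⟩ : TopologicalSpace.NonemptyCompacts ℂ)) P (fun ω => (⟨⟨(Γ ω).range, (Γ ω).isCompact_range⟩, (Γ ω).range_nonempty⟩ :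 TopologicalSpace.NonemptyCompacts ℂ)) Literature.Probability.Process.preWienerMeasure → (∀ δ ω, (X δ ω).source = src δ) → (∀ δ ω, (X δ ω).target = tgt δ) → Filter.Tendsto src (nhdsWithin (0 : ℝ) (Set.Ioi 0)) (nhds (D.pt 0)) → Filter.Tendsto tgt (nhdsWithin (0 : ℝ) (Set.Ioi 0)) (nhds (D.pt 1)) → (∀ ℓ : ℝ, 0 < ℓ → ∀ η : ℝ, 0 < η → ∃ ε : ℝ, 0 < ε ∧ ∀ᶠ δ : ℝ in nhdsWithin (0 : ℝ) (Set.Ioi 0), P δ {ω | ∃ c : Literature.Probability.RandomPlanarGeometry.Curve ℂ, Literature.Probability.RandomPlanarGeometry.CurveClass.mk c = X δ ω ∧ ∃ s t : Fin 3 → unitInterval, (∀ i, s i ≤ t i) ∧ t 0 < s 1 ∧ t 1 < s 2 ∧ (∀ i, ℓ ≤ Metric.diam ((⇑c) '' Set.Icc (s i) (t i))) ∧ ∀ i j, Metric.hausdorffDist ((⇑c) '' Set.Icc (s i) (t i)) ((⇑c) '' Set.Icc (s j) (t j)) ≤ ε} ≤ ENNReal.ofReal η) → Literature.Probability.RandomPlanarGeometry.ConvergesInLawToSLE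 ((8 : NNReal) / 3) D X P :=
  Summit.CriticalPhenomena.SAWScalingLimit.Theorems.HexConjecture.RootLocality.Upgrade.curveUpgrade

/-- **Former STUB 7 · `stub_marksAndEndpoints`** (flat class ⟹ crux) — RETIRED by the reshape in favour of
`stub_marksAndEndpointsFloor` (floor class ⟹ crux, formally stronger); survives as the named Prop `MarksAndEndpoints`. -/
example : MarksAndEndpoints ↔ (HexConjectureFlatBoundary →
    Summit.CriticalPhenomena.SAWScalingLimit.Theses.SAWHexUniversality.HexConjecture) := Iff.rfl

/-- **Former STUB 7♭ · `stub_marksAndEndpointsFloor`** (`HexConjectureFloor → HexConjecture`) — RETIRED by seat c2's reshape in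
favour of the EQUIVALENT `stub_boundaryUniversality` (crux-10472's (E) verbatim; `marksAndEndpointsFloor_iff_boundaryUniversality`);
the statement survives as the named Prop `MarksAndEndpointsFloor`. -/
example : MarksAndEndpointsFloor ↔ (HexConjectureFloor →
    Summit.CriticalPhenomena.SAWScalingLimit.Theses.SAWHexUniversality.HexConjecture) := Iff.rfl

/-- **STUB 5♯ · `stub_uniformModulus`** (L–XL, OPEN — verbatim crux stmt-CriticalPhenomena-10472's registered stub `stub_uniformModulus`;
STRONGER than `stub_nonRetracingFloor`, which it implies, `nonRetracingFloor_of_uniformModulus` p116482; NECESSARY for the crux,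
`Negative.ModulusNecessity.floorUniformModulus_of_hexConjecture` p79732).  See `UniformModulus`.  WHY PLAUSIBLY TRUE: the SLE(8/3) trace is
a.s. a simple curve, and injectivity moduli are closed events (this is how necessity is proved).  WHY HARD: a uniform-in-`δ` modulus is a
six-arm / no-pinching estimate for critical SAW; no RSW, no FKG, no separation lemma in print (10472 leads; Duminil-Copin–Hammond 2013 gives
sub-ballisticity only). [arXiv:1007.0575 §4; Duminil-Copin–Hammond CMP 2013; Kennedy arXiv:math/0112246 (numerics)] -/
theorem stub_uniformModulus : ∀ (D : Literature.Probability.RandomPlanarGeometry.DobrushinDomain) (ρ : ℝ) (a b : ℝ → Literature.Probability.LatticeModels.HexVertex), (0 < ρ ∧ (D.pt 1).im = (D.pt 0).im ∧ D.carrier ⊆ {z : ℂ | (D.pt 0).im < z.im} ∧ D.carrier ∩ Metric.ball (D.pt 0) ρ = {z : ℂ | (D.pt 0).im < z.im} ∩ Metric.ball (D.pt 0) ρ ∧ D.carrier ∩ Metric.ball (D.pt 1) ρ = {z : ℂ | (D.pt 1).im < z.im} ∩ Metric.ball (D.pt 1) ρ) → (Literature.Probability.RandomPlanarGeometry.SAW.IsEmbEndpointApprox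 Literature.Probability.LatticeModels.hexGraph Literature.Probability.LatticeModels.hexCenter D a b ∧ ∀ᶠ δ : ℝ in nhdsWithin (0 : ℝ) (Set.Ioi 0), (∃ u : Literature.Probability.LatticeModels.HexVertex, Literature.Probability.LatticeModels.hexGraph.Adj (a δ) u ∧ ((δ : ℂ) * Literature.Probability.LatticeModels.hexCenter u).im ≤ (D.pt 0).im) ∧ (∃ u : Literature.Probability.LatticeModels.HexVertex, Literature.Probability.LatticeModels.hexGraph.Adj (b δ) u ∧ ((δ : ℂ) * Literature.Probability.LatticeModels.hexCenter u).im ≤ (D.pt 1).im)) → ∀ ε η : ℝ, 0 < ε → 0 < η → ∃ θ : ℝ, 0 < θ ∧ ∀ᶠ δ : ℝ in nhdsWithin (0 : ℝ) (Set.Ioi 0), Literature.Probability.RandomPlanarGeometry.SAW.hexSAWLaw D.carrier δ (a δ) (b δ) {γ | γ.curve ∉ Literature.Probability.RandomPlanarGeometry.CurveClass.modulusClass ε θ} ≤ ENNReal.ofReal η := by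
  sorry

/-- **STUB 7♯ · `stub_boundaryUniversality`** (XL, OPEN, FOREIGN — crux-10472's (E) VERBATIM; the lead holds it; equivalent to the retired
`stub_marksAndEndpointsFloor`): floor-class convergence with floor-vertex endpoints ⟹ DCS Conjecture 1 as typed (all Dobrushin domains, all
`IsEmbEndpointApprox` endpoint approximations).  CONTENT = three residuals shared with every observable / restriction route, none with a
mechanism in print: (R1) marks where `∂D` is not a horizontal floor with `D` above (disc, convex domains; `HexObservableLimitR` is SILENT there,
`Negative.flat_premise_false_on_unitDisc`, and restriction cannot move the marks — hull subdomains agree with `D` near `a, b`); (R2) endpoint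
universality (`IsEmbEndpointApprox` allows microscopically interior endpoints, `Negative.DeepEndpoints`; comparing the laws from `a_δ` and from
the floor vertex below it needs a boundary ratio-mixing estimate `Z_{Ω∖ω}(w → a_δ)/Z_{Ω∖ω}(w → a'_δ) ≈ c(δ)` uniformly in the far
configuration `ω` — a quasi-multiplicativity statement for critical SAW that does not exist); (R3) flat-at-both-marks Jordan domains NOT
above the line through the marks (10472's anchor reduction and `HalfPlaneArchTightness` use the floor).  WHY PLAUSIBLY TRUE: DCS Conj. 1 as
printed is for all simply connected `Ω`; (E) is implied by the crux (`boundaryUniversality_of_hexConjecture`).  RECOMMENDED (both cruxes,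
five leads): promote to its own item `BoundaryUniversality`; equivalently narrow stmt-0808 to `FloorConvergence` plus that item. -/
theorem stub_boundaryUniversality : (∀ (D : Literature.Probability.RandomPlanarGeometry.DobrushinDomain) (ρ : ℝ) (a b : ℝ → Literature.Probability.LatticeModels.HexVertex), (0 < ρ ∧ (D.pt 1).im = (D.pt 0).im ∧ D.carrier ⊆ {z : ℂ | (D.pt 0).im < z.im} ∧ D.carrier ∩ Metric.ball (D.pt 0) ρ = {z : ℂ | (D.pt 0).im < z.im} ∩ Metric.ball (D.pt 0) ρ ∧ D.carrier ∩ Metric.ball (D.pt 1) ρ = {z : ℂ | (D.pt 1).im < z.im} ∩ Metric.ball (D.pt 1) ρ) → (Literature.Probability.RandomPlanarGeometry.SAW.IsEmbEndpointApprox Literature.Probability.LatticeModels.hexGraph Literature.Probability.LatticeModels.hexCenter D a b ∧ ∀ᶠ δ : ℝ in nhdsWithin (0 : ℝ) (Set.Ioi 0), (∃ u : Literature.Probability.LatticeModels.HexVertex, Literature.Probability.LatticeModels.hexGraph.Adj (a δ) u ∧ ((δ : ℂ) * Literature.Probability.LatticeModels.hexCenter u).im ≤ (D.pt 0).im) ∧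 (∃ u : Literature.Probability.LatticeModels.HexVertex, Literature.Probability.LatticeModels.hexGraph.Adj (b δ) u ∧ ((δ : ℂ) * Literature.Probability.LatticeModels.hexCenter u).im ≤ (D.pt 1).im)) → Literature.Probability.RandomPlanarGeometry.ConvergesInLawToSLE ((8 : NNReal) / 3) D (fun δ (γ : Literature.Probability.RandomPlanarGeometry.SAW.HexDomainSAW D.carrier δ (a δ) (b δ)) => γ.curve) (fun δ => Literature.Probability.RandomPlanarGeometry.SAW.hexSAWLaw D.carrier δ (a δ) (b δ))) → ∀ (D : Literature.Probability.RandomPlanarGeometry.DobrushinDomain) (a b : ℝ → Literature.Probability.LatticeModels.HexVertex), Literature.Probability.RandomPlanarGeometry.SAW.IsEmbEndpointApprox Literature.Probability.LatticeModels.hexGraph Literature.Probability.LatticeModels.hexCenter D a b → Literature.Probability.RandomPlanarGeometry.ConvergesInLawToSLE ((8 : NNReal) / 3) D (fun δ (γ : Literature.Probability.RandomPlanarGeometry.SAW.HexDomainSAW D.carrier δ (a δ) (b δ)) => γ.curve) (fun δ => Literature.Probability.RandomPlanarGeometry.SAW.hexSAWLaw D.carrier δ (a δ) (b δ)) := by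
  sorry

/-! ## Consistency: each named statement IS its registered stub (definitionally) -/

theorem floorRatioLimit_holds : FloorRatioLimit := stub_floorRatioLimit
theorem avoidanceCocycleFloorFromRatio_holds : AvoidanceCocycleFloorFromRatio :=
  fun hF hT => Summit.CriticalPhenomena.SAWScalingLimit.Theorems.HexConjecture.RootLocality.hexAvoidanceCocycleFloor_of_floorRestrictionLimit
    (Summit.CriticalPhenomena.SAWScalingLimit.Theorems.ObservableToSLE.FloorRatio.canonicalTransfer_of_hullApprox
      Summit.CriticalPhenomena.SAWScalingLimit.Theorems.HexConjecture.RootLocality.stub_avoidanceCocycleFloor_hullApprox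
      (Summit.CriticalPhenomena.SAWScalingLimit.Theorems.HexConjecture.RootLocality.restrictionCocycle_of_floorRatioModulus hF
        (Summit.CriticalPhenomena.SAWScalingLimit.Theorems.ObservableToSLE.FloorRatio.stub_shortChordLocality_reduction hT)))
theorem archAspectBound_holds : ArchAspectBound := archAspectBound_of_windowTwoPointLowerBound stub_windowTwoPointLowerBound
theorem triDlStep_holds : ∀ L : ℕ, (2 - Real.sqrt 2) * HV.triDl L ≤ HV.triDl (L + 1) := stub_triDlStep
theorem windowTwoPointLowerBound_holds : WindowTwoPointLowerBound := stub_windowTwoPointLowerBound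
theorem avoidanceCocycleFloorFromWindowTwoPoint_holds : AvoidanceCocycleFloorFromWindowTwoPoint :=
  fun hF hW => Summit.CriticalPhenomena.SAWScalingLimit.Theorems.HexConjecture.RootLocality.hexAvoidanceCocycleFloor_of_aspectBound hF
    (archAspectBound_of_windowTwoPointLowerBound hW)
theorem avoidanceCocycleFloorFromAspect_holds : AvoidanceCocycleFloorFromAspect :=
  fun hF hA => Summit.CriticalPhenomena.SAWScalingLimit.Theorems.HexConjecture.RootLocality.hexAvoidanceCocycleFloor_of_aspectBound hF hA
theorem avoidanceCocycleFloorFromWindow_holds : AvoidanceCocycleFloorFromWindow :=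
  fun hF hW => Summit.CriticalPhenomena.SAWScalingLimit.Theorems.HexConjecture.RootLocality.hexAvoidanceCocycleFloor_of_windowLocality hF hW
theorem avoidanceCocycleFloorFromArch_holds : AvoidanceCocycleFloorFromArch :=
  fun h1 hT => Summit.CriticalPhenomena.SAWScalingLimit.Theorems.HexConjecture.RootLocality.hexAvoidanceCocycleFloor_of_archTightness h1 hT
theorem avoidanceCocycleFromObservable_holds : AvoidanceCocycleFromObservable := stub_avoidanceCocycle
theorem avoidanceCocycleFloorFromObservable_holds : AvoidanceCocycleFloorFromObservable := stub_avoidanceCocycleFloor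
theorem rangeIdentification_holds : RangeIdentification := stub_rangeIdentification
theorem rangeIdentificationFloor_holds : RangeIdentificationFloor := stub_rangeIdentificationFloor
theorem hexNonRetracingFloor_holds : HexNonRetracingFloor :=
  Summit.CriticalPhenomena.SAWScalingLimit.Theorems.HexConjecture.RootLocality.nonRetracingFloor_of_uniformModulus stub_uniformModulus
theorem curveUpgrade_holds : CurveUpgrade := stub_curveUpgrade
theorem uniformModulus_holds : UniformModulus := stub_uniformModulus
theorem boundaryUniversality_holds : BoundaryUniversality := stub_boundaryUniversality

/-- UIM ⟹ non-retracing on the floor class (landed, p116482). -/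
theorem hexNonRetracingFloor_of_uniformModulus (hU : UniformModulus) : HexNonRetracingFloor :=
  Summit.CriticalPhenomena.SAWScalingLimit.Theorems.HexConjecture.RootLocality.nonRetracingFloor_of_uniformModulus hU

/-! ## Seat c2 glue: the two endpoint classes coincide on floor domains (landing as
`Theorems/SAWDevelopingMapHexConjectureBoundaryUniversality.lean`; reproduced here so that the skeleton is self-contained) -/

/-- In a domain above the line `im z = h`, no `Ω_δ`-edge reaches a vertex whose rescaled centre is on or below that line. -/
theorem not_hexDomainGraph_adj_of_im_le {Ω : Set ℂ} {h : ℝ} (hΩ : Ω ⊆ {z : ℂ | h < z.im}) {δ : ℝ}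
    {v u : HexVertex} (hu : ((δ : ℂ) * hexCenter u).im ≤ h) : ¬ (hexDomainGraph Ω δ).Adj v u := by
  intro hadj
  have huΩ : u ∈ embMeshDomain hexGraph hexCenter Ω δ := ((embDomainGraph_adj_iff _ _).1 hadj).2.2
  have : h < ((δ : ℂ) * hexCenter u).im := hΩ (embMeshDomain_subset _ _ _ _ huΩ)
  exact absurd this (not_lt.2 hu)

/-- Distinct vertices joined in `Ω_δ` are vertices of `Ω_δ`. -/
theorem mem_embMeshDomain_of_reachable_ne {V : Type*} {G : SimpleGraph V} {emb : V → ℂ} {Ω : Set ℂ} {δ : ℝ}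
    {a b : V} (hab : a ≠ b) (h : (embDomainGraph G emb Ω δ).Reachable a b) : a ∈ embMeshDomain G emb Ω δ := by
  obtain ⟨p⟩ := h
  cases p with
  | nil => exact absurd rfl hab
  | cons hadj _ => exact ((embDomainGraph_adj_iff G emb).1 hadj).2.1

/-- Floor-vertex endpoints are discrete-boundary endpoints, eventually (floor domains). -/
theorem eventually_discreteBoundary_of_floorVertex {D : DobrushinDomain} {a b : ℝ → HexVertex}
    (hD : D.carrier ⊆ {z : ℂ | (D.pt 0).im < z.im}) (h01 : (D.pt 1).im = (D.pt 0).im)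
    (hab : IsEmbEndpointApprox hexGraph hexCenter D a b)
    (hfl : ∀ᶠ δ : ℝ in 𝓝[>] 0,
      (∃ u : HexVertex, hexGraph.Adj (a δ) u ∧ ((δ : ℂ) * hexCenter u).im ≤ (D.pt 0).im) ∧
      (∃ u : HexVertex, hexGraph.Adj (b δ) u ∧ ((δ : ℂ) * hexCenter u).im ≤ (D.pt 1).im)) :
    ∀ᶠ δ : ℝ in 𝓝[>] 0,
      (a δ ∈ embMeshDomain hexGraph hexCenter D.carrier δ ∧
        ∃ w, hexGraph.Adj (a δ) w ∧ ¬ (hexDomainGraph D.carrier δ).Adj (a δ) w) ∧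
      (b δ ∈ embMeshDomain hexGraph hexCenter D.carrier δ ∧
        ∃ w, hexGraph.Adj (b δ) w ∧ ¬ (hexDomainGraph D.carrier δ).Adj (b δ) w) := by
  filter_upwards [hfl, hab.reachable,
    Summit.CriticalPhenomena.SAWScalingLimit.Cruxes.HexConjecture.NonVacuity.IsEmbEndpointApprox.eventually_ne hab]
    with δ hδ hreach hne
  obtain ⟨⟨u, hu, hui⟩, ⟨u', hu', hui'⟩⟩ := hδ
  rw [h01] at hui'
  exact ⟨⟨mem_embMeshDomain_of_reachable_ne hne hreach, u, hu, not_hexDomainGraph_adj_of_im_le hD hui⟩,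
    ⟨mem_embMeshDomain_of_reachable_ne (Ne.symm hne) hreach.symm, u', hu', not_hexDomainGraph_adj_of_im_le hD hui'⟩⟩

/-- Discrete-boundary endpoints are floor-vertex endpoints, eventually (floor domains; landed pieces
`stub_avoidanceCocycle_floorEndpoint`, `eventually_adj_mem_ball`). -/
theorem eventually_floorVertex_of_discreteBoundary {D : DobrushinDomain} {ρ : ℝ} {a b : ℝ → HexVertex} (hρ : 0 < ρ)
    (hflat0 : D.carrier ∩ Metric.ball (D.pt 0) ρ = {z : ℂ | (D.pt 0).im < z.im} ∩ Metric.ball (D.pt 0) ρ)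
    (hflat1 : D.carrier ∩ Metric.ball (D.pt 1) ρ = {z : ℂ | (D.pt 1).im < z.im} ∩ Metric.ball (D.pt 1) ρ)
    (hab : IsEmbEndpointApprox hexGraph hexCenter D a b)
    (hbd : ∀ᶠ δ : ℝ in 𝓝[>] 0,
      (a δ ∈ embMeshDomain hexGraph hexCenter D.carrier δ ∧
        ∃ w, hexGraph.Adj (a δ) w ∧ ¬ (hexDomainGraph D.carrier δ).Adj (a δ) w) ∧
      (b δ ∈ embMeshDomain hexGraph hexCenter D.carrier δ ∧
        ∃ w, hexGraph.Adj (b δ) w ∧ ¬ (hexDomainGraph D.carrier δ).Adj (b δ) w)) :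
    ∀ᶠ δ : ℝ in 𝓝[>] 0,
      (∃ u : HexVertex, hexGraph.Adj (a δ) u ∧ ((δ : ℂ) * hexCenter u).im ≤ (D.pt 0).im) ∧
      (∃ u : HexVertex, hexGraph.Adj (b δ) u ∧ ((δ : ℂ) * hexCenter u).im ≤ (D.pt 1).im) := by
  filter_upwards [hbd,
    Summit.CriticalPhenomena.SAWScalingLimit.Theorems.ObservableToSLE.FloorRatio.eventually_adj_mem_ball hρ hab.tendsto_fst,
    Summit.CriticalPhenomena.SAWScalingLimit.Theorems.ObservableToSLE.FloorRatio.eventually_adj_mem_ball hρ hab.tendsto_snd]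
    with δ h hBa hBb
  obtain ⟨⟨haΩ, wa, hwa, hna⟩, ⟨hbΩ, wb, hwb, hnb⟩⟩ := h
  exact ⟨⟨wa, hwa, Summit.CriticalPhenomena.SAWScalingLimit.Theorems.HexConjecture.RootLocality.stub_avoidanceCocycle_floorEndpoint
      _ _ _ _ _ _ hflat0 (hBa _ (Or.inl rfl)) (hBa _ (Or.inr hwa)) haΩ hwa hna⟩,
    ⟨wb, hwb, Summit.CriticalPhenomena.SAWScalingLimit.Theorems.HexConjecture.RootLocality.stub_avoidanceCocycle_floorEndpoint
      _ _ _ _ _ _ hflat1 (hBb _ (Or.inl rfl)) (hBb _ (Or.inr hwb)) hbΩ hwb hnb⟩⟩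

/-- **The two floor-class convergence statements are equivalent** (floor-vertex endpoints ⟺ discrete-boundary endpoints). -/
theorem floorConvergence_iff_hexConjectureFloor : FloorConvergence ↔ HexConjectureFloor := by
  constructor
  · intro h D ρ a b hfl hab hbd
    exact h D ρ a b hfl ⟨hab, eventually_floorVertex_of_discreteBoundary hfl.1 hfl.2.2.2.1 hfl.2.2.2.2 hab hbd⟩
  · intro h D ρ a b hfl hend
    exact h D ρ a b hfl hend.1 (eventually_discreteBoundary_of_floorVertex hfl.2.2.1 hfl.2.1 hend.1 hend.2)

/-- **One residual for two cruxes**: 10472's (E) ⟺ this line's former stub 7♭. -/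
theorem marksAndEndpointsFloor_iff_boundaryUniversality : MarksAndEndpointsFloor ↔ BoundaryUniversality :=
  Iff.imp floorConvergence_iff_hexConjectureFloor.symm Iff.rfl

/-- (E) is implied by the crux: not refutable short of refuting DCS Conjecture 1. -/
theorem boundaryUniversality_of_hexConjecture
    (h : Summit.CriticalPhenomena.SAWScalingLimit.Theses.SAWHexUniversality.HexConjecture) : BoundaryUniversality :=
  fun _ => h

/-- The former stub 7♭ from the registered stub 7♯. -/
theorem marksAndEndpointsFloor_holds : MarksAndEndpointsFloor :=
  marksAndEndpointsFloor_iff_boundaryUniversality.2 stub_boundaryUniversality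

/-- The crux decl is statement 7♭'s conclusion (definitionally). -/
theorem marksAndEndpointsFloor_iff :
    MarksAndEndpointsFloor ↔ (HexConjectureFloor → Summit.CriticalPhenomena.SAWScalingLimit.Theses.SAWHexUniversality.HexConjecture) :=
  Iff.rfl

/-! ## Name-keyed aliases of the statements (the hypotheses of the composition) -/
namespace Registered

/-- Alias of `FloorRatioLimit` keyed by the registered stub name. -/
abbrev stub_floorRatioLimit : Prop := FloorRatioLimit
/-- Alias of `WindowTwoPointLowerBound` keyed by the registered stub name. -/
abbrev stub_windowTwoPointLowerBound : Prop := WindowTwoPointLowerBound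
/-- Alias of `TriDlLowerRegular` keyed by the registered stub name. -/
abbrev stub_triDlLowerRegular : Prop := TriDlLowerRegular
/-- Alias of `TriDlDoubling` keyed by the registered stub name. -/
abbrev stub_triDlDoubling : Prop := TriDlDoubling
/-- Alias of `SideFloorComparison` keyed by the registered stub name (c11, from s2's line card). -/
abbrev stub_sideFloorComparison : Prop := SideFloorComparison
/-- Alias of the glue SFB ⟹ WTLB keyed by the registered stub name (c11). -/
abbrev stub_windowTwoPoint_of_sideFloorComparison : Prop := (∃ C : ℝ, ∃ L₀ : ℕ, ∀ L : ℕ, L₀ ≤ L → Literature.Probability.RandomPlanarGeometry.SAW.HV.triDl L ≤ C * ∑ d ∈ Finset.Icc ((L : ℤ) / 4) ((L : ℤ) / 2), ∑ P ∈ (Literature.Probability.RandomPlanarGeometry.SAW.HV.midWalks (Literature.Probability.RandomPlanarGeometry.SAW.HV.triV L)).filter (fun P => Literature.Probability.RandomPlanarGeometry.SAW.HV.finalDart P = ((d, 0, false), (d, -1, true)) ∨ Literature.Probability.RandomPlanarGeometry.SAW.HV.finalDart P = ((d, -1, true), (d, 0, false))), Literature.Probability.RandomPlanarGeometry.SAW.hexCriticalFugacity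 ^ Literature.Probability.RandomPlanarGeometry.SAW.HV.mwLen P) → (∃ θa θb C : ℝ, 0 < θa ∧ θa < θb ∧ θb ≤ 1 / 4 ∧ 0 < C ∧ ∃ R₀ : ℝ, 0 < R₀ ∧ ∀ R : ℝ, R₀ ≤ R → ∀ (x : Literature.Probability.LatticeModels.Site 2) (B : Finset Literature.Probability.LatticeModels.HexVertex) (S' : Finset ℤ), (∀ v : Literature.Probability.LatticeModels.HexVertex, v ∈ B ↔ (x 1 ≤ v.1 1 ∧ dist (Literature.Probability.LatticeModels.hexCenter v) (Literature.Probability.RandomPlanarGeometry.SAW.hexMidpoint s((x - Pi.single 1 1, 1), (x, 0))) ≤ R)) → (∀ d : ℤ, d ∈ S' ↔ (θa * R ≤ (d : ℝ) ∧ (d : ℝ) ≤ θb * R)) → Literature.Probability.RandomPlanarGeometry.SAW.HV.triDl ⌊R / 4⌋₊ ≤ C * ∑ d ∈ S', ∑ γ : Literature.Probability.RandomPlanarGeometry.SAW.HexMidEdgeSAW B s((x - Pi.single 1 1, 1), (x, 0)) s((x + Pi.single 0 d - Pi.single 1 1, 1), (x + Pi.single 0 d, 0)), Literature.Probability.RandomPlanarGeometry.SAW.hexCriticalFugacity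 ^ γ.length)
/-- Alias of the unit-step regularity statement keyed by the registered stub name (c11). -/
abbrev stub_triDlStep : Prop := ∀ L : ℕ, (2 - Real.sqrt 2) * HV.triDl L ≤ HV.triDl (L + 1)
/-- Alias of `HalfPlaneGramPositivity` keyed by the registered stub name (c12 ← s3). -/
abbrev stub_halfPlaneGramPositivity : Prop := HalfPlaneGramPositivity
/-- Alias of the glue positivity ⟹ Bochner keyed by the registered stub name (c12 ← s3). -/
abbrev stub_bochnerIneq_of_positivity : Prop := HalfPlaneGramPositivity → HalfPlaneBochnerIneq
/-- Alias of the glue Bochner ∧ AvgTF ⟹ REG keyed by the registered stub name (c12 ← s3). -/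
abbrev stub_reg_of_bochner_avgTail : Prop := HalfPlaneBochnerIneq → AverageTailFraction → TriDlLowerRegular
/-- Alias of `AverageTailFraction` keyed by the (v13) stub name (c12 ← s3). -/
abbrev stub_averageTailFraction : Prop := AverageTailFraction
/-- Alias of `UniformModulus` keyed by the registered stub name. -/
abbrev stub_uniformModulus : Prop := UniformModulus
/-- Alias of `BoundaryUniversality` keyed by the registered stub name. -/
abbrev stub_boundaryUniversality : Prop := BoundaryUniversality

end Registered

/-! ## Proved glue -/

/-- The polyline of a lattice SAW starts at its embedded first vertex. -/
theorem curve_source_eq {Ω : Set ℂ} {δ : ℝ} {u v : HexVertex} (γ : HexDomainSAW Ω δ u v) :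
    γ.curve.source = (δ : ℂ) * hexCenter u :=
  SimpleGraph.Walk.toCurve_apply_zero _ _

/-- The polyline of a lattice SAW ends at its embedded last vertex. -/
theorem curve_target_eq {Ω : Set ℂ} {δ : ℝ} {u v : HexVertex} (γ : HexDomainSAW Ω δ u v) :
    γ.curve.target = (δ : ℂ) * hexCenter v :=
  SimpleGraph.Walk.toCurve_apply_one _ _

/-- THE REACH OF THE LINE ON THE FLOOR CLASS FROM THE COCYCLE (kernel-checked): statements 3♭/3♯'s conclusion, 4♭, 5♭, 6 give the
crux on the floor class.  Range identification is fed by the floor cocycle, the curve upgrade by the range limit, the deterministic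
endpoints of the lattice polylines (`curve_source_eq/target_eq` with `IsEmbEndpointApprox.tendsto_fst/snd` — the load-bearing clauses of
`Negative.hexConjecture_false_without_tendsto_*`), a.e.-measurability for the discrete σ-algebra, and non-retracing. -/
theorem hexConjectureFloor_of_cocycle (hC : HexAvoidanceCocycleFloor) (h4 : RangeIdentificationFloor)
    (h5 : HexNonRetracingFloor) (h6 : CurveUpgrade) : HexConjectureFloor := by
  intro D ρ a b hfl happ hbd
  obtain ⟨Γ, hΓ, hrange⟩ := h4 hC D ρ a b hfl happ hbd
  exact h6 D (fun δ => HexDomainSAW D.carrier δ (a δ) (b δ)) (fun δ γ => γ.curve)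
    (fun δ => hexSAWLaw D.carrier δ (a δ) (b δ)) Γ
    (fun δ => (δ : ℂ) * hexCenter (a δ)) (fun δ => (δ : ℂ) * hexCenter (b δ)) hΓ
    (Eventually.of_forall fun δ => (EmbDomainSAW.measurable_of_top _).aemeasurable) hrange
    (fun δ γ => curve_source_eq γ) (fun δ γ => curve_target_eq γ) happ.tendsto_fst happ.tendsto_snd
    (h5 D ρ a b hfl happ hbd)

/-- The reach of the line from the WEAKENED statement 1♯ with the WINDOW TWO-POINT lever 2♮♮ (statements 1♯, 2♮♮, 5♭; 2♮♮ ⟹ 2♮ ⟹ 3♮, 4♭, 6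
landed and discharged inside) — PRIMARY after the c8 reshape. -/
theorem hexConjectureFloor_of_line_windowTwoPoint (hF : FloorRatioLimit) (hW : WindowTwoPointLowerBound)
    (h5 : HexNonRetracingFloor) : HexConjectureFloor :=
  hexConjectureFloor_of_cocycle (avoidanceCocycleFloorFromWindowTwoPoint_holds hF hW) rangeIdentificationFloor_holds h5
    curveUpgrade_holds

/-- The reach of the line from the WEAKENED statement 1♯ with the `η`-FREE lever 2♮ (statements 1♯, 2♮, 5♭; 3♮, 4♭, 6 landed
and discharged inside) — PRIMARY after the c6 reshape. -/
theorem hexConjectureFloor_of_line_aspect (hF : FloorRatioLimit) (hA : ArchAspectBound) (h5 : HexNonRetracingFloor) :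
    HexConjectureFloor :=
  hexConjectureFloor_of_cocycle (avoidanceCocycleFloorFromAspect_holds hF hA) rangeIdentificationFloor_holds h5 curveUpgrade_holds

/-- The reach of the line from the WEAKENED statement 1♯ with the WINDOW-AVERAGED lever (statements 1♯, 2♭♭, 5♭; 3♭♭, 4♭, 6 landed
and discharged inside) — primary after the c5 reshape, alternative after c6. -/
theorem hexConjectureFloor_of_line (hF : FloorRatioLimit) (hW : WindowArchLocality) (h5 : HexNonRetracingFloor) :
    HexConjectureFloor :=
  hexConjectureFloor_of_cocycle (avoidanceCocycleFloorFromWindow_holds hF hW) rangeIdentificationFloor_holds h5 curveUpgrade_holds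

/-- The reach of the line from 1♯ with the lever in POSITIVE POINTWISE form 2♯ (statements 1♯, 2♯, 5♭) — now a corollary via 2♯ ⟹ 2♭♭. -/
theorem hexConjectureFloor_of_line_arch (hF : FloorRatioLimit) (hT : HalfPlaneArchTightness) (h5 : HexNonRetracingFloor) :
    HexConjectureFloor :=
  hexConjectureFloor_of_line hF (windowArchLocality_of_halfPlaneArchTightness hT) h5

/-- The reach of the line from statement 1 with the lever in POSITIVE form (statements 1, 2♯, 5♭). -/
theorem hexConjectureFloor_of_line_observable (h1 : ObservableLimit) (hT : HalfPlaneArchTightness) (h5 : HexNonRetracingFloor) :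
    HexConjectureFloor :=
  hexConjectureFloor_of_cocycle (avoidanceCocycleFloorFromArch_holds h1 hT) rangeIdentificationFloor_holds h5 curveUpgrade_holds

/-- The reach of the line with the lever in PHASE form (statements 1, 2, 5♭; 3♭, 4♭, 6 landed and discharged inside). -/
theorem hexConjectureFloor_of_line_rootDominance (h1 : ObservableLimit) (h2 : RootDominance) (h5 : HexNonRetracingFloor) :
    HexConjectureFloor :=
  hexConjectureFloor_of_cocycle (avoidanceCocycleFloorFromObservable_holds h1 h2) rangeIdentificationFloor_holds h5
    curveUpgrade_holds

/-- RECORD — the reach of the line on the FLAT-boundary class, closed modulo the retired canonical transfer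
`CanonicalTransferFlat` and the flat non-retracing estimate (both now plain hypotheses, no `sorry`). -/
theorem hexConjectureFlatBoundary_of_line (h1 : ObservableLimit) (h2 : RootDominance)
    (h3 : AvoidanceCocycleFromObservable) (hCT : CanonicalTransferFlat) (h4 : RangeIdentification)
    (h5 : HexNonRetracing) (h6 : CurveUpgrade) : HexConjectureFlatBoundary := by
  intro D ρ a b hρ hflat happ hbd
  obtain ⟨Γ, hΓ, hrange⟩ := h4 (h3 h1 h2 hCT) D ρ a b hρ hflat happ hbd
  exact h6 D (fun δ => HexDomainSAW D.carrier δ (a δ) (b δ)) (fun δ γ => γ.curve)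
    (fun δ => hexSAWLaw D.carrier δ (a δ) (b δ)) Γ
    (fun δ => (δ : ℂ) * hexCenter (a δ)) (fun δ => (δ : ℂ) * hexCenter (b δ)) hΓ
    (Eventually.of_forall fun δ => (EmbDomainSAW.measurable_of_top _).aemeasurable) hrange
    (fun δ γ => curve_source_eq γ) (fun δ γ => curve_target_eq γ) happ.tendsto_fst happ.tendsto_snd
    (h5 D ρ a b hρ hflat happ hbd)

/-- The flat-boundary reach contains the floor reach (the floor class is a subclass). -/
theorem hexConjectureFloor_of_flatBoundary (h : HexConjectureFlatBoundary) : HexConjectureFloor :=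
  fun D ρ a b hfl happ hbd => h D ρ a b hfl.1 (Fin.forall_fin_two.2 ⟨hfl.2.2.2.1, hfl.2.2.2.2⟩) happ hbd

/-- The printed (discrete-boundary-endpoint) reading of the conjecture, the disprover's
`Boundary.HexConjectureBoundaryEndpoints`, contains the floor class: the foreign stub 7♭ is (the floor case of) the
CONVERSE of `Boundary.boundaryEndpoints_of_hexConjecture`. -/
theorem floor_of_boundaryEndpoints
    (h : Summit.CriticalPhenomena.SAWScalingLimit.Cruxes.HexConjecture.Boundary.HexConjectureBoundaryEndpoints) :
    HexConjectureFloor :=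
  fun D _ a b _ happ hbd => h D a b happ hbd

/-! ## The composition: the stubs imply the crux, by name -/

/-- The floor class in 10472's convention from the line: statements 1♯, 2♮♮, 5♯ (2♮, 3♮, 4♭, 6 LANDED and discharged inside) — c8. -/
theorem floorConvergence_of_line_windowTwoPoint (hF : FloorRatioLimit) (hW : WindowTwoPointLowerBound) (hU : UniformModulus) :
    FloorConvergence :=
  floorConvergence_iff_hexConjectureFloor.2
    (hexConjectureFloor_of_line_windowTwoPoint hF hW (hexNonRetracingFloor_of_uniformModulus hU))

/-- The floor class in 10472's convention from the line: statements 1♯, 2♮, 5♯ (3♮, 4♭, 6 LANDED and discharged inside) — c6. -/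
theorem floorConvergence_of_line_aspect (hF : FloorRatioLimit) (hA : ArchAspectBound) (hU : UniformModulus) :
    FloorConvergence :=
  floorConvergence_iff_hexConjectureFloor.2 (hexConjectureFloor_of_line_aspect hF hA (hexNonRetracingFloor_of_uniformModulus hU))

/-- The floor class in 10472's convention from the line: statements 1♯, 2♭♭, 5♯ (3♭♭, 4♭, 6 LANDED and discharged inside) — c5. -/
theorem floorConvergence_of_line (hF : FloorRatioLimit) (hW : WindowArchLocality) (hU : UniformModulus) :
    FloorConvergence :=
  floorConvergence_iff_hexConjectureFloor.2 (hexConjectureFloor_of_line hF hW (hexNonRetracingFloor_of_uniformModulus hU))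

/-- `HexConjecture` from the registered stubs (pure logic; no `sorry` outside the stubs) — PRIMARY composition after seat c8's reshape:
stubs 1♯ (floor-ratio limit ⟸ stmt-14003), 2♮♮ (WINDOW TWO-POINT LOWER BOUND), 5♯ (uniform injectivity modulus, = 10472's stub) give the floor
class (`floorConvergence_of_line_windowTwoPoint`; statements 2♮ ⟸ 2♮♮, 3♮, 4♭, 6 are LANDED), stub 7♯ (boundary universality, = 10472's (E))
passes to all Dobrushin domains and endpoint approximations. -/
theorem HexConjecture_of (hF : Registered.stub_floorRatioLimit) (hW : Registered.stub_windowTwoPointLowerBound)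
    (hU : Registered.stub_uniformModulus) (hE : Registered.stub_boundaryUniversality) :
    Summit.CriticalPhenomena.SAWScalingLimit.Theses.SAWHexUniversality.HexConjecture :=
  hE (floorConvergence_of_line_windowTwoPoint hF hW hU)

/-- The same composition concluding the decl of the payload route `SAWDevelopingMap` (identical body). -/
theorem HexConjecture_of' (hF : Registered.stub_floorRatioLimit) (hW : Registered.stub_windowTwoPointLowerBound)
    (hU : Registered.stub_uniformModulus) (hE : Registered.stub_boundaryUniversality) :
    Summit.CriticalPhenomena.SAWScalingLimit.Theses.SAWDevelopingMap.HexConjecture :=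
  hE (floorConvergence_of_line_windowTwoPoint hF hW hU)

/-- ALTERNATIVE composition with the c6 lever 2♮ (ARCH ASPECT BOUND, `η`-free; no longer registered — plain hypothesis). -/
theorem HexConjecture_of_aspectBound (hF : Registered.stub_floorRatioLimit) (hA : ArchAspectBound)
    (hU : Registered.stub_uniformModulus) (hE : Registered.stub_boundaryUniversality) :
    Summit.CriticalPhenomena.SAWScalingLimit.Theses.SAWDevelopingMap.HexConjecture :=
  hE (floorConvergence_of_line_aspect hF hA hU)

/-- ALTERNATIVE composition with the c5 lever 2♭♭ (WINDOW-AVERAGED arch locality; no longer registered — plain hypothesis). -/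
theorem HexConjecture_of_windowLocality (hF : Registered.stub_floorRatioLimit) (hW : WindowArchLocality)
    (hU : Registered.stub_uniformModulus) (hE : Registered.stub_boundaryUniversality) :
    Summit.CriticalPhenomena.SAWScalingLimit.Theses.SAWDevelopingMap.HexConjecture :=
  hE (floorConvergence_of_line hF hW hU)

/-- ALTERNATIVE composition through the c9 sufficient form 2♮♮-R of the lever (REG ⟹ WTLB ⟹ AAB ⟹ cocycle); since v12 REG is a derived /
hypothesis-level Prop, so this composition concludes the `SAWDevelopingMap` clone (identical body) — only all-DECLARED-stub compositions may
conclude the registered decl `SAWHexUniversality.HexConjecture` (skeleton audit `skeleton.extra-hypothesis`). -/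
theorem HexConjecture_of_reg (hF : Registered.stub_floorRatioLimit) (hR : Registered.stub_triDlLowerRegular)
    (hU : Registered.stub_uniformModulus) (hE : Registered.stub_boundaryUniversality) :
    Summit.CriticalPhenomena.SAWScalingLimit.Theses.SAWDevelopingMap.HexConjecture :=
  HexConjecture_of' hF (windowTwoPointLowerBound_of_triDlLowerRegular hR) hU hE

/-- ALTERNATIVE composition through the c10 sufficient form 2♮♮-D of the lever (DOUBLING ⟹ REG ⟹ WTLB ⟹ AAB ⟹ cocycle; hypothesis-level since v12). -/
theorem HexConjecture_of_doubling (hF : Registered.stub_floorRatioLimit) (hD : Registered.stub_triDlDoubling)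
    (hU : Registered.stub_uniformModulus) (hE : Registered.stub_boundaryUniversality) :
    Summit.CriticalPhenomena.SAWScalingLimit.Theses.SAWDevelopingMap.HexConjecture :=
  HexConjecture_of' hF (windowTwoPointLowerBound_of_triDlDoubling hD) hU hE

/-- ALTERNATIVE all-registered-stub composition through the POSITIVITY source of the lever (c12 ← s3): FRL, Gram positivity, the two
glue stubs, AvgTF, UIM, (E)  (positivity ⟹ Bochner ⟹ (with AvgTF) REG ⟹ WTLB ⟹ AAB ⟹ cocycle). -/
theorem HexConjecture_of_gram (hF : Registered.stub_floorRatioLimit) (hP : Registered.stub_halfPlaneGramPositivity)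
    (hB : Registered.stub_bochnerIneq_of_positivity) (hR : Registered.stub_reg_of_bochner_avgTail)
    (hT : Registered.stub_averageTailFraction)
    (hU : Registered.stub_uniformModulus) (hE : Registered.stub_boundaryUniversality) :
    Summit.CriticalPhenomena.SAWScalingLimit.Theses.SAWDevelopingMap.HexConjecture :=
  HexConjecture_of_reg hF (triDlLowerRegular_of_gram hP hB hR hT) hU hE

/-- ALTERNATIVE composition through the OBSERVABLE-side source of the lever (c11 ← s2): FRL, SFB, UIM, (E). -/
theorem HexConjecture_of_sideFloor (hF : Registered.stub_floorRatioLimit) (hS : Registered.stub_sideFloorComparison)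
    (hG : Registered.stub_windowTwoPoint_of_sideFloorComparison)
    (hU : Registered.stub_uniformModulus) (hE : Registered.stub_boundaryUniversality) :
    Summit.CriticalPhenomena.SAWScalingLimit.Theses.SAWDevelopingMap.HexConjecture :=
  HexConjecture_of' hF (hG hS) hU hE

/-- DERIVED composition through crux-10472's verbatim lever `HalfPlaneArchTightness` (2♯ ⟹ 2♭♭, p121715): a proof of 10472's
`stub_halfPlaneArchTightness` still closes this line.  (The alternative compositions whose hypotheses are not all REGISTERED stubs conclude the
`SAWDevelopingMap` clone of the crux — identical body, `hexConjecture_iff` — so that the skeleton audit's candidate set for the registered decl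
`SAWHexUniversality.HexConjecture` consists of all-stub compositions only.) -/
theorem HexConjecture_of_archTightness (hF : Registered.stub_floorRatioLimit) (hT : HalfPlaneArchTightness)
    (hU : Registered.stub_uniformModulus) (hE : Registered.stub_boundaryUniversality) :
    Summit.CriticalPhenomena.SAWScalingLimit.Theses.SAWDevelopingMap.HexConjecture :=
  HexConjecture_of_windowLocality hF (windowArchLocality_of_halfPlaneArchTightness hT) hU hE

/-- ALTERNATIVE composition with the WEAKER regularity stub 5♭ (non-retracing) in place of 5♯. -/
theorem HexConjecture_of_nonRetracing (hF : Registered.stub_floorRatioLimit) (hW : WindowArchLocality)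
    (h5 : HexNonRetracingFloor) (hE : Registered.stub_boundaryUniversality) :
    Summit.CriticalPhenomena.SAWScalingLimit.Theses.SAWDevelopingMap.HexConjecture :=
  hE (floorConvergence_iff_hexConjectureFloor.2 (hexConjectureFloor_of_line hF hW h5))

/-- ALTERNATIVE composition from statement 1 (`stub_observableLimit` = stmt-14003) with the window-averaged lever. -/
theorem HexConjecture_of_observable (h1 : ObservableLimit) (hW : WindowArchLocality)
    (h5 : HexNonRetracingFloor) (hE : Registered.stub_boundaryUniversality) :
    Summit.CriticalPhenomena.SAWScalingLimit.Theses.SAWDevelopingMap.HexConjecture :=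
  hE (floorConvergence_iff_hexConjectureFloor.2 (hexConjectureFloor_of_line (floorRatioLimit_of_observableLimit h1) hW h5))

/-- ALTERNATIVE composition with the lever in PHASE form (`RootDominance`, no longer registered). -/
theorem HexConjecture_of_rootDominance (h1 : ObservableLimit) (h2 : RootDominance)
    (h5 : HexNonRetracingFloor) (hE : Registered.stub_boundaryUniversality) :
    Summit.CriticalPhenomena.SAWScalingLimit.Theses.SAWDevelopingMap.HexConjecture :=
  hE (floorConvergence_iff_hexConjectureFloor.2 (hexConjectureFloor_of_line_rootDominance h1 h2 h5))

/-- The two route decls of the shared crux are the same statement (definitionally). -/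
theorem hexConjecture_iff : Summit.CriticalPhenomena.SAWScalingLimit.Theses.SAWHexUniversality.HexConjecture ↔ Summit.CriticalPhenomena.SAWScalingLimit.Theses.SAWDevelopingMap.HexConjecture := Iff.rfl

/-- **The assembly shape of the crux** (for the planners): DCS Conjecture 1 as typed ⟺ `FloorConvergence ∧ BoundaryUniversality`;
the first conjunct is a theorem modulo {`FloorRatioLimit` ⟸ stmt-14003, `WindowTwoPointLowerBound` ⟹ `ArchAspectBound` | `WindowArchLocality` ⟸ `HalfPlaneArchTightness`,
`UniformModulus`} (`floorConvergence_of_line_aspect` / `floorConvergence_of_line`), the second is the residual shared verbatim with crux stmt-10472. -/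
theorem hexConjecture_iff_floorConvergence_and_boundaryUniversality :
    Summit.CriticalPhenomena.SAWScalingLimit.Theses.SAWHexUniversality.HexConjecture ↔
      (FloorConvergence ∧ BoundaryUniversality) :=
  ⟨fun h => ⟨fun D _ a b _ hend => h D a b hend.1, fun _ => h⟩, fun h => h.2 h.1⟩

/-- Wiring check / the skeleton audit's `<Crux>_proof` form: the registered stubs feed `HexConjecture_of` as stated (closed modulo the
`sorry`s inside the open `stub_*`). -/
theorem HexConjecture_proof : Summit.CriticalPhenomena.SAWScalingLimit.Theses.SAWHexUniversality.HexConjecture :=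
  HexConjecture_of stub_floorRatioLimit stub_windowTwoPointLowerBound stub_uniformModulus stub_boundaryUniversality

/-- Same, for the `SAWDevelopingMap` decl. -/
theorem HexConjecture_proof' : Summit.CriticalPhenomena.SAWScalingLimit.Theses.SAWDevelopingMap.HexConjecture :=
  HexConjecture_of' stub_floorRatioLimit stub_windowTwoPointLowerBound stub_uniformModulus stub_boundaryUniversality

/- (c11) No zero-hypothesis `HexConjecture_proof_sideFloor` is declared: `#h21_check_skeleton` takes the FIRST crux-concluding theorem in
environment order as "the skeleton theorem" and reports `closed` for it; the hypothesis-style `HexConjecture_of_sideFloor` (all five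
hypotheses registered stubs, body sorry-free) is the SFB composition of record. -/

/-- Same, for the `SAWBrickWallHomotopy` decl (the route of lead seat c11; identical body, shared item stmt-0808). -/
theorem HexConjecture_proof'' : Summit.CriticalPhenomena.SAWScalingLimit.Theses.SAWBrickWallHomotopy.HexConjecture :=
  fun D a b h => HexConjecture_proof D a b h

end Summit.CriticalPhenomena.SAWScalingLimit.Cruxes.HexConjecture.RootLocalityReplacesLoewner

end
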